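import Literature.NumberTheory.Automorphic.BLZPeriodCocycleTransform

/-!
# Towards BLZ Proposition 5.1 — the collar extension and the argument principle

Bruggeman, Lewis and Zagier, *Period functions for Maass wave forms and cohomology*,
Mem. AMS 237 no. 1118 (2015) [BruggemanLewisZagier2015], Proposition 5.1 (p. 30; proof p. 31):
"If the discrete subgroup `Γ ⊂ G` is infinite, then `r`, `p` and `q` are injective."
This file continues `BLZPeriodCocycleProofs.lean` (§1–§8), `BLZPeriodCocycleHolomorphy.lean`
(§9–§16) and `BLZPeriodCocycleTransform.lean` (§17–§22) with §23–§28 of the road map (the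
statement is the named fact `BruggemanLewisZagier2015_prop_5_1` in `BLZPeriodCocycle.lean`).

## What is here (all proved)

* §23 `exists_collar_extension`: for `φ ∈ V_s^ω` the hybrid-model boundary function
  `Φ(t) = φ(t) R_t(z₀)^{-s}` is the restriction of a function holomorphic on
  `N = {|Re η| > T} ∪ {|Im η| > T} ∪ {|Im η| < δ}` and bounded near `∞` (local complexifications
  of `φ` glued by choice; the chart at `∞` from `ψ(t) = |t|^{-2s} φ(-1/t)`);
* §24 `hybridCoboundary_ofReal`, `hybridCoboundary_ball` (the coboundary hypothesis
  `r_γ = φ|γ - φ` in the hybrid model, `c_γ(η) = μ(η)^{-s} Φ(g⁻¹ η) - Φ(η)`, at real points and on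
  discs around them) and **`seed_functionalEquation`**: the twisted functional equation
  `D(g⁻¹ η) = μ(η)^s D(η)` of `D = Φ - h` and the branch-free identity `F'D - FD' = s(μ'/μ)FD`
  on a half-disc at a real point;
* §25 the loop lemmas: `circleIntegral_logDeriv_mem_zmultiples` (`∮ f'/f ∈ 2πiℤ`),
  `circleIntegral_logDeriv_ratioBase` (`∮ μ'/μ = -2πi`), `false_of_logDeriv_identity`;
* §26 geometry of the collar: `exists_far_element` (an infinite discrete `Γ` moves `z₀`
  arbitrarily far; Mathlib's properness of the action of `SL₂(ℝ)` on `ℍ`), isometry of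
  determinant-one elements, hyperbolic-distance bounds, connectedness of the collar and of thin
  annuli, finiteness of isolated zeros on compact sets;
* §27 **`collar_vanishing`**: `Φ = h` on the collar `ℍ ∩ N` (the argument principle of p. 31);
* §28 the conjugate system: `lewisZagierCocycle_conj`, `conj_coboundary_hypothesis`
  (`r[ū, s̄]` is the coboundary of `φ̃ = -conj ∘ φ - ū(z₀) κ`, `κ(t) = R_t(z₀)^{s̄}`).

## References

* [BruggemanLewisZagier2015] R. Bruggeman, J. Lewis, D. Zagier, *Period functions for Maass wave
  forms and cohomology*, Mem. Amer. Math. Soc. 237 (2015), no. 1118, doi:10.1090/memo/1118: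
  (1.6)–(1.7) p. 10; (1.9)–(1.10) p. 11; (2.1)–(2.2) pp. 11–12; (2.25) p. 16; (5.5a) p. 29;
  Proposition 5.1 pp. 30–31.
* R. Bruggeman, J. Lewis, D. Zagier, *Function theory related to the group PSL₂(ℝ)*, in
  *From Fourier analysis and number theory to Radon transforms and geometry*, Dev. Math. 28,
  Springer (2013), 107–201, §4.2, Theorem 4.2.
-/

noncomputable section

namespace Literature.NumberTheory.Automorphic

open _root_.UpperHalfPlane _root_.Complex _root_.Filter _root_.Set _root_.MeasureTheory
open scoped MatrixGroups Topology ComplexConjugate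
open Laplacian

/-! ## 23. The collar extension of an analytic vector (hybrid model)

An analytic vector `φ ∈ V_s^ω` is the boundary restriction of a holomorphic function on a
neighbourhood of `P¹(ℝ)` ((2.2), p. 12). In the hybrid normalisation of the companion paper the
relevant holomorphic function near `P¹(ℝ)` is `Φ(η) = φ(η) (R_η(z₀))^{-s}`: near finite points
`Φ(η) = Θ(η) ((η - z₀)(η - z̄₀)/y₀)^s` with `Θ` a holomorphic extension of `φ`, near `∞`
`Φ(η) = Ψ(-1/η) ((1 - z₀/η)(1 - z̄₀/η)/y₀)^s` with `Ψ` a holomorphic extension of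
`ψ(t) = |t|^{-2s} φ(-1/t)`. We glue the local extensions of `φ` by choice (two extensions agree
on the lens of their discs, which is convex and contains real points) and assemble a function
holomorphic on `{|Re η| > T} ∪ {|Im η| > H} ∪ {|Im η| < δ}`, equal to `φ(t) R_t(z₀)^{-s}` on `ℝ`
and bounded near `∞`. -/

section CollarExtension

variable {s : ℂ} {φ : ℝ → ℂ}

/-- **Gluing local complexifications.** If every real `t` carries a holomorphic function `Θ t`
on the disc `|η - t| < r t` that agrees with `φ` at the real points of the disc, then there is a
single function, holomorphic on `⋃_t {|η - t| < r t / 2}`, equal to `Θ t` on `{|η - t| < r t/2}`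
and to `φ` on `ℝ`. [cite: BruggemanLewisZagier2015, (2.2) p. 12] -/
theorem exists_glued_extension {r : ℝ → ℝ} (hr : ∀ t, 0 < r t) {Θ : ℝ → ℂ → ℂ}
    (hΘ : ∀ t, DifferentiableOn ℂ (Θ t) (Metric.ball (t : ℂ) (r t)))
    (hΘφ : ∀ t t' : ℝ, |t' - t| < r t → Θ t t' = φ t') :
    ∃ Θg : ℂ → ℂ, (∀ t : ℝ, ∀ η ∈ Metric.ball (t : ℂ) (r t / 2), Θg η = Θ t η) ∧
      (∀ t : ℝ, DifferentiableOn ℂ Θg (Metric.ball (t : ℂ) (r t / 2))) ∧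
      ∀ t : ℝ, Θg t = φ t := by
  classical
  -- two local extensions agree on the lens of their discs
  have hagree : ∀ t₁ t₂ : ℝ, ∀ η : ℂ, η ∈ Metric.ball (t₁ : ℂ) (r t₁) → η ∈ Metric.ball (t₂ : ℂ) (r t₂) →
      Θ t₁ η = Θ t₂ η := by
    intro t₁ t₂ η h₁ h₂
    set L : Set ℂ := Metric.ball (t₁ : ℂ) (r t₁) ∩ Metric.ball (t₂ : ℂ) (r t₂) with hL
    have hLo : IsOpen L := Metric.isOpen_ball.inter Metric.isOpen_ball
    have hLc : IsPreconnected L := ((convex_ball _ _).inter (convex_ball _ _)).isPreconnected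
    -- the real point `Re η` lies in the lens
    have hre₁ : |η.re - t₁| < r t₁ := by
      rw [Metric.mem_ball, dist_eq_norm] at h₁
      exact lt_of_le_of_lt (by simpa using Complex.abs_re_le_norm (η - t₁)) h₁
    have hre₂ : |η.re - t₂| < r t₂ := by
      rw [Metric.mem_ball, dist_eq_norm] at h₂
      exact lt_of_le_of_lt (by simpa using Complex.abs_re_le_norm (η - t₂)) h₂
    have hpL : ((η.re : ℝ) : ℂ) ∈ L := by
      refine ⟨?_, ?_⟩
      · rw [Metric.mem_ball, dist_eq_norm, ← Complex.ofReal_sub, Complex.norm_real, Real.norm_eq_abs]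
        exact hre₁
      · rw [Metric.mem_ball, dist_eq_norm, ← Complex.ofReal_sub, Complex.norm_real, Real.norm_eq_abs]
        exact hre₂
    -- near `Re η`, both extensions equal `φ` on the reals
    have hev : ∀ᶠ t : ℝ in 𝓝[≠] η.re, Θ t₁ t = Θ t₂ t := by
      have hc1 : Continuous (fun t : ℝ => |t - t₁|) := by fun_prop
      have hc2 : Continuous (fun t : ℝ => |t - t₂|) := by fun_prop
      have h1 : ∀ᶠ t : ℝ in 𝓝 η.re, |t - t₁| < r t₁ :=
        hc1.continuousAt.eventually_lt continuousAt_const hre₁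
      have h2 : ∀ᶠ t : ℝ in 𝓝 η.re, |t - t₂| < r t₂ :=
        hc2.continuousAt.eventually_lt continuousAt_const hre₂
      filter_upwards [nhdsWithin_le_nhds (h1.and h2)] with t ht
      rw [hΘφ t₁ t ht.1, hΘφ t₂ t ht.2]
    have heq := eqOn_of_eqOn_real hLo hLc hpL ((hΘ t₁).mono inter_subset_left)
      ((hΘ t₂).mono inter_subset_right) hev
    exact heq ⟨h₁, h₂⟩
  -- the glued function
  set Θg : ℂ → ℂ := fun η =>
    if h : ∃ t : ℝ, η ∈ Metric.ball (t : ℂ) (r t / 2) then Θ (Classical.choose h) η else 0 with hΘg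
  have hloc : ∀ t : ℝ, ∀ η ∈ Metric.ball (t : ℂ) (r t / 2), Θg η = Θ t η := by
    intro t η hη
    have hex : ∃ t' : ℝ, η ∈ Metric.ball (t' : ℂ) (r t' / 2) := ⟨t, hη⟩
    simp only [hΘg, dif_pos hex]
    have hc := Classical.choose_spec hex
    refine hagree _ _ η ?_ ?_
    · exact Metric.ball_subset_ball (by linarith [hr (Classical.choose hex)]) hc
    · exact Metric.ball_subset_ball (by linarith [hr t]) hη
  refine ⟨Θg, hloc, fun t => ?_, fun t => ?_⟩
  · intro η hη
    have hball : Metric.ball (t : ℂ) (r t / 2) ∈ 𝓝 η := Metric.isOpen_ball.mem_nhds hη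
    have hd : DifferentiableAt ℂ (Θ t) η :=
      (hΘ t).differentiableAt (Metric.isOpen_ball.mem_nhds (Metric.ball_subset_ball (by linarith [hr t]) hη))
    refine (hd.congr_of_eventuallyEq ?_).differentiableWithinAt
    filter_upwards [hball] with η' hη'
    exact hloc t η' hη'
  · rw [hloc t (t : ℂ) (Metric.mem_ball_self (by linarith [hr t]))]
    exact hΘφ t t (by simp [hr t])

/-- `x^{-s} = (x⁻¹)^s` off the negative real axis. [folklore] -/
theorem cpow_neg_eq_inv_cpow {x : ℂ} (hx : x.arg ≠ Real.pi) (s : ℂ) : x ^ (-s) = x⁻¹ ^ s := by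
  rw [Complex.inv_cpow _ _ hx, Complex.cpow_neg]

/-- For real `t` and `z₀ ∈ ℍ`, `R_t(z₀)` is a positive real; in particular its argument is `0`.
[cite: BruggemanLewisZagier2015, (1.6) p. 10] -/
theorem arg_poissonKernelC_ofReal (t : ℝ) {z₀ : ℂ} (hz₀ : 0 < z₀.im) :
    (poissonKernelC t z₀).arg = 0 := by
  rw [poissonKernelC_ofReal, Complex.arg_ofReal_of_nonneg (hypPoissonKernel_pos t hz₀).le]

/-- `R_t(z₀)⁻¹ = (t - z₀)(t - z̄₀)/y₀` (and the same formula for complex `t`). [folklore] -/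
theorem poissonKernelC_inv (η z₀ : ℂ) :
    (poissonKernelC η z₀)⁻¹ = (η - z₀) * (η - conj z₀) / (z₀.im : ℂ) := by
  rw [poissonKernelC_apply, inv_div]

/-- The finite-chart factor at a real point: `((t - z₀)(t - z̄₀)/y₀)^s = R_t(z₀)^{-s}`.
[cite: BruggemanLewisZagier2015, (2.2) p. 12] -/
theorem finiteChart_factor_ofReal (s : ℂ) (t : ℝ) {z₀ : ℂ} (hz₀ : 0 < z₀.im) :
    (((t : ℂ) - z₀) * ((t : ℂ) - conj z₀) / (z₀.im : ℂ)) ^ s = (poissonKernelC t z₀) ^ (-s) := by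
  rw [← poissonKernelC_inv, cpow_neg_eq_inv_cpow]
  rw [arg_poissonKernelC_ofReal t hz₀]
  exact Real.pi_ne_zero.symm

/-- Positive real powers: `((a : ℂ))^s ((b : ℂ))^s = ((ab : ℂ))^s` for `a, b ≥ 0`. [folklore] -/
theorem ofReal_cpow_mul_ofReal_cpow {a b : ℝ} (ha : 0 ≤ a) (hb : 0 ≤ b) (s : ℂ) :
    ((a : ℂ)) ^ s * ((b : ℂ)) ^ s = (((a * b : ℝ)) : ℂ) ^ s := by
  rw [Complex.ofReal_mul, Complex.mul_cpow_ofReal_nonneg ha hb]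

/-- The `∞`-chart factor at a real point `t ≠ 0`: with `ψ(τ) = |τ|^{-2s} φ(-1/τ)`,
`ψ(-1/t) ((t - z₀)(t - z̄₀)/(y₀ t²))^s = φ(t) R_t(z₀)^{-s}`.
[cite: BruggemanLewisZagier2015, (2.2) p. 12] -/
theorem inftyChart_value_ofReal (s : ℂ) {φ ψ : ℝ → ℂ}
    (hψ : ∀ t : ℝ, t ≠ 0 → ψ t = ((|t| : ℝ) : ℂ) ^ (-(2 * s)) * φ (-1 / t))
    {t : ℝ} (ht : t ≠ 0) {z₀ : ℂ} (hz₀ : 0 < z₀.im) :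
    ψ (-1 / t) * (((t : ℂ) - z₀) * ((t : ℂ) - conj z₀) / ((z₀.im : ℂ) * (t : ℂ) ^ 2)) ^ s =
      φ t * (poissonKernelC t z₀) ^ (-s) := by
  have ht' : (-1 / t : ℝ) ≠ 0 := by
    rw [div_ne_zero_iff]; exact ⟨by norm_num, ht⟩
  rw [hψ (-1 / t) ht']
  have e1 : (-1 / (-1 / t) : ℝ) = t := by field_simp
  rw [e1]
  set P : ℝ := hypPoissonKernel t z₀ with hP
  have hP0 : 0 < P := hypPoissonKernel_pos t hz₀
  have hPc : poissonKernelC t z₀ = (P : ℂ) := poissonKernelC_ofReal t z₀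
  set X : ℂ := (((t ^ 2)⁻¹ : ℝ) : ℂ) with hX
  set Y : ℂ := ((P⁻¹ : ℝ) : ℂ) with hY
  have ht0 : (t : ℂ) ≠ 0 := by exact_mod_cast ht
  have hy0 : (z₀.im : ℂ) ≠ 0 := by exact_mod_cast hz₀.ne'
  have hbase : ((t : ℂ) - z₀) * ((t : ℂ) - conj z₀) / ((z₀.im : ℂ) * (t : ℂ) ^ 2) = Y * X := by
    have h1 : ((t : ℂ) - z₀) * ((t : ℂ) - conj z₀) / (z₀.im : ℂ) = (P : ℂ)⁻¹ := by
      rw [← hPc, poissonKernelC_inv]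
    have h2 : ((t : ℂ) - z₀) * ((t : ℂ) - conj z₀) / ((z₀.im : ℂ) * (t : ℂ) ^ 2) =
        (((t : ℂ) - z₀) * ((t : ℂ) - conj z₀) / (z₀.im : ℂ)) * ((t : ℂ) ^ 2)⁻¹ := by
      field_simp
    rw [h2, h1, hY, hX]
    push_cast
    ring
  have habs : (((|(-1 / t : ℝ)| : ℝ)) : ℂ) = (((|t|⁻¹ : ℝ)) : ℂ) := by
    rw [abs_div, abs_neg, abs_one, one_div]
  rw [hbase, habs]
  have hX0 : X ≠ 0 := by
    rw [hX]; exact_mod_cast inv_ne_zero (pow_ne_zero 2 ht)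
  have hXs0 : X ^ s ≠ 0 := by
    rw [Ne, Complex.cpow_eq_zero_iff, not_and_or]; left; exact hX0
  have hnn : (0 : ℝ) ≤ |t|⁻¹ := by positivity
  have h0 : (((|t|⁻¹ : ℝ)) : ℂ) ≠ 0 := by exact_mod_cast inv_ne_zero (abs_ne_zero.mpr ht)
  have hr : (|t|⁻¹ * |t|⁻¹ : ℝ) = (t ^ 2)⁻¹ := by rw [← mul_inv, abs_mul_abs_self, sq]
  have hA : (((|t|⁻¹ : ℝ)) : ℂ) ^ (-(2 * s)) = (X ^ s)⁻¹ := by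
    rw [Complex.cpow_neg, two_mul, Complex.cpow_add _ _ h0, ofReal_cpow_mul_ofReal_cpow hnn hnn, hr]
  have hsplit : (Y * X) ^ s = Y ^ s * X ^ s := by
    rw [hY, hX, Complex.mul_cpow_ofReal_nonneg (by positivity) (by positivity)]
  have harg : (poissonKernelC t z₀).arg ≠ Real.pi := by
    rw [arg_poissonKernelC_ofReal t hz₀]; exact Real.pi_ne_zero.symm
  have hPinv : Y ^ s = (poissonKernelC t z₀) ^ (-s) := by
    rw [cpow_neg_eq_inv_cpow harg, hPc, hY, Complex.ofReal_inv]
  rw [hA, hsplit, hPinv]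
  calc (X ^ s)⁻¹ * φ t * (poissonKernelC t z₀ ^ (-s) * X ^ s)
      = φ t * poissonKernelC t z₀ ^ (-s) * ((X ^ s)⁻¹ * X ^ s) := by ring
    _ = φ t * poissonKernelC t z₀ ^ (-s) := by rw [inv_mul_cancel₀ hXs0, mul_one]

/-- The base of the `∞`-chart factor has positive real part and is bounded for `|η| ≥ 4|z₀| + 4`.
[folklore] -/
theorem re_inftyBase_pos {z₀ η : ℂ} (hz₀ : 0 < z₀.im) (hη : 4 * (‖z₀‖ + 1) ≤ ‖η‖) :
    0 < ((η - z₀) * (η - conj z₀) / ((z₀.im : ℂ) * η ^ 2)).re ∧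
      ‖(η - z₀) * (η - conj z₀) / ((z₀.im : ℂ) * η ^ 2)‖ ≤ 4 / z₀.im := by
  have hη0 : η ≠ 0 := by
    intro h; rw [h, norm_zero] at hη; linarith [norm_nonneg z₀]
  have hηpos : 0 < ‖η‖ := norm_pos_iff.mpr hη0
  set a : ℂ := z₀ / η with ha
  set b : ℂ := conj z₀ / η with hb
  have hab : (η - z₀) * (η - conj z₀) / ((z₀.im : ℂ) * η ^ 2) = (1 - a) * (1 - b) / (z₀.im : ℂ) := by
    simp only [ha, hb]
    field_simp
  have hna : ‖a‖ ≤ 1 / 4 := by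
    rw [ha, norm_div, div_le_iff₀ hηpos]
    linarith
  have hnb : ‖b‖ ≤ 1 / 4 := by
    rw [hb, norm_div, Complex.norm_conj, div_le_iff₀ hηpos]
    linarith
  have hre : 7 / 16 ≤ ((1 - a) * (1 - b)).re := by
    have e : ((1 - a) * (1 - b)).re = 1 - a.re - b.re + (a * b).re := by
      simp [Complex.mul_re]; ring
    rw [e]
    have h1 : a.re ≤ 1 / 4 := (Complex.re_le_norm a).trans hna
    have h2 : b.re ≤ 1 / 4 := (Complex.re_le_norm b).trans hnb
    have h3 : -(1 / 16) ≤ (a * b).re := by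
      have := Complex.abs_re_le_norm (a * b)
      rw [norm_mul] at this
      have h4 : ‖a‖ * ‖b‖ ≤ 1 / 4 * (1 / 4) :=
        mul_le_mul hna hnb (norm_nonneg _) (by norm_num)
      have := neg_abs_le ((a * b).re)
      linarith
    linarith
  have hnorm : ‖(1 - a) * (1 - b)‖ ≤ 4 := by
    rw [norm_mul]
    have h1 : ‖1 - a‖ ≤ 2 := by
      calc ‖1 - a‖ ≤ ‖(1 : ℂ)‖ + ‖a‖ := norm_sub_le _ _
        _ ≤ 2 := by rw [norm_one]; linarith
    have h2 : ‖1 - b‖ ≤ 2 := by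
      calc ‖1 - b‖ ≤ ‖(1 : ℂ)‖ + ‖b‖ := norm_sub_le _ _
        _ ≤ 2 := by rw [norm_one]; linarith
    calc ‖1 - a‖ * ‖1 - b‖ ≤ 2 * 2 := mul_le_mul h1 h2 (norm_nonneg _) (by norm_num)
      _ = 4 := by norm_num
  rw [hab]
  constructor
  · rw [Complex.div_ofReal_re]
    exact div_pos (by linarith) hz₀
  · rw [norm_div, Complex.norm_real, Real.norm_eq_abs, abs_of_pos hz₀]
    exact div_le_div_of_nonneg_right hnorm hz₀.le

/-- The base of the finite-chart factor has positive real part on the strip `|Im η| < y₀`.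
[folklore] -/
theorem re_finiteBase_pos {z₀ η : ℂ} (hz₀ : 0 < z₀.im) (hη : |η.im| < z₀.im) :
    0 < ((η - z₀) * (η - conj z₀) / (z₀.im : ℂ)).re := by
  rw [Complex.div_ofReal_re]
  refine div_pos ?_ hz₀
  have e : ((η - z₀) * (η - conj z₀)).re = (η.re - z₀.re) ^ 2 + (z₀.im ^ 2 - η.im ^ 2) := by
    simp only [Complex.mul_re, Complex.sub_re, Complex.sub_im, Complex.conj_re, Complex.conj_im]
    ring
  rw [e]
  have h1 : η.im ^ 2 < z₀.im ^ 2 := by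
    have := abs_lt.mp hη
    nlinarith [abs_nonneg η.im, sq_abs η.im]
  nlinarith [sq_nonneg (η.re - z₀.re)]

/-- **The `∞`-chart**: `η ↦ Ψ(-1/η) ((η - z₀)(η - z̄₀)/(y₀ η²))^s` is holomorphic and bounded on
`{|η| > R₀}` when `Ψ` is holomorphic on a disc around `0` (`0 ≤ Re s`).
[cite: BruggemanLewisZagier2015, (2.2) p. 12] -/
theorem inftyChart_differentiableOn_bounded (hs' : 0 ≤ s.re) {Ψ : ℂ → ℂ} {r : ℝ} (hr : 0 < r)
    (hΨ : DifferentiableOn ℂ Ψ (Metric.ball (0 : ℂ) r)) {z₀ : ℂ} (hz₀ : 0 < z₀.im) :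
    ∃ R₀ : ℝ, 0 < R₀ ∧
      DifferentiableOn ℂ (fun η : ℂ =>
        Ψ (-1 / η) * ((η - z₀) * (η - conj z₀) / ((z₀.im : ℂ) * η ^ 2)) ^ s) {η : ℂ | R₀ < ‖η‖} ∧
      (∀ η : ℂ, R₀ < ‖η‖ → (-1 / η) ∈ Metric.ball (0 : ℂ) r) ∧
      ∃ B : ℝ, ∀ η : ℂ, R₀ < ‖η‖ →
        ‖Ψ (-1 / η) * ((η - z₀) * (η - conj z₀) / ((z₀.im : ℂ) * η ^ 2)) ^ s‖ ≤ B := by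
  set R₀ : ℝ := max (2 / r) (4 * (‖z₀‖ + 1)) with hR₀
  have hR₀pos : 0 < R₀ := lt_of_lt_of_le (by positivity) (le_max_left _ _)
  have hΨc : ContinuousOn Ψ (Metric.closedBall (0 : ℂ) (r / 2)) :=
    hΨ.continuousOn.mono (Metric.closedBall_subset_ball (by linarith))
  obtain ⟨B₁, hB₁⟩ := (isCompact_closedBall (0 : ℂ) (r / 2)).exists_bound_of_continuousOn hΨc
  have hinv : ∀ η : ℂ, R₀ < ‖η‖ →
      (-1 / η) ∈ Metric.closedBall (0 : ℂ) (r / 2) ∧ (-1 / η) ∈ Metric.ball (0 : ℂ) r := by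
    intro η hη
    have hη0 : 0 < ‖η‖ := lt_trans hR₀pos hη
    have h2r : 2 / r < ‖η‖ := lt_of_le_of_lt (le_max_left _ _) hη
    have hn : ‖(-1 / η : ℂ)‖ = ‖η‖⁻¹ := by rw [norm_div, norm_neg, norm_one, one_div]
    have hle : ‖η‖⁻¹ ≤ r / 2 := by
      rw [inv_le_comm₀ hη0 (by positivity), inv_div]
      exact h2r.le
    refine ⟨?_, ?_⟩
    · rw [Metric.mem_closedBall, dist_zero_right, hn]; exact hle
    · rw [Metric.mem_ball, dist_zero_right, hn]; linarith
  refine ⟨R₀, hR₀pos, ?_, fun η hη => (hinv η hη).2,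
    ⟨max B₁ 0 * ((4 / z₀.im) ^ s.re * Real.exp (Real.pi * |s.im|)), ?_⟩⟩
  · intro η hη
    replace hη : R₀ < ‖η‖ := hη
    have hη' : 4 * (‖z₀‖ + 1) ≤ ‖η‖ := (le_max_right _ _).trans (le_of_lt hη)
    obtain ⟨hre, -⟩ := re_inftyBase_pos hz₀ hη'
    have hη0 : η ≠ 0 := by intro h; rw [h, norm_zero] at hη; linarith
    apply DifferentiableAt.differentiableWithinAt
    apply DifferentiableAt.mul
    · have h1 : DifferentiableAt ℂ (fun η : ℂ => -1 / η) η :=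
        (differentiableAt_const _).div differentiableAt_id hη0
      have h2 : DifferentiableAt ℂ Ψ (-1 / η) :=
        hΨ.differentiableAt (Metric.isOpen_ball.mem_nhds (hinv η hη).2)
      exact h2.comp η h1
    · have hden : (z₀.im : ℂ) * η ^ 2 ≠ 0 :=
        mul_ne_zero (by exact_mod_cast hz₀.ne') (pow_ne_zero 2 hη0)
      have hb : DifferentiableAt ℂ (fun η : ℂ => (η - z₀) * (η - conj z₀) / ((z₀.im : ℂ) * η ^ 2)) η :=
        DifferentiableAt.div (by fun_prop) (by fun_prop) hden
      exact hb.cpow (differentiableAt_const s) (Complex.mem_slitPlane_iff.mpr (Or.inl hre))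
  · intro η hη
    have hη' : 4 * (‖z₀‖ + 1) ≤ ‖η‖ := (le_max_right _ _).trans (le_of_lt hη)
    obtain ⟨hre, hbd⟩ := re_inftyBase_pos hz₀ hη'
    have hb0 : (η - z₀) * (η - conj z₀) / ((z₀.im : ℂ) * η ^ 2) ≠ 0 := by
      intro h; rw [h] at hre; simp at hre
    rw [norm_mul]
    have h1 : ‖Ψ (-1 / η)‖ ≤ max B₁ 0 := (hB₁ _ (hinv η hη).1).trans (le_max_left _ _)
    have h2 : ‖((η - z₀) * (η - conj z₀) / ((z₀.im : ℂ) * η ^ 2)) ^ s‖ ≤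
        (4 / z₀.im) ^ s.re * Real.exp (Real.pi * |s.im|) := by
      refine (norm_cpow_le_rpow_mul_exp hb0 s).trans ?_
      exact mul_le_mul_of_nonneg_right (Real.rpow_le_rpow (norm_nonneg _) hbd hs') (by positivity)
    exact mul_le_mul h1 h2 (norm_nonneg _) (le_max_right _ _)

/-- **The collar extension of an analytic vector in the hybrid model.** For `φ ∈ V_s^ω`
(`0 ≤ Re s`) and `z₀ ∈ ℍ` there are `T, δ > 0` and `Φ : ℂ → ℂ` holomorphic on
`{|Re η| > T} ∪ {|Im η| > T} ∪ {|Im η| < δ}`, bounded on `{|Re η| > T} ∪ {|Im η| > T}`, with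
`Φ(t) = φ(t) R_t(z₀)^{-s}` for all real `t` (the holomorphic function near `P¹(ℝ)` of which the
hybrid-model boundary function is the restriction; (2.2) and its analogue at `∞`).
[cite: BruggemanLewisZagier2015, (2.2) p. 12] -/
theorem exists_collar_extension (hs' : 0 ≤ s.re) (hφ : IsAnalyticVector s φ) {z₀ : ℂ}
    (hz₀ : 0 < z₀.im) :
    ∃ (T δ : ℝ) (Φ : ℂ → ℂ), 0 < T ∧ 0 < δ ∧ δ < T ∧ δ ≤ z₀.im / 2 ∧
      DifferentiableOn ℂ Φ ({η : ℂ | T < |η.re|} ∪ {η : ℂ | T < |η.im|} ∪ {η : ℂ | |η.im| < δ}) ∧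
      (∀ t : ℝ, Φ t = φ t * (poissonKernelC t z₀) ^ (-s)) ∧
      ∃ B : ℝ, ∀ η : ℂ, (T < |η.re| ∨ T < |η.im|) → ‖Φ η‖ ≤ B := by
  classical
  obtain ⟨hφa, ψ, hψa, hψ⟩ := hφ
  -- local complexifications of `φ` and their gluing
  have hloc : ∀ t : ℝ, ∃ r : ℝ, 0 < r ∧ ∃ Θ : ℂ → ℂ, DifferentiableOn ℂ Θ (Metric.ball (t : ℂ) r) ∧
      ∀ t' : ℝ, |t' - t| < r → Θ t' = φ t' := fun t => exists_complex_extension (hφa t (mem_univ t))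
  choose r hr Θ hΘ hΘφ using hloc
  obtain ⟨Θg, hΘg_loc, hΘg_diff, hΘg_real⟩ := exists_glued_extension hr hΘ hΘφ
  -- complexification of `ψ` at `0` and the `∞`-chart
  obtain ⟨rinf, hrinf, Ψ, hΨ, hΨψ⟩ := exists_complex_extension hψa
  have hΨ' : DifferentiableOn ℂ Ψ (Metric.ball (0 : ℂ) rinf) := by simpa using hΨ
  obtain ⟨R₀, hR₀, hΦid, hΦiball, Bi, hBi⟩ := inftyChart_differentiableOn_bounded hs' hrinf hΨ' hz₀
  set Φi : ℂ → ℂ := fun η =>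
    Ψ (-1 / η) * ((η - z₀) * (η - conj z₀) / ((z₀.im : ℂ) * η ^ 2)) ^ s with hΦi
  set Φf : ℂ → ℂ := fun η => Θg η * ((η - z₀) * (η - conj z₀) / (z₀.im : ℂ)) ^ s with hΦf
  -- parameters
  set T : ℝ := R₀ + 1 with hT
  have hT0 : 0 < T := by simp only [hT]; linarith
  -- Lebesgue number of the cover of `[-T-1, T+1]` by the half-discs
  set K : Set ℂ := (fun x : ℝ => (x : ℂ)) '' Icc (-(T + 1)) (T + 1) with hK
  have hKc : IsCompact K := isCompact_Icc.image Complex.continuous_ofReal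
  obtain ⟨δL, hδL, hLeb⟩ := lebesgue_number_lemma_of_metric (ι := ℝ)
    (c := fun t : ℝ => Metric.ball (t : ℂ) (r t / 2)) hKc (fun t => Metric.isOpen_ball) (by
      rintro _ ⟨x, -, rfl⟩
      exact mem_iUnion.mpr ⟨x, Metric.mem_ball_self (by linarith [hr x])⟩)
  set δ : ℝ := min (min δL (z₀.im / 2)) (R₀ / 2) with hδ
  have hδ0 : 0 < δ := lt_min (lt_min hδL (by positivity)) (by positivity)
  have hδL' : δ ≤ δL := (min_le_left _ _).trans (min_le_left _ _)
  have hδy : δ ≤ z₀.im / 2 := (min_le_left _ _).trans (min_le_right _ _)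
  have hδH : δ < T := by
    have : δ ≤ R₀ / 2 := min_le_right _ _
    simp only [hT]; linarith
  -- differentiability of the finite chart on the strip
  have hΘg_at : ∀ η : ℂ, |η.re| ≤ T + 1 → |η.im| < δ → DifferentiableAt ℂ Θg η := by
    intro η hre him
    have hxK : ((η.re : ℝ) : ℂ) ∈ K := ⟨η.re, abs_le.mp hre, rfl⟩
    obtain ⟨t, ht⟩ := hLeb _ hxK
    have hηball : η ∈ Metric.ball ((η.re : ℝ) : ℂ) δL := by
      rw [Metric.mem_ball, dist_eq_norm]
      have e : η - ((η.re : ℝ) : ℂ) = (η.im : ℂ) * Complex.I := by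
        apply Complex.ext <;> simp
      rw [e, norm_mul, Complex.norm_I, mul_one, Complex.norm_real, Real.norm_eq_abs]
      exact lt_of_lt_of_le him hδL'
    have hmem : η ∈ Metric.ball (t : ℂ) (r t / 2) := ht hηball
    exact (hΘg_diff t).differentiableAt (Metric.isOpen_ball.mem_nhds hmem)
  have hΦf_at : ∀ η : ℂ, |η.re| ≤ T + 1 → |η.im| < δ → DifferentiableAt ℂ Φf η := by
    intro η hre him
    have himy : |η.im| < z₀.im := lt_of_lt_of_le him (hδy.trans (by linarith))
    have hb : DifferentiableAt ℂ (fun η : ℂ => (η - z₀) * (η - conj z₀) / (z₀.im : ℂ)) η := by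
      fun_prop
    exact (hΘg_at η hre him).mul (hb.cpow (differentiableAt_const s)
      (Complex.mem_slitPlane_iff.mpr (Or.inl (re_finiteBase_pos hz₀ himy))))
  -- values on the real axis
  have hΦf_real : ∀ t : ℝ, Φf t = φ t * (poissonKernelC t z₀) ^ (-s) := by
    intro t
    simp only [hΦf, hΘg_real t, finiteChart_factor_ofReal s t hz₀]
  have hΦi_real : ∀ t : ℝ, R₀ < |t| → Φi t = φ t * (poissonKernelC t z₀) ^ (-s) := by
    intro t ht
    have ht0 : t ≠ 0 := by intro h; rw [h, abs_zero] at ht; linarith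
    have hball := hΦiball (t : ℂ) (by rwa [Complex.norm_real, Real.norm_eq_abs])
    have hΨt : Ψ (-1 / (t : ℂ)) = ψ (-1 / t) := by
      have e : (-1 / (t : ℂ)) = ((-1 / t : ℝ) : ℂ) := by push_cast; ring
      rw [e]
      apply hΨψ
      rw [sub_zero]
      rw [e, Metric.mem_ball, dist_zero_right, Complex.norm_real, Real.norm_eq_abs] at hball
      exact hball
    simp only [hΦi]
    rw [hΨt]
    exact inftyChart_value_ofReal s hψ ht0 hz₀
  -- the two charts agree on the boxes around `±T`
  have hbox : ∀ σ : ℝ, (σ = 1 ∨ σ = -1) →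
      EqOn Φi Φf {η : ℂ | T - 1 < σ * η.re ∧ σ * η.re < T + 1 ∧ |η.im| < δ} := by
    intro σ hσ
    have hσ1 : σ * σ = 1 := by rcases hσ with h | h <;> simp [h]
    have habsσ : ∀ x : ℝ, |σ * x| = |x| := fun x => by
      rcases hσ with h | h <;> simp [h]
    set S : Set ℂ := {η : ℂ | T - 1 < σ * η.re ∧ σ * η.re < T + 1 ∧ |η.im| < δ} with hS
    have hSo : IsOpen S := by
      simp only [hS, Set.setOf_and]
      refine (isOpen_lt continuous_const (continuous_const.mul Complex.continuous_re)).inter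
        ((isOpen_lt (continuous_const.mul Complex.continuous_re) continuous_const).inter
        (isOpen_lt (continuous_abs.comp Complex.continuous_im) continuous_const))
    have hSc : IsPreconnected S := by
      have hconv : Convex ℝ S := by
        intro x hx y hy a b ha hb hab
        simp only [hS, mem_setOf_eq, Complex.add_re, Complex.add_im, Complex.smul_re,
          Complex.smul_im, smul_eq_mul] at hx hy ⊢
        have e : σ * (a * x.re + b * y.re) = a * (σ * x.re) + b * (σ * y.re) := by ring
        have hsum : a * (T - 1) + b * (T - 1) = T - 1 := by rw [← add_mul, hab, one_mul]
        have hsum' : a * (T + 1) + b * (T + 1) = T + 1 := by rw [← add_mul, hab, one_mul]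
        refine ⟨?_, ?_, ?_⟩
        · rw [e]
          rcases ha.eq_or_lt with h0 | ha'
          · have hb1 : b = 1 := by linarith
            rw [← h0, hb1]; simpa using hy.1
          · have h1 := mul_lt_mul_of_pos_left hx.1 ha'
            have h2 := mul_le_mul_of_nonneg_left hy.1.le hb
            linarith
        · rw [e]
          rcases ha.eq_or_lt with h0 | ha'
          · have hb1 : b = 1 := by linarith
            rw [← h0, hb1]; simpa using hy.2.1
          · have h1 := mul_lt_mul_of_pos_left hx.2.1 ha'
            have h2 := mul_le_mul_of_nonneg_left hy.2.1.le hb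
            linarith
        · calc |a * x.im + b * y.im| ≤ |a * x.im| + |b * y.im| := abs_add_le _ _
            _ = a * |x.im| + b * |y.im| := by rw [abs_mul, abs_mul, abs_of_nonneg ha, abs_of_nonneg hb]
            _ < a * δ + b * δ := by
                rcases ha.eq_or_lt with rfl | ha'
                · simp only [zero_mul, zero_add] at hab ⊢; rw [hab]; simp [hy.2.2]
                · have := mul_lt_mul_of_pos_left hx.2.2 ha'
                  have := mul_le_mul_of_nonneg_left hy.2.2.le hb
                  linarith
            _ = δ := by rw [← add_mul, hab, one_mul]
      exact hconv.isPreconnected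
    have hTS : ((σ * T : ℝ) : ℂ) ∈ S := by
      simp only [hS, mem_setOf_eq, Complex.ofReal_re, Complex.ofReal_im, abs_zero]
      refine ⟨?_, ?_, hδ0⟩ <;> nlinarith
    -- both charts are holomorphic on `S`
    have hSi : S ⊆ {η : ℂ | R₀ < ‖η‖} := by
      intro η hη
      have h1 : T - 1 < |η.re| := by
        have := hη.1
        calc T - 1 < σ * η.re := this
          _ ≤ |σ * η.re| := le_abs_self _
          _ = |η.re| := habsσ _
      show R₀ < ‖η‖
      calc R₀ = T - 1 := by simp only [hT]; ring
        _ < |η.re| := h1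
        _ ≤ ‖η‖ := Complex.abs_re_le_norm η
    have hdi : DifferentiableOn ℂ Φi S := hΦid.mono hSi
    have hdf : DifferentiableOn ℂ Φf S := by
      intro η hη
      refine (hΦf_at η ?_ hη.2.2).differentiableWithinAt
      have := hη.2.1
      rw [← habsσ]
      have h0 : 0 ≤ σ * η.re := by linarith [hη.1, hT0, show T - 1 = R₀ from by simp only [hT]; ring]
      rw [abs_of_nonneg h0]; exact this.le
    -- agreement on the reals near `σ T`
    have hev : ∀ᶠ t : ℝ in 𝓝[≠] (σ * T), Φi t = Φf t := by
      have hopen : IsOpen {t : ℝ | R₀ < |t|} := isOpen_lt continuous_const continuous_abs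
      have hmem : σ * T ∈ {t : ℝ | R₀ < |t|} := by
        show R₀ < |σ * T|; rw [habsσ, abs_of_pos hT0]; simp only [hT]; linarith
      filter_upwards [nhdsWithin_le_nhds (hopen.mem_nhds hmem)] with t ht
      rw [hΦi_real t ht, hΦf_real t]
    exact eqOn_of_eqOn_real hSo hSc hTS hdi hdf hev
  -- the glued function
  set Φ : ℂ → ℂ := fun η => if T < |η.re| ∨ T < |η.im| then Φi η else Φf η with hΦdef
  have hcond_open : IsOpen {η : ℂ | T < |η.re| ∨ T < |η.im|} :=
    (isOpen_lt continuous_const (continuous_abs.comp Complex.continuous_re)).union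
      (isOpen_lt continuous_const (continuous_abs.comp Complex.continuous_im))
  have hcond_R₀ : ∀ η : ℂ, (T < |η.re| ∨ T < |η.im|) → R₀ < ‖η‖ := by
    intro η h
    rcases h with h | h
    · calc R₀ < T := by simp only [hT]; linarith
        _ < |η.re| := h
        _ ≤ ‖η‖ := Complex.abs_re_le_norm η
    · calc R₀ < T := by simp only [hT]; linarith
        _ < |η.im| := h
        _ ≤ ‖η‖ := Complex.abs_im_le_norm η
  refine ⟨T, δ, Φ, hT0, hδ0, hδH, hδy, ?_, ?_, ⟨Bi, ?_⟩⟩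
  · -- holomorphy
    intro η₀ hη₀
    by_cases hc : T < |η₀.re| ∨ T < |η₀.im|
    · have hev : Φ =ᶠ[𝓝 η₀] Φi := by
        filter_upwards [hcond_open.mem_nhds hc] with η hη
        simp only [hΦdef, if_pos hη]
      have hd : DifferentiableAt ℂ Φi η₀ :=
        hΦid.differentiableAt ((isOpen_lt continuous_const continuous_norm).mem_nhds (hcond_R₀ η₀ hc))
      exact (hd.congr_of_eventuallyEq hev).differentiableWithinAt
    · push Not at hc
      obtain ⟨hre₀, him₀⟩ := hc
      have him₀' : |η₀.im| < δ := by
        rcases hη₀ with (h | h) | h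
        · exact absurd h (not_lt.mpr hre₀)
        · exact absurd h (not_lt.mpr him₀)
        · exact h
      -- near `η₀`, `Φ = Φf`
      set V : Set ℂ := {η : ℂ | |η.re| < T + 1 ∧ |η.im| < δ} with hV
      have hVo : IsOpen V := by
        simp only [hV, Set.setOf_and]
        exact (isOpen_lt (continuous_abs.comp Complex.continuous_re) continuous_const).inter
          (isOpen_lt (continuous_abs.comp Complex.continuous_im) continuous_const)
      have hη₀V : η₀ ∈ V := ⟨by linarith, him₀'⟩
      have hev : Φ =ᶠ[𝓝 η₀] Φf := by
        filter_upwards [hVo.mem_nhds hη₀V] with η hη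
        by_cases hc' : T < |η.re| ∨ T < |η.im|
        · simp only [hΦdef, if_pos hc']
          have hre : T < |η.re| := by
            rcases hc' with h | h
            · exact h
            · exfalso; linarith [hη.2, hδH]
          -- `η` lies in one of the two boxes
          rcases le_or_gt 0 η.re with hpos | hneg
          · refine hbox 1 (Or.inl rfl) ⟨?_, ?_, hη.2⟩
            · rw [one_mul]; rw [abs_of_nonneg hpos] at hre; linarith
            · rw [one_mul]; have := hη.1; rw [abs_of_nonneg hpos] at this; exact this
          · refine hbox (-1) (Or.inr rfl) ⟨?_, ?_, hη.2⟩
            · rw [abs_of_neg hneg] at hre; linarith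
            · have := hη.1; rw [abs_of_neg hneg] at this; linarith
        · simp only [hΦdef, if_neg hc']
      exact ((hΦf_at η₀ (by linarith) him₀').congr_of_eventuallyEq hev).differentiableWithinAt
  · -- real values
    intro t
    by_cases hc : T < |(t : ℂ).re| ∨ T < |(t : ℂ).im|
    · simp only [hΦdef, if_pos hc]
      apply hΦi_real
      rcases hc with h | h
      · simp only [Complex.ofReal_re] at h; simp only [hT] at h; linarith
      · simp only [Complex.ofReal_im, abs_zero] at h; linarith [hT0]
    · simp only [hΦdef, if_neg hc]
      exact hΦf_real t
  · -- the bound near `∞`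
    intro η hη
    simp only [hΦdef, if_pos hη]
    exact hBi η (hcond_R₀ η hη)

end CollarExtension

/-! ## 24. The coboundary identity in the hybrid model and the twisted functional equation

For a real `t` the canonical-model objects are positive-real rescalings of the line-model ones:
`(R_t(w)/R_t(z₀))^s = R_t(z₀)^{-s} R_t(w)^s`, so `∫_a^b [u, (R_t/R_t(z₀))^s] = R_t(z₀)^{-s} ∫_a^b [u, R_t^s]`,
and `R_t(z₀)^{-s} (φ|γ)(t) = μ_γ(t)^{-s} Φ(γ t)` with `Φ(ξ) = φ(ξ) R_ξ(z₀)^{-s}` and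
`μ_γ(t) = R_t(z₀)/R_t(γ⁻¹ z₀)` ((2.25): `R_{γt}(γ w) = (ct + d)² R_t(w)`). Hence the coboundary
hypothesis `r_γ = φ|γ - φ` reads `c_γ(t) = μ_γ(t)^{-s} Φ(γt) - Φ(t)` (hybrid coboundary identity),
extends to complex `η` near `ℝ` by the identity theorem, and combined with the transformation law
(§22) gives the twisted functional equation `D(γ η) = μ_γ(η)^s D(η)` of `D = Φ - h` near the real
axis. -/

section HybridCoboundary

variable {Γ : Subgroup (GL (Fin 2) ℝ)} {s : ℂ} {u : ℍ → ℂ}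

/-- Negative powers of positive reals multiply. [folklore] -/
theorem ofReal_cpow_mul_ofReal_cpow' {a b : ℝ} (ha : 0 ≤ a) (hb : 0 ≤ b) (s : ℂ) :
    ((a : ℂ)) ^ (-s) * ((b : ℂ)) ^ (-s) = (((a * b : ℝ)) : ℂ) ^ (-s) :=
  ofReal_cpow_mul_ofReal_cpow ha hb (-s)

/-- `((a : ℂ))^{-s} = ((a⁻¹ : ℂ))^{s}` for `a ≥ 0`. [folklore] -/
theorem ofReal_cpow_neg {a : ℝ} (ha : 0 ≤ a) (s : ℂ) : ((a : ℂ)) ^ (-s) = (((a⁻¹ : ℝ)) : ℂ) ^ s := by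
  rw [cpow_neg_eq_inv_cpow (by rw [Complex.arg_ofReal_of_nonneg ha]; exact Real.pi_ne_zero.symm),
    Complex.ofReal_inv]

/-- `|x|^{-2s} = ((x²))^{-s}` for real `x`. [folklore] -/
theorem abs_cpow_neg_two_mul (x : ℝ) (s : ℂ) (hx : x ≠ 0) :
    ((|x| : ℝ) : ℂ) ^ (-(2 * s)) = (((x ^ 2 : ℝ)) : ℂ) ^ (-s) := by
  have h0 : ((|x| : ℝ) : ℂ) ≠ 0 := by exact_mod_cast abs_ne_zero.mpr hx
  rw [show -(2 * s) = -s + -s from by ring, Complex.cpow_add _ _ h0,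
    ofReal_cpow_mul_ofReal_cpow' (abs_nonneg x) (abs_nonneg x), abs_mul_abs_self, sq]

/-- **The ratio kernel for a real parameter**: `(R_t(w)/R_t(z₀))^s = R_t(z₀)^{-s} R_t(w)^s` on `ℍ`.
[cite: BruggemanLewisZagier2015, (1.6)–(1.7) p. 10] -/
theorem ratioKernel_ofReal (s : ℂ) (t : ℝ) {z₀ w : ℂ} (hz₀ : 0 < z₀.im) (hw : 0 < w.im) :
    ratioKernel s z₀ t w = (poissonKernelC t z₀) ^ (-s) * hypPoissonKernelCpow s t w := by
  unfold ratioKernel hypPoissonKernelCpow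
  rw [poissonKernelC_ofReal, poissonKernelC_ofReal, ← Complex.ofReal_div, div_eq_mul_inv,
    Complex.ofReal_mul, Complex.mul_cpow_ofReal_nonneg (hypPoissonKernel_pos t hw).le
      (inv_nonneg.mpr (hypPoissonKernel_pos t hz₀).le),
    ← ofReal_cpow_neg (hypPoissonKernel_pos t hz₀).le, mul_comm]

/-- **The canonical cocycle at real points**: `∫_a^b [u, (R_t/R_t(z₀))^s] = R_t(z₀)^{-s} ∫_a^b [u, R_t^s]`.
[cite: BruggemanLewisZagier2015, (5.5a) p. 29] -/
theorem cocycleExt_ofReal (s : ℂ) (u : ℍ → ℂ) (t : ℝ) (z₀ a b : ℍ) :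
    greenSegmentIntegral (u ∘ ofComplex) (ratioKernel s z₀ t) a b =
      (poissonKernelC t z₀) ^ (-s) * greenPeriod s u a b t := by
  unfold greenPeriod
  rw [← greenSegmentIntegral_const_mul]
  refine greenSegmentIntegral_congr_upperHalfPlane (fun w _ => rfl) ?_ a b
  intro w hw
  exact ratioKernel_ofReal s t z₀.coe_im_pos hw

/-- **Möbius covariance of `R` at real points** ((2.25)): `R_{γt}(γ w) = (ct + d)² R_t(w)` for
`det γ = 1`, `t` not the pole of `γ`, `w ∈ ℍ`. [cite: BruggemanLewisZagier2015, (2.25) p. 16] -/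
theorem poissonKernelC_smul_ofReal {γ : GL (Fin 2) ℝ} (hγ : γ.det.val = 1) {t : ℝ}
    (ht : γ 1 0 * t + γ 1 1 ≠ 0) (w : ℍ) :
    poissonKernelC ((((γ 0 0 * t + γ 0 1) / (γ 1 0 * t + γ 1 1) : ℝ)) : ℂ) ((γ • w : ℍ) : ℂ) =
      ((((γ 1 0 * t + γ 1 1) ^ 2 : ℝ)) : ℂ) * poissonKernelC t w := by
  have hγ' : 0 < γ.det.val := by rw [hγ]; exact one_pos
  have hdet : γ 0 0 * γ 1 1 - γ 0 1 * γ 1 0 = 1 := by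
    have h : γ.val.det = 1 := hγ
    rw [Matrix.det_fin_two] at h
    exact h
  have ht' : (γ 1 0 : ℂ) * (t : ℂ) + (γ 1 1 : ℝ) ≠ 0 := by exact_mod_cast ht
  have h := poissonKernelC_moebius hdet ht' (smul_denom_ne_zero γ w)
  rw [coe_smul_eq_div hγ']
  push_cast at h ⊢
  rw [h]

/-- **The slash action in the hybrid model** (real points): for `det γ = 1`, `w ∈ ℍ`,
`z₀ = γ w` and `t` not the pole of `γ`,
`(φ|γ)(t) R_t(z₀)^{-s} = (R_t(z₀)/R_t(w))^{-s} · φ(γt) R_{γt}(z₀)^{-s}`.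
[cite: BruggemanLewisZagier2015, (2.1) p. 11 and (2.25) p. 16] -/
theorem lineSlash_hybrid (s : ℂ) (φ : ℝ → ℂ) {γ : GL (Fin 2) ℝ} (hγ : γ.det.val = 1) {t : ℝ}
    (ht : γ 1 0 * t + γ 1 1 ≠ 0) (w : ℍ) :
    lineSlash s γ φ t * (poissonKernelC t ((γ • w : ℍ) : ℂ)) ^ (-s) =
      (poissonKernelC t ((γ • w : ℍ) : ℂ) / poissonKernelC t w) ^ (-s) *
        (φ ((γ 0 0 * t + γ 0 1) / (γ 1 0 * t + γ 1 1)) *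
          (poissonKernelC ((((γ 0 0 * t + γ 0 1) / (γ 1 0 * t + γ 1 1) : ℝ)) : ℂ)
            ((γ • w : ℍ) : ℂ)) ^ (-s)) := by
  rw [lineSlash_apply, poissonKernelC_smul_ofReal hγ ht w]
  set A : ℝ := hypPoissonKernel t ((γ • w : ℍ) : ℂ) with hA
  set B : ℝ := hypPoissonKernel t (w : ℂ) with hB
  set J : ℝ := (γ 1 0 * t + γ 1 1) ^ 2 with hJ
  have hA0 : 0 < A := hypPoissonKernel_pos t (γ • w).coe_im_pos
  have hB0 : 0 < B := hypPoissonKernel_pos t w.coe_im_pos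
  have hJ0 : 0 < J := by simp only [hJ]; positivity
  have hPA : poissonKernelC t ((γ • w : ℍ) : ℂ) = (A : ℂ) := poissonKernelC_ofReal t _
  have hPB : poissonKernelC t (w : ℂ) = (B : ℂ) := poissonKernelC_ofReal t _
  rw [hPA, hPB, abs_cpow_neg_two_mul _ s ht, ← Complex.ofReal_div, ← Complex.ofReal_mul]
  rw [show (((γ 1 0 * t + γ 1 1) ^ 2 : ℝ)) = J from rfl]
  -- both sides equal `φ(γt) · ((J A : ℝ))^{-s}`
  have e1 : (((J : ℝ)) : ℂ) ^ (-s) * ((A : ℂ)) ^ (-s) = (((J * A : ℝ)) : ℂ) ^ (-s) :=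
    ofReal_cpow_mul_ofReal_cpow' hJ0.le hA0.le s
  have e2 : (((A / B : ℝ)) : ℂ) ^ (-s) * (((J * B : ℝ)) : ℂ) ^ (-s) = (((J * A : ℝ)) : ℂ) ^ (-s) := by
    rw [ofReal_cpow_mul_ofReal_cpow' (by positivity) (by positivity)]
    congr 2
    field_simp
  calc (((J : ℝ)) : ℂ) ^ (-s) * φ ((γ 0 0 * t + γ 0 1) / (γ 1 0 * t + γ 1 1)) * ((A : ℂ)) ^ (-s)
      = φ ((γ 0 0 * t + γ 0 1) / (γ 1 0 * t + γ 1 1)) * ((((J : ℝ)) : ℂ) ^ (-s) * ((A : ℂ)) ^ (-s)) := by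
        ring
    _ = φ ((γ 0 0 * t + γ 0 1) / (γ 1 0 * t + γ 1 1)) *
          ((((A / B : ℝ)) : ℂ) ^ (-s) * (((J * B : ℝ)) : ℂ) ^ (-s)) := by rw [e1, e2]
    _ = _ := by ring

end HybridCoboundary

section SeedPatch

variable {Γ : Subgroup (GL (Fin 2) ℝ)} {s : ℂ} {u : ℍ → ℂ}

/-- The Möbius map of `γ` (as a map of `ℂ`) agrees with the action on `ℍ` (`det γ > 0`).
[folklore] -/
theorem moebius_apply_of_im_pos {γ : GL (Fin 2) ℝ} (hγ : 0 < γ.det.val) {η : ℂ} (hη : 0 < η.im) :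
    ((γ 0 0 : ℂ) * η + (γ 0 1 : ℝ)) / ((γ 1 0 : ℂ) * η + (γ 1 1 : ℝ)) =
      ((γ • (⟨η, hη⟩ : ℍ) : ℍ) : ℂ) := by
  rw [coe_smul_eq_div hγ]

/-- The Möbius map of `γ` at a real point. [folklore] -/
theorem moebius_ofReal (γ : GL (Fin 2) ℝ) (t : ℝ) :
    ((γ 0 0 : ℂ) * (t : ℂ) + (γ 0 1 : ℝ)) / ((γ 1 0 : ℂ) * (t : ℂ) + (γ 1 1 : ℝ)) =
      ((((γ 0 0 * t + γ 0 1) / (γ 1 0 * t + γ 1 1) : ℝ)) : ℂ) := by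
  push_cast; ring

/-- The Möbius map of `γ` is complex differentiable off its pole. [folklore] -/
theorem differentiableAt_moebius (γ : GL (Fin 2) ℝ) {η : ℂ} (hη : (γ 1 0 : ℂ) * η + (γ 1 1 : ℝ) ≠ 0) :
    DifferentiableAt ℂ (fun η : ℂ => ((γ 0 0 : ℂ) * η + (γ 0 1 : ℝ)) / ((γ 1 0 : ℂ) * η + (γ 1 1 : ℝ))) η :=
  DifferentiableAt.div (by fun_prop) (by fun_prop) hη

/-- The determinant of `g⁻¹` is `1` when that of `g` is. [folklore] -/
theorem det_inv_eq_one {g : GL (Fin 2) ℝ} (hdet : g.det.val = 1) : (g⁻¹).det.val = 1 := by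
  rw [map_inv, Units.val_inv_eq_inv_val, hdet, inv_one]

/-- The entries of a determinant-one `γ` satisfy `γ₀₀ γ₁₁ - γ₀₁ γ₁₀ = 1`. [folklore] -/
theorem det_entries_eq_one {γ : GL (Fin 2) ℝ} (hγ : γ.det.val = 1) :
    γ 0 0 * γ 1 1 - γ 0 1 * γ 1 0 = 1 := by
  have h : γ.val.det = 1 := hγ
  rw [Matrix.det_fin_two] at h
  exact h

/-- The pole of a determinant-one `γ` is a single real point (or none). [folklore] -/
theorem eventually_cofinite_denom_ne_zero {γ : GL (Fin 2) ℝ} (hγ : γ.det.val = 1) :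
    ∀ᶠ t : ℝ in cofinite, γ 1 0 * t + γ 1 1 ≠ 0 := by
  rw [Filter.eventually_cofinite]
  apply (Set.finite_singleton (-(γ 1 1) / γ 1 0)).subset
  intro t ht
  simp only [mem_setOf_eq, not_not] at ht
  have hdet := det_entries_eq_one hγ
  by_cases h0 : γ 1 0 = 0
  · exfalso
    rw [h0] at ht hdet
    simp only [zero_mul, zero_add] at ht
    rw [ht] at hdet
    simp at hdet
  · rw [mem_singleton_iff]
    field_simp
    linarith

/-- **The denominator cocycle at a real point**: if `g γ = 1` and `t` is not the pole of `γ`, then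
`(g₁₀ (γt) + g₁₁)(γ₁₀ t + γ₁₁) = 1`; in particular `γ t` is not the pole of `g`. [folklore] -/
theorem denom_mul_denom_eq_one {g γ : GL (Fin 2) ℝ} (h : g * γ = 1) {t : ℝ}
    (ht : γ 1 0 * t + γ 1 1 ≠ 0) :
    (g 1 0 * ((γ 0 0 * t + γ 0 1) / (γ 1 0 * t + γ 1 1)) + g 1 1) * (γ 1 0 * t + γ 1 1) = 1 := by
  have e10 : g 1 0 * γ 0 0 + g 1 1 * γ 1 0 = 0 := by
    have := congrArg (fun m : GL (Fin 2) ℝ => (m : Matrix (Fin 2) (Fin 2) ℝ) 1 0) h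
    simpa [Matrix.mul_apply, Fin.sum_univ_two] using this
  have e11 : g 1 0 * γ 0 1 + g 1 1 * γ 1 1 = 1 := by
    have := congrArg (fun m : GL (Fin 2) ℝ => (m : Matrix (Fin 2) (Fin 2) ℝ) 1 1) h
    simpa [Matrix.mul_apply, Fin.sum_univ_two] using this
  have e : (g 1 0 * ((γ 0 0 * t + γ 0 1) / (γ 1 0 * t + γ 1 1)) + g 1 1) * (γ 1 0 * t + γ 1 1) =
      g 1 0 * (γ 0 0 * t + γ 0 1) + g 1 1 * (γ 1 0 * t + γ 1 1) := by
    rw [add_mul, mul_assoc, div_mul_cancel₀ _ ht]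
  rw [e]
  linear_combination t * e10 + e11

/-- **The hybrid coboundary identity at real points.** If `r_{g⁻¹} = φ|g⁻¹ - φ` off a finite set
(line model), then, off a finite set, `c(t) = μ(t)^{-s} Φ(g⁻¹ t) - Φ(t)` where
`c(t) = ∫_{g z₀}^{z₀} [u, (R_t/R_t(z₀))^s]`, `μ(t) = R_t(z₀)/R_t(g z₀)` and `Φ(ξ) = φ(ξ) R_ξ(z₀)^{-s}`
(hybrid model of the companion paper). [cite: BruggemanLewisZagier2015, Proposition 5.1 pp. 30–31] -/
theorem hybridCoboundary_ofReal (s : ℂ) (φ : ℝ → ℂ) (u : ℍ → ℂ) {g : GL (Fin 2) ℝ}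
    (hdet : g.det.val = 1) (z₀ : ℍ) {Φ : ℂ → ℂ}
    (hΦ : ∀ t : ℝ, Φ t = φ t * (poissonKernelC t z₀) ^ (-s))
    (hcb : ∀ᶠ t : ℝ in cofinite, lewisZagierCocycle s z₀ u g⁻¹ t = lineSlash s g⁻¹ φ t - φ t) :
    ∀ᶠ t : ℝ in cofinite,
      greenSegmentIntegral (u ∘ ofComplex) (ratioKernel s z₀ t) ((g • z₀ : ℍ) : ℂ) z₀ =
        (poissonKernelC t z₀ / poissonKernelC t ((g • z₀ : ℍ) : ℂ)) ^ (-s) *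
          Φ (((g⁻¹ 0 0 : ℂ) * (t : ℂ) + (g⁻¹ 0 1 : ℝ)) / ((g⁻¹ 1 0 : ℂ) * (t : ℂ) + (g⁻¹ 1 1 : ℝ))) -
          Φ t := by
  have hγdet : (g⁻¹).det.val = 1 := det_inv_eq_one hdet
  filter_upwards [hcb, eventually_cofinite_denom_ne_zero hγdet] with t ht hp
  have hw : g⁻¹ • (g • z₀) = z₀ := inv_smul_smul g z₀
  rw [cocycleExt_ofReal s u t z₀ (g • z₀) z₀]
  have hr : greenPeriod s u (g • z₀) z₀ t = lewisZagierCocycle s z₀ u g⁻¹ t := by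
    rw [lewisZagierCocycle, inv_inv]
  rw [hr, ht, moebius_ofReal, hΦ, hΦ]
  have key := lineSlash_hybrid s φ hγdet hp (g • z₀)
  rw [hw] at key
  rw [mul_sub, mul_comm (poissonKernelC t z₀ ^ (-s)) (lineSlash s g⁻¹ φ t), key]
  ring

/-- **The hybrid coboundary identity near a real point** (identity theorem): with notation as
above and `Φ` holomorphic on an open set containing `ℝ`, the identity
`c(η) = μ(η)^{-s} Φ(g⁻¹ η) - Φ(η)` holds for all complex `η` in a disc around any real `t₀` that is
not the pole of `g⁻¹`; on that disc both sides are holomorphic, `μ` is holomorphic with values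
off the cut, and `η`, `g⁻¹ η` stay in the domain of `Φ`.
[cite: BruggemanLewisZagier2015, Proposition 5.1 pp. 30–31] -/
theorem hybridCoboundary_ball (s : ℂ) (φ : ℝ → ℂ) {u : ℍ → ℂ}
    (hU : ContDiffOn ℝ 2 (u ∘ ofComplex) {z : ℂ | 0 < z.im})
    {g : GL (Fin 2) ℝ} (hdet : g.det.val = 1) (z₀ : ℍ) {N : Set ℂ} (hN : IsOpen N)
    {Φ : ℂ → ℂ} (hΦN : DifferentiableOn ℂ Φ N) (hrealN : ∀ t : ℝ, (t : ℂ) ∈ N)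
    (hΦ : ∀ t : ℝ, Φ t = φ t * (poissonKernelC t z₀) ^ (-s))
    (hcb : ∀ᶠ t : ℝ in cofinite, lewisZagierCocycle s z₀ u g⁻¹ t = lineSlash s g⁻¹ φ t - φ t)
    {t₀ : ℝ} (ht₀ : g⁻¹ 1 0 * t₀ + g⁻¹ 1 1 ≠ 0) :
    ∃ δ' > 0,
      DifferentiableOn ℂ (fun η : ℂ =>
        greenSegmentIntegral (u ∘ ofComplex) (ratioKernel s z₀ η) ((g • z₀ : ℍ) : ℂ) z₀)
        (Metric.ball (t₀ : ℂ) δ') ∧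
      (∀ η ∈ Metric.ball (t₀ : ℂ) δ',
        poissonKernelC η z₀ / poissonKernelC η ((g • z₀ : ℍ) : ℂ) ∈ Complex.slitPlane ∧
        DifferentiableAt ℂ (fun η : ℂ => poissonKernelC η z₀ / poissonKernelC η ((g • z₀ : ℍ) : ℂ)) η ∧
        (g⁻¹ 1 0 : ℂ) * η + (g⁻¹ 1 1 : ℝ) ≠ 0 ∧ η ∈ N ∧
        ((g⁻¹ 0 0 : ℂ) * η + (g⁻¹ 0 1 : ℝ)) / ((g⁻¹ 1 0 : ℂ) * η + (g⁻¹ 1 1 : ℝ)) ∈ N ∧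
        DifferentiableAt ℂ Φ η ∧
        DifferentiableAt ℂ (fun η : ℂ =>
          Φ (((g⁻¹ 0 0 : ℂ) * η + (g⁻¹ 0 1 : ℝ)) / ((g⁻¹ 1 0 : ℂ) * η + (g⁻¹ 1 1 : ℝ)))) η) ∧
      ∀ η ∈ Metric.ball (t₀ : ℂ) δ',
        greenSegmentIntegral (u ∘ ofComplex) (ratioKernel s z₀ η) ((g • z₀ : ℍ) : ℂ) z₀ =
          (poissonKernelC η z₀ / poissonKernelC η ((g • z₀ : ℍ) : ℂ)) ^ (-s) *
            Φ (((g⁻¹ 0 0 : ℂ) * η + (g⁻¹ 0 1 : ℝ)) / ((g⁻¹ 1 0 : ℂ) * η + (g⁻¹ 1 1 : ℝ))) - Φ η := by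
  set γ : GL (Fin 2) ℝ := g⁻¹ with hγdef
  set a₁ : ℂ := ((g • z₀ : ℍ) : ℂ) with ha₁
  have ha₁im : 0 < a₁.im := (g • z₀).coe_im_pos
  have hz₀im : 0 < (z₀ : ℂ).im := z₀.coe_im_pos
  -- (e1) holomorphy of the cocycle extension near `t₀`
  obtain ⟨δ₁, hδ₁, hc⟩ := exists_ball_differentiableOn_param_real s hU hz₀im ha₁im hz₀im t₀
  -- (e2) `μ` near `t₀`
  have hne : ∀ w : ℂ, 0 < w.im → ∀ᶠ η : ℂ in 𝓝 (t₀ : ℂ), η ≠ w ∧ η ≠ conj w := by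
    intro w hw
    have h1 : (t₀ : ℂ) ≠ w := by
      intro h; have := congrArg Complex.im h; simp at this; linarith
    have h2 : (t₀ : ℂ) ≠ conj w := by
      intro h; have := congrArg Complex.im h; simp at this; linarith
    exact (isOpen_ne.eventually_mem h1).and (isOpen_ne.eventually_mem h2)
  have hμdiff : ∀ᶠ η : ℂ in 𝓝 (t₀ : ℂ),
      DifferentiableAt ℂ (fun η : ℂ => poissonKernelC η z₀ / poissonKernelC η a₁) η ∧
        poissonKernelC η a₁ ≠ 0 := by
    filter_upwards [hne z₀ hz₀im, hne a₁ ha₁im] with η h₁ h₂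
    have hpa : poissonKernelC η a₁ ≠ 0 := by
      unfold poissonKernelC
      exact div_ne_zero (by exact_mod_cast ha₁im.ne')
        (mul_ne_zero (sub_ne_zero.mpr h₂.1) (sub_ne_zero.mpr h₂.2))
    exact ⟨(differentiableAt_poissonKernelC_param h₁.1 h₁.2).div
      (differentiableAt_poissonKernelC_param h₂.1 h₂.2) hpa, hpa⟩
  have hμt₀ : poissonKernelC (t₀ : ℂ) z₀ / poissonKernelC (t₀ : ℂ) a₁ =
      ((hypPoissonKernel t₀ z₀ / hypPoissonKernel t₀ a₁ : ℝ) : ℂ) := by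
    rw [poissonKernelC_ofReal, poissonKernelC_ofReal, Complex.ofReal_div]
  have hμslit : ∀ᶠ η : ℂ in 𝓝 (t₀ : ℂ),
      poissonKernelC η z₀ / poissonKernelC η a₁ ∈ Complex.slitPlane := by
    have hcont : ContinuousAt (fun η : ℂ => poissonKernelC η z₀ / poissonKernelC η a₁) (t₀ : ℂ) :=
      hμdiff.self_of_nhds.1.continuousAt
    apply hcont.eventually (Complex.isOpen_slitPlane.mem_nhds ?_)
    show poissonKernelC (t₀ : ℂ) z₀ / poissonKernelC (t₀ : ℂ) a₁ ∈ Complex.slitPlane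
    rw [hμt₀]
    exact Complex.ofReal_mem_slitPlane.mpr (div_pos (hypPoissonKernel_pos t₀ hz₀im)
      (hypPoissonKernel_pos t₀ ha₁im))
  -- (e3) the Möbius map and `Φ ∘ Mob`, (e4) `Φ`
  have ht₀' : (γ 1 0 : ℂ) * (t₀ : ℂ) + (γ 1 1 : ℝ) ≠ 0 := by
    have : (γ 1 0 * t₀ + γ 1 1 : ℝ) ≠ 0 := ht₀
    exact_mod_cast this
  have hden : ∀ᶠ η : ℂ in 𝓝 (t₀ : ℂ), (γ 1 0 : ℂ) * η + (γ 1 1 : ℝ) ≠ 0 :=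
    (Continuous.continuousAt (by fun_prop)).eventually_ne ht₀'
  have hMobt₀ : ((γ 0 0 : ℂ) * (t₀ : ℂ) + (γ 0 1 : ℝ)) / ((γ 1 0 : ℂ) * (t₀ : ℂ) + (γ 1 1 : ℝ)) ∈ N := by
    rw [moebius_ofReal]; exact hrealN _
  have hMobN : ∀ᶠ η : ℂ in 𝓝 (t₀ : ℂ),
      ((γ 0 0 : ℂ) * η + (γ 0 1 : ℝ)) / ((γ 1 0 : ℂ) * η + (γ 1 1 : ℝ)) ∈ N :=
    (differentiableAt_moebius γ ht₀').continuousAt.preimage_mem_nhds (hN.mem_nhds hMobt₀)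
  have hηN : ∀ᶠ η : ℂ in 𝓝 (t₀ : ℂ), η ∈ N := hN.mem_nhds (hrealN t₀)
  -- collect
  have hall : ∀ᶠ η : ℂ in 𝓝 (t₀ : ℂ), η ∈ Metric.ball (t₀ : ℂ) δ₁ ∧
      (DifferentiableAt ℂ (fun η : ℂ => poissonKernelC η z₀ / poissonKernelC η a₁) η ∧
        poissonKernelC η a₁ ≠ 0) ∧
      poissonKernelC η z₀ / poissonKernelC η a₁ ∈ Complex.slitPlane ∧
      (γ 1 0 : ℂ) * η + (γ 1 1 : ℝ) ≠ 0 ∧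
      ((γ 0 0 : ℂ) * η + (γ 0 1 : ℝ)) / ((γ 1 0 : ℂ) * η + (γ 1 1 : ℝ)) ∈ N ∧ η ∈ N :=
    (show ∀ᶠ η : ℂ in 𝓝 (t₀ : ℂ), η ∈ Metric.ball (t₀ : ℂ) δ₁ from
      Metric.ball_mem_nhds (t₀ : ℂ) hδ₁).and (hμdiff.and (hμslit.and (hden.and (hMobN.and hηN))))
  obtain ⟨δ', hδ', hball⟩ := Metric.eventually_nhds_iff_ball.mp hall
  have hLHS : DifferentiableOn ℂ (fun η : ℂ =>
      greenSegmentIntegral (u ∘ ofComplex) (ratioKernel s z₀ η) a₁ z₀) (Metric.ball (t₀ : ℂ) δ') := by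
    intro η hη
    have hη₁ : η ∈ Metric.ball (t₀ : ℂ) δ₁ := (hball η hη).1
    exact ((hc η hη₁).differentiableAt (Metric.isOpen_ball.mem_nhds hη₁)).differentiableWithinAt
  have hpt : ∀ η ∈ Metric.ball (t₀ : ℂ) δ',
      poissonKernelC η z₀ / poissonKernelC η a₁ ∈ Complex.slitPlane ∧
      DifferentiableAt ℂ (fun η : ℂ => poissonKernelC η z₀ / poissonKernelC η a₁) η ∧
      (γ 1 0 : ℂ) * η + (γ 1 1 : ℝ) ≠ 0 ∧ η ∈ N ∧
      ((γ 0 0 : ℂ) * η + (γ 0 1 : ℝ)) / ((γ 1 0 : ℂ) * η + (γ 1 1 : ℝ)) ∈ N ∧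
      DifferentiableAt ℂ Φ η ∧
      DifferentiableAt ℂ (fun η : ℂ =>
        Φ (((γ 0 0 : ℂ) * η + (γ 0 1 : ℝ)) / ((γ 1 0 : ℂ) * η + (γ 1 1 : ℝ)))) η := by
    intro η hη
    obtain ⟨-, ⟨hμd, -⟩, hsl, hd, hMN, hηN'⟩ := hball η hη
    refine ⟨hsl, hμd, hd, hηN', hMN, hΦN.differentiableAt (hN.mem_nhds hηN'), ?_⟩
    exact (hΦN.differentiableAt (hN.mem_nhds hMN)).comp η (differentiableAt_moebius γ hd)
  have hRHS : DifferentiableOn ℂ (fun η : ℂ =>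
      (poissonKernelC η z₀ / poissonKernelC η a₁) ^ (-s) *
        Φ (((γ 0 0 : ℂ) * η + (γ 0 1 : ℝ)) / ((γ 1 0 : ℂ) * η + (γ 1 1 : ℝ))) - Φ η)
      (Metric.ball (t₀ : ℂ) δ') := by
    intro η hη
    obtain ⟨hsl, hμd, -, -, -, hΦd, hΦMd⟩ := hpt η hη
    exact (((hμd.cpow (differentiableAt_const _) hsl).mul hΦMd).sub hΦd).differentiableWithinAt
  refine ⟨δ', hδ', hLHS, hpt, ?_⟩
  -- identity theorem along the reals
  have hreal := hybridCoboundary_ofReal s φ u hdet z₀ hΦ hcb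
  have hev : ∀ᶠ t : ℝ in 𝓝[≠] t₀,
      (fun η : ℂ => greenSegmentIntegral (u ∘ ofComplex) (ratioKernel s z₀ η) a₁ z₀) t =
      (fun η : ℂ => (poissonKernelC η z₀ / poissonKernelC η a₁) ^ (-s) *
        Φ (((γ 0 0 : ℂ) * η + (γ 0 1 : ℝ)) / ((γ 1 0 : ℂ) * η + (γ 1 1 : ℝ))) - Φ η) t :=
    hreal.filter_mono (nhdsNE_le_cofinite t₀)
  exact eqOn_of_eqOn_real Metric.isOpen_ball (convex_ball _ _).isPreconnected
    (Metric.mem_ball_self hδ') hLHS hRHS hev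

attribute [local irreducible] ratioKernel poissonKernelC in
/-- **The twisted functional equation on a seed patch.** With `g ∈ Γ` (determinant one),
`Φ` the collar extension, `h(ξ) = ∫_{z₀}^{ξ} [u, (R_ξ/R_ξ(z₀))^s]` the canonical integral and
`D = Φ - h`, `μ(η) = R_η(z₀)/R_η(g z₀)`: for `η ∈ ℍ` in a small disc around a real point `t₀` (not the
pole of `g⁻¹`) one has `D(g⁻¹ η) = μ(η)^s D(η)` (coboundary hypothesis in the hybrid model +
transformation law of the canonical integral), hence the branch-free identity
`F' D - F D' = s (μ'/μ) F D` for `F = D ∘ g⁻¹`.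
[cite: BruggemanLewisZagier2015, Proposition 5.1 pp. 30–31] -/
theorem seed_functionalEquation (hu : IsInvariantEigenfunction Γ s u) (hs : s.re < 1)
    (hs' : 0 < s.re) (hs1 : s ≠ 1) {g : GL (Fin 2) ℝ} (hg : g ∈ Γ) (hdet : g.det.val = 1)
    (z₀ : ℍ) {φ : ℝ → ℂ} {N : Set ℂ} (hN : IsOpen N) {Φ : ℂ → ℂ} (hΦN : DifferentiableOn ℂ Φ N)
    (hrealN : ∀ t : ℝ, (t : ℂ) ∈ N)
    (hΦ : ∀ t : ℝ, Φ t = φ t * (poissonKernelC t z₀) ^ (-s))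
    (hcb : ∀ᶠ t : ℝ in cofinite, lewisZagierCocycle s z₀ u g⁻¹ t = lineSlash s g⁻¹ φ t - φ t)
    {t₀ : ℝ} (ht₀ : g⁻¹ 1 0 * t₀ + g⁻¹ 1 1 ≠ 0) :
    ∃ δ' > 0, ∀ η ∈ Metric.ball (t₀ : ℂ) δ', 0 < η.im →
      0 < ((((g⁻¹ 0 0 : ℂ) * η + (g⁻¹ 0 1 : ℝ)) / ((g⁻¹ 1 0 : ℂ) * η + (g⁻¹ 1 1 : ℝ)))).im ∧ η ∈ N ∧ (((g⁻¹ 0 0 : ℂ) * η + (g⁻¹ 0 1 : ℝ)) / ((g⁻¹ 1 0 : ℂ) * η + (g⁻¹ 1 1 : ℝ))) ∈ N ∧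
      (poissonKernelC η z₀ / poissonKernelC η ((g • z₀ : ℍ) : ℂ)) ∈ Complex.slitPlane ∧
      DifferentiableAt ℂ (fun η : ℂ => (poissonKernelC η z₀ / poissonKernelC η ((g • z₀ : ℍ) : ℂ))) η ∧
      DifferentiableAt ℂ Φ η ∧ DifferentiableAt ℂ (fun η : ℂ => Φ (((g⁻¹ 0 0 : ℂ) * η + (g⁻¹ 0 1 : ℝ)) / ((g⁻¹ 1 0 : ℂ) * η + (g⁻¹ 1 1 : ℝ)))) η ∧
      (Φ (((g⁻¹ 0 0 : ℂ) * η + (g⁻¹ 0 1 : ℝ)) / ((g⁻¹ 1 0 : ℂ) * η + (g⁻¹ 1 1 : ℝ))) - greenSegmentIntegral (u ∘ ofComplex) (ratioKernel s z₀ (((g⁻¹ 0 0 : ℂ) * η + (g⁻¹ 0 1 : ℝ)) / ((g⁻¹ 1 0 : ℂ) * η + (g⁻¹ 1 1 : ℝ)))) z₀ (((g⁻¹ 0 0 : ℂ) * η + (g⁻¹ 0 1 : ℝ)) / ((g⁻¹ 1 0 : ℂ) * η + (g⁻¹ 1 1 : ℝ))) = (poissonKernelC η z₀ / poissonKernelC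 η ((g • z₀ : ℍ) : ℂ)) ^ s * (Φ η - greenSegmentIntegral (u ∘ ofComplex) (ratioKernel s z₀ η) z₀ η)) ∧
      deriv (fun η : ℂ => Φ (((g⁻¹ 0 0 : ℂ) * η + (g⁻¹ 0 1 : ℝ)) / ((g⁻¹ 1 0 : ℂ) * η + (g⁻¹ 1 1 : ℝ))) - greenSegmentIntegral (u ∘ ofComplex) (ratioKernel s z₀ (((g⁻¹ 0 0 : ℂ) * η + (g⁻¹ 0 1 : ℝ)) / ((g⁻¹ 1 0 : ℂ) * η + (g⁻¹ 1 1 : ℝ)))) z₀ (((g⁻¹ 0 0 : ℂ) * η + (g⁻¹ 0 1 : ℝ)) / ((g⁻¹ 1 0 : ℂ) * η + (g⁻¹ 1 1 : ℝ)))) η * (Φ η - greenSegmentIntegral (u ∘ ofComplex) (ratioKernel s z₀ η) z₀ η) -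
          (Φ (((g⁻¹ 0 0 : ℂ) * η + (g⁻¹ 0 1 : ℝ)) / ((g⁻¹ 1 0 : ℂ) * η + (g⁻¹ 1 1 : ℝ))) - greenSegmentIntegral (u ∘ ofComplex) (ratioKernel s z₀ (((g⁻¹ 0 0 : ℂ) * η + (g⁻¹ 0 1 : ℝ)) / ((g⁻¹ 1 0 : ℂ) * η + (g⁻¹ 1 1 : ℝ)))) z₀ (((g⁻¹ 0 0 : ℂ) * η + (g⁻¹ 0 1 : ℝ)) / ((g⁻¹ 1 0 : ℂ) * η + (g⁻¹ 1 1 : ℝ)))) * deriv (fun η : ℂ => Φ η - greenSegmentIntegral (u ∘ ofComplex) (ratioKernel s z₀ η) z₀ η) η =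
        s * (deriv (fun η : ℂ => (poissonKernelC η z₀ / poissonKernelC η ((g • z₀ : ℍ) : ℂ))) η / (poissonKernelC η z₀ / poissonKernelC η ((g • z₀ : ℍ) : ℂ))) *
          ((Φ (((g⁻¹ 0 0 : ℂ) * η + (g⁻¹ 0 1 : ℝ)) / ((g⁻¹ 1 0 : ℂ) * η + (g⁻¹ 1 1 : ℝ))) - greenSegmentIntegral (u ∘ ofComplex) (ratioKernel s z₀ (((g⁻¹ 0 0 : ℂ) * η + (g⁻¹ 0 1 : ℝ)) / ((g⁻¹ 1 0 : ℂ) * η + (g⁻¹ 1 1 : ℝ)))) z₀ (((g⁻¹ 0 0 : ℂ) * η + (g⁻¹ 0 1 : ℝ)) / ((g⁻¹ 1 0 : ℂ) * η + (g⁻¹ 1 1 : ℝ)))) * (Φ η - greenSegmentIntegral (u ∘ ofComplex) (ratioKernel s z₀ η) z₀ η)) := by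
  have hs0 : s ≠ 0 := fun h => by rw [h] at hs'; simp at hs'
  set γ : GL (Fin 2) ℝ := g⁻¹ with hγdef
  set a₁ : ℂ := ((g • z₀ : ℍ) : ℂ) with ha₁
  have ha₁im : 0 < a₁.im := (g • z₀).coe_im_pos
  have hz₀im : 0 < (z₀ : ℂ).im := z₀.coe_im_pos
  have hz₀im' : 0 < z₀.im := z₀.im_pos
  have hγdet : γ.det.val = 1 := det_inv_eq_one hdet
  have hγpos : 0 < γ.det.val := by rw [hγdet]; exact one_pos
  have hU : ContDiffOn ℝ 2 (u ∘ ofComplex) {z : ℂ | 0 < z.im} := hu.isC2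
  obtain ⟨δ₁, hδ₁, hcdiff, hpt, hCB⟩ := hybridCoboundary_ball s φ hU hdet z₀ hN hΦN hrealN hΦ hcb ht₀
  -- the Möbius map is continuous at `t₀`; its value there is real
  have ht₀' : (γ 1 0 : ℂ) * (t₀ : ℂ) + (γ 1 1 : ℝ) ≠ 0 := by
    have : (γ 1 0 * t₀ + γ 1 1 : ℝ) ≠ 0 := ht₀
    exact_mod_cast this
  have hMobc : ContinuousAt (fun η : ℂ => (((γ 0 0 : ℂ) * η + (γ 0 1 : ℝ)) / ((γ 1 0 : ℂ) * η + (γ 1 1 : ℝ)))) (t₀ : ℂ) :=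
    (differentiableAt_moebius γ ht₀').continuousAt
  set ζ₀ : ℝ := (γ 0 0 * t₀ + γ 0 1) / (γ 1 0 * t₀ + γ 1 1) with hζ₀
  have hMobt₀ : (((γ 0 0 : ℂ) * (t₀ : ℂ) + (γ 0 1 : ℝ)) / ((γ 1 0 : ℂ) * (t₀ : ℂ) + (γ 1 1 : ℝ))) = (ζ₀ : ℂ) := moebius_ofReal γ t₀
  -- `ζ₀` is not the pole of `g`
  have hgζ₀ : g 1 0 * ζ₀ + g 1 1 ≠ 0 := by
    have h := denom_mul_denom_eq_one (mul_inv_cancel g) ht₀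
    intro h0
    rw [hζ₀] at h0
    rw [h0, zero_mul] at h
    exact one_ne_zero h.symm
  -- eventualities at `t₀`
  have ev_ball : ∀ᶠ η : ℂ in 𝓝 (t₀ : ℂ), η ∈ Metric.ball (t₀ : ℂ) δ₁ := Metric.ball_mem_nhds _ hδ₁
  have ev_ne : ∀ᶠ η : ℂ in 𝓝 (t₀ : ℂ), (((γ 0 0 : ℂ) * η + (γ 0 1 : ℝ)) / ((γ 1 0 : ℂ) * η + (γ 1 1 : ℝ))) ≠ (z₀ : ℂ) := by
    apply hMobc.eventually_ne
    rw [hMobt₀]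
    intro h; have := congrArg Complex.im h; simp at this; linarith
  have ev_h1 : ∀ᶠ η : ℂ in 𝓝 (t₀ : ℂ), η.im < a₁.im :=
    Complex.continuous_im.continuousAt.eventually_lt continuousAt_const (by simpa using ha₁im)
  have ev_h2 : ∀ᶠ η : ℂ in 𝓝 (t₀ : ℂ), η.im < (z₀ : ℂ).im :=
    Complex.continuous_im.continuousAt.eventually_lt continuousAt_const (by simpa using hz₀im)
  have ev_cond : ∀ᶠ η : ℂ in 𝓝 (t₀ : ℂ),
      ((((γ 0 0 : ℂ) * η + (γ 0 1 : ℝ)) / ((γ 1 0 : ℂ) * η + (γ 1 1 : ℝ)))).im *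
          (2 * |g 1 0| * ‖(g 1 0 : ℂ) * (((γ 0 0 : ℂ) * η + (γ 0 1 : ℝ)) / ((γ 1 0 : ℂ) * η + (γ 1 1 : ℝ))) + (g 1 1 : ℝ)‖ *
              ‖(z₀ : ℂ) - (((γ 0 0 : ℂ) * η + (γ 0 1 : ℝ)) / ((γ 1 0 : ℂ) * η + (γ 1 1 : ℝ)))‖ +
            (g 1 0) ^ 2 * ‖(z₀ : ℂ) - (((γ 0 0 : ℂ) * η + (γ 0 1 : ℝ)) / ((γ 1 0 : ℂ) * η + (γ 1 1 : ℝ)))‖ ^ 2) <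
        ((z₀ : ℂ).im - ((((γ 0 0 : ℂ) * η + (γ 0 1 : ℝ)) / ((γ 1 0 : ℂ) * η + (γ 1 1 : ℝ)))).im) *
          ‖(g 1 0 : ℂ) * (((γ 0 0 : ℂ) * η + (γ 0 1 : ℝ)) / ((γ 1 0 : ℂ) * η + (γ 1 1 : ℝ))) + (g 1 1 : ℝ)‖ ^ 2 := by
    have hL : ContinuousAt (fun η : ℂ => ((((γ 0 0 : ℂ) * η + (γ 0 1 : ℝ)) / ((γ 1 0 : ℂ) * η + (γ 1 1 : ℝ)))).im *
          (2 * |g 1 0| * ‖(g 1 0 : ℂ) * (((γ 0 0 : ℂ) * η + (γ 0 1 : ℝ)) / ((γ 1 0 : ℂ) * η + (γ 1 1 : ℝ))) + (g 1 1 : ℝ)‖ *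
              ‖(z₀ : ℂ) - (((γ 0 0 : ℂ) * η + (γ 0 1 : ℝ)) / ((γ 1 0 : ℂ) * η + (γ 1 1 : ℝ)))‖ +
            (g 1 0) ^ 2 * ‖(z₀ : ℂ) - (((γ 0 0 : ℂ) * η + (γ 0 1 : ℝ)) / ((γ 1 0 : ℂ) * η + (γ 1 1 : ℝ)))‖ ^ 2)) (t₀ : ℂ) := by
      apply ContinuousAt.mul (Complex.continuous_im.continuousAt.comp hMobc)
      apply ContinuousAt.add
      · apply ContinuousAt.mul
        · exact continuousAt_const.mul (continuous_norm.continuousAt.comp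
            ((continuousAt_const.mul hMobc).add continuousAt_const))
        · exact continuous_norm.continuousAt.comp (continuousAt_const.sub hMobc)
      · exact continuousAt_const.mul ((continuous_norm.continuousAt.comp
          (continuousAt_const.sub hMobc)).pow 2)
    have hR : ContinuousAt (fun η : ℂ => ((z₀ : ℂ).im - ((((γ 0 0 : ℂ) * η + (γ 0 1 : ℝ)) / ((γ 1 0 : ℂ) * η + (γ 1 1 : ℝ)))).im) *
          ‖(g 1 0 : ℂ) * (((γ 0 0 : ℂ) * η + (γ 0 1 : ℝ)) / ((γ 1 0 : ℂ) * η + (γ 1 1 : ℝ))) + (g 1 1 : ℝ)‖ ^ 2) (t₀ : ℂ) := by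
      apply ContinuousAt.mul (continuousAt_const.sub (Complex.continuous_im.continuousAt.comp hMobc))
      exact (continuous_norm.continuousAt.comp ((continuousAt_const.mul hMobc).add continuousAt_const)).pow 2
    apply hL.eventually_lt hR
    rw [hMobt₀]
    simp only [Complex.ofReal_im, zero_mul, sub_zero]
    apply mul_pos hz₀im
    apply pow_pos
    rw [norm_pos_iff]
    have : (g 1 0 * ζ₀ + g 1 1 : ℝ) ≠ 0 := hgζ₀
    exact_mod_cast this
  have hμt₀ : poissonKernelC (t₀ : ℂ) z₀ / poissonKernelC (t₀ : ℂ) a₁ =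
      ((hypPoissonKernel t₀ z₀ / hypPoissonKernel t₀ a₁ : ℝ) : ℂ) := by
    rw [poissonKernelC_ofReal, poissonKernelC_ofReal, Complex.ofReal_div]
  have ev_μ : ∀ᶠ η : ℂ in 𝓝 (t₀ : ℂ), 0 < (poissonKernelC η z₀ / poissonKernelC η a₁).re := by
    have hcont : ContinuousAt (fun η : ℂ => poissonKernelC η z₀ / poissonKernelC η a₁) (t₀ : ℂ) :=
      (hpt (t₀ : ℂ) (Metric.mem_ball_self hδ₁)).2.1.continuousAt
    have hcont' := Complex.continuous_re.continuousAt.comp hcont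
    refine continuousAt_const.eventually_lt hcont' ?_
    show (0 : ℝ) < ((fun η : ℂ => poissonKernelC η z₀ / poissonKernelC η a₁) (t₀ : ℂ)).re
    simp only []
    rw [hμt₀, Complex.ofReal_re]
    exact div_pos (hypPoissonKernel_pos t₀ hz₀im) (hypPoissonKernel_pos t₀ ha₁im)
  have ev_seg : ∀ᶠ η : ℂ in 𝓝 (t₀ : ℂ), ∀ w ∈ segment ℝ a₁ (z₀ : ℂ),
      0 < (poissonKernelC η w / poissonKernelC η z₀).re := by
    have hK : IsCompact (segment ℝ a₁ (z₀ : ℂ)) := by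
      rw [segment_eq_image_lineMap]
      exact isCompact_Icc.image AffineMap.lineMap_continuous
    apply hK.eventually_forall_of_forall_eventually
    intro w hw
    have hwim : 0 < w.im := (convex_halfSpace_im_gt 0).segment_subset ha₁im hz₀im hw
    -- joint continuity of `(η, w) ↦ Re (R_η(w)/R_η(z₀))` at `(t₀, w)`
    have h1 : (t₀ : ℂ) - w ≠ 0 := by
      rw [sub_ne_zero]; intro h; have := congrArg Complex.im h; simp at this; linarith
    have h2 : (t₀ : ℂ) - conj w ≠ 0 := by
      rw [sub_ne_zero]; intro h; have := congrArg Complex.im h; simp at this; linarith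
    have h3 : (t₀ : ℂ) - (z₀ : ℂ) ≠ 0 := by
      rw [sub_ne_zero]; intro h; have := congrArg Complex.im h; simp at this; linarith
    have h4 : (t₀ : ℂ) - conj (z₀ : ℂ) ≠ 0 := by
      rw [sub_ne_zero]; intro h; have := congrArg Complex.im h; simp at this; linarith
    have hPw : ContinuousAt (fun p : ℂ × ℂ => poissonKernelC p.1 p.2) ((t₀ : ℂ), w) := by
      unfold poissonKernelC
      refine ContinuousAt.div (by fun_prop) (by fun_prop) ?_
      exact mul_ne_zero h1 h2
    have hPz : ContinuousAt (fun p : ℂ × ℂ => poissonKernelC p.1 (z₀ : ℂ)) ((t₀ : ℂ), w) := by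
      unfold poissonKernelC
      refine ContinuousAt.div (by fun_prop) (by fun_prop) ?_
      exact mul_ne_zero h3 h4
    have hPz0 : poissonKernelC (t₀ : ℂ) (z₀ : ℂ) ≠ 0 := by
      rw [poissonKernelC_ofReal]; exact_mod_cast (hypPoissonKernel_pos t₀ hz₀im).ne'
    have hf : ContinuousAt (fun p : ℂ × ℂ => (poissonKernelC p.1 p.2 / poissonKernelC p.1 (z₀ : ℂ)).re)
        ((t₀ : ℂ), w) :=
      Complex.continuous_re.continuousAt.comp (hPw.div hPz hPz0)
    refine continuousAt_const.eventually_lt hf ?_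
    show (0 : ℝ) < (poissonKernelC (t₀ : ℂ) w / poissonKernelC (t₀ : ℂ) (z₀ : ℂ)).re
    rw [poissonKernelC_ofReal, poissonKernelC_ofReal, ← Complex.ofReal_div, Complex.ofReal_re]
    exact div_pos (hypPoissonKernel_pos t₀ hwim) (hypPoissonKernel_pos t₀ hz₀im)
  -- collect
  obtain ⟨δ', hδ', hall⟩ := Metric.eventually_nhds_iff_ball.mp
    (ev_ball.and (ev_ne.and (ev_h1.and (ev_h2.and (ev_cond.and (ev_μ.and ev_seg))))))
  -- the functional equation at every point of the half-disc
  have hFE : ∀ η ∈ Metric.ball (t₀ : ℂ) δ', ∀ hη : 0 < η.im,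
      (((γ 0 0 : ℂ) * η + (γ 0 1 : ℝ)) / ((γ 1 0 : ℂ) * η + (γ 1 1 : ℝ))) = ((γ • (⟨η, hη⟩ : ℍ) : ℍ) : ℂ) ∧
      Φ (((γ 0 0 : ℂ) * η + (γ 0 1 : ℝ)) / ((γ 1 0 : ℂ) * η + (γ 1 1 : ℝ))) - greenSegmentIntegral (u ∘ ofComplex) (ratioKernel s z₀ (((γ 0 0 : ℂ) * η + (γ 0 1 : ℝ)) / ((γ 1 0 : ℂ) * η + (γ 1 1 : ℝ)))) z₀ (((γ 0 0 : ℂ) * η + (γ 0 1 : ℝ)) / ((γ 1 0 : ℂ) * η + (γ 1 1 : ℝ))) =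
        (poissonKernelC η z₀ / poissonKernelC η a₁) ^ s * (Φ η - greenSegmentIntegral (u ∘ ofComplex) (ratioKernel s z₀ η) z₀ η) := by
    intro η hη hηim
    obtain ⟨hb₁, hne, h1, h2, hcond, hμre, hseg⟩ := hall η hη
    have hMob : (((γ 0 0 : ℂ) * η + (γ 0 1 : ℝ)) / ((γ 1 0 : ℂ) * η + (γ 1 1 : ℝ))) = ((γ • (⟨η, hηim⟩ : ℍ) : ℍ) : ℂ) :=
      moebius_apply_of_im_pos hγpos hηim
    refine ⟨hMob, ?_⟩
    set ζ : ℍ := γ • (⟨η, hηim⟩ : ℍ) with hζdef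
    have hgζ : ((g • ζ : ℍ) : ℂ) = η := by
      rw [hζdef, hγdef, smul_inv_smul]
    have hζne : (ζ : ℂ) ≠ z₀ := by rw [← hMob]; exact hne
    rw [hMob] at hcond
    have hT := canonicalIntegral_transform hu hs hs' hs1 hg hdet z₀ ζ hζne hgζ rfl h1 h2 hcond hμre hseg
    have hcb' := hCB η hb₁
    rw [hMob] at hcb' ⊢
    -- `μ^s μ^{-s} = 1`
    have hμslit : poissonKernelC η z₀ / poissonKernelC η a₁ ∈ Complex.slitPlane := (hpt η hb₁).1
    have hμ0 : poissonKernelC η z₀ / poissonKernelC η a₁ ≠ 0 := Complex.slitPlane_ne_zero hμslit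
    have hμs0 : (poissonKernelC η z₀ / poissonKernelC η a₁) ^ s ≠ 0 := by
      rw [Ne, Complex.cpow_eq_zero_iff, not_and_or]; left; exact hμ0
    have e : (poissonKernelC η z₀ / poissonKernelC η a₁) ^ s *
        (poissonKernelC η z₀ / poissonKernelC η a₁) ^ (-s) = 1 := by
      rw [Complex.cpow_neg, mul_inv_cancel₀ hμs0]
    rw [hcb'] at hT
    linear_combination (-1 : ℂ) * hT - (Φ (ζ : ℂ)) * e
  refine ⟨δ', hδ', fun η hη hηim => ?_⟩
  obtain ⟨hb₁, hne, h1, h2, hcond, hμre, hseg⟩ := hall η hη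
  obtain ⟨hμslit, hμd, hden, hηN, hMN, hΦd, hΦMd⟩ := hpt η hb₁
  obtain ⟨hMob, hFEη⟩ := hFE η hη hηim
  have hζim : 0 < ((((γ 0 0 : ℂ) * η + (γ 0 1 : ℝ)) / ((γ 1 0 : ℂ) * η + (γ 1 1 : ℝ)))).im := by
    rw [hMob]; exact (γ • (⟨η, hηim⟩ : ℍ)).coe_im_pos
  refine ⟨hζim, hηN, hMN, hμslit, hμd, hΦd, hΦMd, hFEη, ?_⟩
  -- the derivative identity
  have hμ0 : poissonKernelC η z₀ / poissonKernelC η a₁ ≠ 0 := Complex.slitPlane_ne_zero hμslit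
  -- `D` is differentiable at `η`
  have hHd : DifferentiableAt ℂ (fun ξ : ℂ => greenSegmentIntegral (u ∘ ofComplex) (ratioKernel s z₀ ξ) z₀ ξ) η :=
    (differentiableOn_canonicalIntegral hu hs hs0 hs1 hz₀im).differentiableAt
      (isOpen_upperHalfPlaneSet.mem_nhds hηim)
  have hDd : DifferentiableAt ℂ (fun ξ : ℂ => Φ ξ - greenSegmentIntegral (u ∘ ofComplex) (ratioKernel s z₀ ξ) z₀ ξ) η := hΦd.sub hHd
  -- near `η`, `F = μ^s D`
  have hW : ∀ᶠ η' : ℂ in 𝓝 η, η' ∈ Metric.ball (t₀ : ℂ) δ' ∧ 0 < η'.im := by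
    filter_upwards [Metric.isOpen_ball.mem_nhds hη, isOpen_upperHalfPlaneSet.mem_nhds hηim]
      with η' h1 h2
    exact ⟨h1, h2⟩
  have hev : (fun η' : ℂ => Φ (((γ 0 0 : ℂ) * η' + (γ 0 1 : ℝ)) / ((γ 1 0 : ℂ) * η' + (γ 1 1 : ℝ))) - greenSegmentIntegral (u ∘ ofComplex) (ratioKernel s z₀ (((γ 0 0 : ℂ) * η' + (γ 0 1 : ℝ)) / ((γ 1 0 : ℂ) * η' + (γ 1 1 : ℝ)))) z₀ (((γ 0 0 : ℂ) * η' + (γ 0 1 : ℝ)) / ((γ 1 0 : ℂ) * η' + (γ 1 1 : ℝ)))) =ᶠ[𝓝 η]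
      fun η' : ℂ => (poissonKernelC η' z₀ / poissonKernelC η' a₁) ^ s * (Φ η' - greenSegmentIntegral (u ∘ ofComplex) (ratioKernel s z₀ η') z₀ η') := by
    filter_upwards [hW] with η' hη'
    exact (hFE η' hη'.1 hη'.2).2
  rw [hev.deriv_eq]
  have hderiv : HasDerivAt (fun η' : ℂ => (poissonKernelC η' z₀ / poissonKernelC η' a₁) ^ s *
      (Φ η' - greenSegmentIntegral (u ∘ ofComplex) (ratioKernel s z₀ η') z₀ η'))
      ((s * (poissonKernelC η z₀ / poissonKernelC η a₁) ^ (s - 1) *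
        deriv (fun η' : ℂ => poissonKernelC η' z₀ / poissonKernelC η' a₁) η) *
        (Φ η - greenSegmentIntegral (u ∘ ofComplex) (ratioKernel s z₀ η) z₀ η) +
       (poissonKernelC η z₀ / poissonKernelC η a₁) ^ s *
        deriv (fun ξ : ℂ => Φ ξ - greenSegmentIntegral (u ∘ ofComplex) (ratioKernel s z₀ ξ) z₀ ξ) η) η :=
    (hμd.hasDerivAt.cpow_const hμslit).mul hDd.hasDerivAt
  rw [hderiv.deriv, hFEη]
  have hsub : (poissonKernelC η z₀ / poissonKernelC η a₁) ^ (s - 1) =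
      (poissonKernelC η z₀ / poissonKernelC η a₁) ^ s / (poissonKernelC η z₀ / poissonKernelC η a₁) := by
    rw [Complex.cpow_sub _ _ hμ0, Complex.cpow_one]
  rw [hsub]
  field_simp
  ring

end SeedPatch

/-! ## 25. Loop integrals: the winding lemma and `∮ μ'/μ`

The argument-principle computation on a collar (BLZ p. 31, proof of Proposition 5.1,
"`H_s^Γ = {0}` by an argument on a collar of `S¹`"): for `f` holomorphic and zero-free on a
circle, `∮ f'/f ∈ 2πiℤ` (continuous logarithm along the loop); the rational factor
`μ(η) = R_η(z₀)/R_η(a₁)` of the twisted functional equation has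
`μ'/μ = (η-a₁)⁻¹ + (η-ā₁)⁻¹ - (η-z₀)⁻¹ - (η-z̄₀)⁻¹`, so `∮ μ'/μ = -2πi` around a circle in `ℍ`
enclosing `z₀` but not `a₁`; and the identity `F'D - FD' = s(μ'/μ)FD` on such a circle with
`F`, `D` zero-free forces `s ∈ ℤ`. -/

section LoopIntegrals

open Real in
/-- **Winding lemma.** For `f` holomorphic on a neighbourhood of the circle `|z - c| = R` and
zero-free on it, `∮ f'/f dz ∈ 2πi ℤ`. [folklore] -/
theorem circleIntegral_logDeriv_mem_zmultiples {f : ℂ → ℂ} {c : ℂ} {R : ℝ} (hR : 0 < R)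
    {V : Set ℂ} (hV : IsOpen V) (hsub : Metric.sphere c R ⊆ V) (hf : DifferentiableOn ℂ f V)
    (hne : ∀ z ∈ Metric.sphere c R, f z ≠ 0) :
    ∃ n : ℤ, (∮ z in C(c, R), deriv f z / f z) = n * (2 * π * Complex.I) := by
  -- the loop `g = f ∘ circleMap` and its logarithmic derivative
  obtain ⟨g, hg⟩ : ∃ g : ℝ → ℂ, g = fun θ => f (circleMap c R θ) := ⟨_, rfl⟩
  obtain ⟨k, hk⟩ : ∃ k : ℝ → ℂ,
      k = fun θ => deriv (circleMap c R) θ * (deriv f (circleMap c R θ) / f (circleMap c R θ)) :=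
    ⟨_, rfl⟩
  have hmem : ∀ θ : ℝ, circleMap c R θ ∈ V := fun θ => hsub (circleMap_mem_sphere c hR.le θ)
  have hgne : ∀ θ : ℝ, g θ ≠ 0 := fun θ => by
    rw [hg]; exact hne _ (circleMap_mem_sphere c hR.le θ)
  have hfne : ∀ θ : ℝ, f (circleMap c R θ) ≠ 0 := fun θ => hne _ (circleMap_mem_sphere c hR.le θ)
  have hfd : ∀ θ : ℝ, HasDerivAt f (deriv f (circleMap c R θ)) (circleMap c R θ) := fun θ =>
    ((hf.differentiableAt (hV.mem_nhds (hmem θ)))).hasDerivAt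
  have hgd : ∀ θ : ℝ, HasDerivAt g (deriv f (circleMap c R θ) * deriv (circleMap c R) θ) θ := by
    intro θ
    have := (hfd θ).comp θ (hasDerivAt_circleMap c R θ)
    rw [(hasDerivAt_circleMap c R θ).deriv, hg]
    exact this
  -- continuity of the integrand
  have hfa : AnalyticOnNhd ℂ f V := hf.analyticOnNhd hV
  have hdf : ContinuousOn (deriv f) V := hfa.deriv.continuousOn
  have hkc : Continuous k := by
    rw [hk]
    apply Continuous.mul
    · have : deriv (circleMap c R) = fun θ => circleMap 0 R θ * Complex.I := by
        funext θ; exact deriv_circleMap c R θ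
      rw [this]
      exact (continuous_circleMap 0 R).mul continuous_const
    · apply Continuous.div
      · exact hdf.comp_continuous (continuous_circleMap c R) hmem
      · exact hf.continuousOn.comp_continuous (continuous_circleMap c R) hmem
      · exact hfne
  -- the primitive `L` and the constancy of `exp(-L) g`
  obtain ⟨L, hL⟩ : ∃ L : ℝ → ℂ, L = fun θ => ∫ x in (0 : ℝ)..θ, k x := ⟨_, rfl⟩
  have hLd : ∀ θ : ℝ, HasDerivAt L (k θ) θ := fun θ => by
    rw [hL]; exact (hkc.integral_hasStrictDerivAt 0 θ).hasDerivAt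
  obtain ⟨h, hh⟩ : ∃ h : ℝ → ℂ, h = fun θ => Complex.exp (-L θ) * g θ := ⟨_, rfl⟩
  have hhd : ∀ θ : ℝ, HasDerivAt h 0 θ := by
    intro θ
    have h1 : HasDerivAt (fun θ => Complex.exp (-L θ)) (Complex.exp (-L θ) * (-k θ)) θ :=
      (hLd θ).neg.cexp
    have h2 := h1.mul (hgd θ)
    have e : Complex.exp (-L θ) * -k θ * g θ +
        Complex.exp (-L θ) * (deriv f (circleMap c R θ) * deriv (circleMap c R) θ) = 0 := by
      rw [hk, hg]
      field_simp [hfne θ]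
      ring
    rw [e] at h2
    rw [hh]
    exact h2
  have hconst : h (2 * π) = h 0 :=
    is_const_of_deriv_eq_zero (fun θ => (hhd θ).differentiableAt) (fun θ => (hhd θ).deriv) _ _
  -- evaluate
  have hg2π : g (2 * π) = g 0 := by
    rw [hg]
    have := periodic_circleMap c R 0
    rw [zero_add] at this
    simp only [this]
  have hL0 : L 0 = 0 := by rw [hL]; simp
  have hexp : Complex.exp (-L (2 * π)) = 1 := by
    have := hconst
    rw [hh] at this
    simp only [hL0, neg_zero, Complex.exp_zero, one_mul, hg2π] at this
    exact (mul_eq_right₀ (hgne 0)).mp this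
  obtain ⟨n, hn⟩ := Complex.exp_eq_one_iff.mp hexp
  refine ⟨-n, ?_⟩
  have hint : (∮ z in C(c, R), deriv f z / f z) = L (2 * π) := by
    rw [hL, hk]
    simp only [circleIntegral, smul_eq_mul]
  rw [hint]
  have : L (2 * π) = -(n * (2 * π * Complex.I)) := by rw [← hn]; ring
  rw [this]
  push_cast
  ring

/-- **The logarithmic derivative of `μ`.** For
`μ(η) = R_η(z₀)/R_η(a)` (`= (Im z₀/Im a)(η-a)(η-ā)/((η-z₀)(η-z̄₀))`),
`μ'(η)/μ(η) = (η-a)⁻¹ + (η-ā)⁻¹ - (η-z₀)⁻¹ - (η-z̄₀)⁻¹` off the four points.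
[cite: BruggemanLewisZagier2015, (1.7) p. 10] -/
theorem logDeriv_ratioBase {η z₀ a : ℂ} (hz₀ : z₀.im ≠ 0) (ha : a.im ≠ 0) (h1 : η ≠ z₀)
    (h2 : η ≠ conj z₀) (h3 : η ≠ a) (h4 : η ≠ conj a) :
    deriv (fun η : ℂ => poissonKernelC η z₀ / poissonKernelC η a) η /
        (poissonKernelC η z₀ / poissonKernelC η a) =
      (η - a)⁻¹ + (η - conj a)⁻¹ - (η - z₀)⁻¹ - (η - conj z₀)⁻¹ := by
  have hA : ∀ η : ℂ, η ≠ z₀ → η ≠ conj z₀ → η ≠ a → η ≠ conj a →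
      poissonKernelC η z₀ / poissonKernelC η a =
        ((z₀.im : ℂ) / (a.im : ℂ)) * (((η - a) * (η - conj a)) / ((η - z₀) * (η - conj z₀))) := by
    intro η h1 h2 h3 h4
    unfold poissonKernelC
    have ha' : (a.im : ℂ) ≠ 0 := by exact_mod_cast ha
    field_simp
  have hs1 : η - z₀ ≠ 0 := sub_ne_zero.mpr h1
  have hs2 : η - conj z₀ ≠ 0 := sub_ne_zero.mpr h2
  have hs3 : η - a ≠ 0 := sub_ne_zero.mpr h3
  have hs4 : η - conj a ≠ 0 := sub_ne_zero.mpr h4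
  have hz₀' : (z₀.im : ℂ) ≠ 0 := by exact_mod_cast hz₀
  have ha' : (a.im : ℂ) ≠ 0 := by exact_mod_cast ha
  -- the function agrees near `η` with the rational expression
  have hev : (fun η : ℂ => poissonKernelC η z₀ / poissonKernelC η a) =ᶠ[𝓝 η]
      fun η => ((z₀.im : ℂ) / (a.im : ℂ)) * (((η - a) * (η - conj a)) / ((η - z₀) * (η - conj z₀))) := by
    have ho : ∀ᶠ η' : ℂ in 𝓝 η, η' ≠ z₀ ∧ η' ≠ conj z₀ ∧ η' ≠ a ∧ η' ≠ conj a :=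
      (isOpen_ne.eventually_mem h1).and ((isOpen_ne.eventually_mem h2).and
        ((isOpen_ne.eventually_mem h3).and (isOpen_ne.eventually_mem h4)))
    filter_upwards [ho] with η' hη'
    exact hA η' hη'.1 hη'.2.1 hη'.2.2.1 hη'.2.2.2
  rw [hev.deriv_eq, hA η h1 h2 h3 h4]
  -- derivative of the rational expression
  have hN : HasDerivAt (fun η : ℂ => (η - a) * (η - conj a)) ((η - conj a) + (η - a)) η := by
    have h := ((hasDerivAt_id η).sub_const a).mul ((hasDerivAt_id η).sub_const (conj a))
    exact (h.congr_deriv (by simp)).congr_of_eventuallyEq (Eventually.of_forall fun y => rfl)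
  have hD : HasDerivAt (fun η : ℂ => (η - z₀) * (η - conj z₀)) ((η - conj z₀) + (η - z₀)) η := by
    have h := ((hasDerivAt_id η).sub_const z₀).mul ((hasDerivAt_id η).sub_const (conj z₀))
    exact (h.congr_deriv (by simp)).congr_of_eventuallyEq (Eventually.of_forall fun y => rfl)
  have hQ : HasDerivAt (fun η : ℂ => ((z₀.im : ℂ) / (a.im : ℂ)) *
      (((η - a) * (η - conj a)) / ((η - z₀) * (η - conj z₀))))
      (((z₀.im : ℂ) / (a.im : ℂ)) * ((((η - conj a) + (η - a)) * ((η - z₀) * (η - conj z₀)) -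
        ((η - a) * (η - conj a)) * ((η - conj z₀) + (η - z₀))) / ((η - z₀) * (η - conj z₀)) ^ 2)) η :=
    (hN.fun_div hD (mul_ne_zero hs1 hs2)).const_mul ((z₀.im : ℂ) / (a.im : ℂ))
  rw [hQ.deriv]
  field_simp
  ring

open Real in
/-- `∮ (z - p)⁻¹ dz = 0` around a circle whose closed disc misses `p`. [folklore] -/
theorem circleIntegral_sub_inv_of_not_mem_closedBall {c p : ℂ} {R : ℝ} (hR : 0 ≤ R)
    (hp : p ∉ Metric.closedBall c R) : (∮ z in C(c, R), (z - p)⁻¹) = 0 := by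
  apply Complex.circleIntegral_eq_zero_of_differentiable_on_off_countable hR Set.countable_empty
  · apply ContinuousOn.inv₀ (by fun_prop)
    intro z hz h0
    exact hp (by rwa [sub_eq_zero.mp h0] at hz)
  · intro z hz
    refine DifferentiableAt.inv (by fun_prop) ?_
    intro h0
    exact hp (Metric.ball_subset_closedBall (by simpa [sub_eq_zero.mp h0] using hz.1))

open Real in
/-- **`∮ μ'/μ = -2πi`** around a circle in the plane enclosing `z₀` whose closed disc misses
`a`, `ā` and `z̄₀`. [cite: BruggemanLewisZagier2015, Proposition 5.1 pp. 30–31] -/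
theorem circleIntegral_logDeriv_ratioBase {c z₀ a : ℂ} {R : ℝ} (hR : 0 < R) (hz₀ : z₀.im ≠ 0)
    (ha : a.im ≠ 0) (hz₀c : z₀ ∈ Metric.ball c R) (hz₀c' : conj z₀ ∉ Metric.closedBall c R)
    (hac : a ∉ Metric.closedBall c R) (hac' : conj a ∉ Metric.closedBall c R) :
    (∮ z in C(c, R), deriv (fun η : ℂ => poissonKernelC η z₀ / poissonKernelC η a) z /
        (poissonKernelC z z₀ / poissonKernelC z a)) = -(2 * π * Complex.I) := by
  have hsph : ∀ z ∈ Metric.sphere c R, z ≠ z₀ ∧ z ≠ conj z₀ ∧ z ≠ a ∧ z ≠ conj a := by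
    intro z hz
    have hzc : z ∈ Metric.closedBall c R := Metric.sphere_subset_closedBall hz
    refine ⟨?_, ?_, ?_, ?_⟩
    · intro h; rw [h] at hz
      rw [Metric.mem_ball] at hz₀c; rw [Metric.mem_sphere] at hz; linarith
    · intro h; rw [h] at hzc; exact hz₀c' hzc
    · intro h; rw [h] at hzc; exact hac hzc
    · intro h; rw [h] at hzc; exact hac' hzc
  rw [circleIntegral.integral_congr hR.le (fun z hz => logDeriv_ratioBase hz₀ ha (hsph z hz).1
    (hsph z hz).2.1 (hsph z hz).2.2.1 (hsph z hz).2.2.2)]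
  have hci : ∀ p : ℂ, p ∉ Metric.sphere c R → CircleIntegrable (fun z : ℂ => (z - p)⁻¹) c R := by
    intro p hp
    refine ContinuousOn.circleIntegrable hR.le ((ContinuousOn.inv₀ (by fun_prop)) ?_)
    intro z hz h0
    exact hp (by rwa [sub_eq_zero.mp h0] at hz)
  have hz₀s : z₀ ∉ Metric.sphere c R := by
    intro h; rw [Metric.mem_ball] at hz₀c; rw [Metric.mem_sphere] at h; linarith
  have h1 := hci a (fun h => hac (Metric.sphere_subset_closedBall h))
  have h2 := hci (conj a) (fun h => hac' (Metric.sphere_subset_closedBall h))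
  have h3 := hci z₀ hz₀s
  have h4 := hci (conj z₀) (fun h => hz₀c' (Metric.sphere_subset_closedBall h))
  have e1 : (∮ z in C(c, R), ((z - a)⁻¹ + (z - conj a)⁻¹ - (z - z₀)⁻¹ - (z - conj z₀)⁻¹)) =
      (∮ z in C(c, R), ((z - a)⁻¹ + (z - conj a)⁻¹ - (z - z₀)⁻¹)) - ∮ z in C(c, R), (z - conj z₀)⁻¹ :=
    circleIntegral.integral_sub ((h1.add h2).sub h3) h4
  have e2 : (∮ z in C(c, R), ((z - a)⁻¹ + (z - conj a)⁻¹ - (z - z₀)⁻¹)) =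
      (∮ z in C(c, R), ((z - a)⁻¹ + (z - conj a)⁻¹)) - ∮ z in C(c, R), (z - z₀)⁻¹ :=
    circleIntegral.integral_sub (h1.add h2) h3
  have e3 : (∮ z in C(c, R), ((z - a)⁻¹ + (z - conj a)⁻¹)) =
      (∮ z in C(c, R), (z - a)⁻¹) + ∮ z in C(c, R), (z - conj a)⁻¹ :=
    circleIntegral.integral_add h1 h2
  rw [e1, e2, e3, circleIntegral_sub_inv_of_not_mem_closedBall hR.le hac,
    circleIntegral_sub_inv_of_not_mem_closedBall hR.le hac',
    circleIntegral_sub_inv_of_not_mem_closedBall hR.le hz₀c',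
    circleIntegral.integral_sub_inv_of_mem_ball hz₀c]
  ring

open Real in
/-- **The argument-principle contradiction.** If on a circle the zero-free functions `F`, `D`
(holomorphic near the circle) satisfy `F'D - FD' = s (μ'/μ) F D` with `∮ μ'/μ = -2πi`, then
`s` is an integer; in particular this is impossible for `0 < Re s < 1`.
[cite: BruggemanLewisZagier2015, Proposition 5.1 pp. 30–31] -/
theorem false_of_logDeriv_identity {F D m : ℂ → ℂ} {s : ℂ} (hs0 : 0 < s.re) (hs1 : s.re < 1)
    {c : ℂ} {R : ℝ} (hR : 0 < R) {V : Set ℂ} (hV : IsOpen V) (hsub : Metric.sphere c R ⊆ V)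
    (hF : DifferentiableOn ℂ F V) (hD : DifferentiableOn ℂ D V)
    (hFne : ∀ z ∈ Metric.sphere c R, F z ≠ 0) (hDne : ∀ z ∈ Metric.sphere c R, D z ≠ 0)
    (hid : ∀ z ∈ Metric.sphere c R,
      deriv F z * D z - F z * deriv D z = s * m z * (F z * D z))
    (hint : (∮ z in C(c, R), m z) = -(2 * π * Complex.I)) : False := by
  obtain ⟨n₁, hn₁⟩ := circleIntegral_logDeriv_mem_zmultiples hR hV hsub hF hFne
  obtain ⟨n₂, hn₂⟩ := circleIntegral_logDeriv_mem_zmultiples hR hV hsub hD hDne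
  -- pointwise on the circle: `F'/F - D'/D = s m`
  have hpt : EqOn (fun z => deriv F z / F z - deriv D z / D z) (fun z => s * m z) (Metric.sphere c R) := by
    intro z hz
    have hF0 := hFne z hz
    have hD0 := hDne z hz
    have h := hid z hz
    field_simp
    linear_combination h
  have hFa : AnalyticOnNhd ℂ F V := hF.analyticOnNhd hV
  have hDa : AnalyticOnNhd ℂ D V := hD.analyticOnNhd hV
  have hcF : CircleIntegrable (fun z => deriv F z / F z) c R := by
    refine ContinuousOn.circleIntegrable hR.le (ContinuousOn.div ?_ ?_ hFne)
    · exact hFa.deriv.continuousOn.mono hsub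
    · exact hF.continuousOn.mono hsub
  have hcD : CircleIntegrable (fun z => deriv D z / D z) c R := by
    refine ContinuousOn.circleIntegrable hR.le (ContinuousOn.div ?_ ?_ hDne)
    · exact hDa.deriv.continuousOn.mono hsub
    · exact hD.continuousOn.mono hsub
  have hI : (∮ z in C(c, R), (deriv F z / F z - deriv D z / D z)) = ∮ z in C(c, R), s * m z :=
    circleIntegral.integral_congr hR.le hpt
  rw [circleIntegral.integral_sub hcF hcD, hn₁, hn₂] at hI
  have hsm : (∮ z in C(c, R), s * m z) = s * ∮ z in C(c, R), m z := by
    simp only [← smul_eq_mul]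
    exact circleIntegral.integral_smul s m c R
  rw [hsm, hint] at hI
  -- `(n₁ - n₂) 2πi = -s 2πi`
  have h2πI : (2 * π * Complex.I : ℂ) ≠ 0 := by
    simp [Real.pi_ne_zero, Complex.I_ne_zero]
  have hs : s = (n₂ : ℂ) - n₁ := by
    have : ((n₁ : ℂ) - n₂ + s) * (2 * π * Complex.I) = 0 := by linear_combination hI
    have h' := (mul_eq_zero.mp this).resolve_right h2πI
    linear_combination h'
  have hre : s.re = ((n₂ - n₁ : ℤ) : ℝ) := by
    rw [hs]; simp
  rw [hre] at hs0 hs1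
  have h0 : (0 : ℤ) < n₂ - n₁ := by exact_mod_cast hs0
  have h1 : n₂ - n₁ < (1 : ℤ) := by exact_mod_cast hs1
  omega

end LoopIntegrals

/-! ## 26. Geometry of the collar: far elements, distances, regions, zeros

Auxiliary facts for the argument principle on a collar: (i) an infinite discrete
`Γ ≤ SL₂(ℝ)` has elements displacing `z₀` arbitrarily far (properness of the action, Mathlib's
`UpperHalfPlane.isProperMap_smul_I`); (ii) the action of determinant-one elements is
isometric for the hyperbolic metric; (iii) elementary hyperbolic-distance bounds for horizontal
strips and for the exterior of large discs; (iv) connectedness of the collar region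
`{|Re| > T} ∪ {Im > T} ∪ {0 < Im < δ}` and of thin Euclidean annuli; (v) finiteness of the
zeros of a holomorphic function, with isolated zeros, on compact sets. -/

section CollarGeometry

open Matrix.SpecialLinearGroup in
/-- The action of `SL(2, ℝ)` on `ℍ` (Mathlib) agrees with that of its image in `GL(2, ℝ)`.
[folklore] -/
theorem sl_smul_eq_toGL_smul (g : SL(2, ℝ)) (z : ℍ) : g • z = (toGL g : GL (Fin 2) ℝ) • z := by
  show (mapGL ℝ g) • z = (toGL g : GL (Fin 2) ℝ) • z
  congr 1

open Matrix.SpecialLinearGroup in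
/-- A determinant-one element of `GL(2, ℝ)` as an element of `SL(2, ℝ)`. [folklore] -/
theorem toGL_mk_eq {γ : GL (Fin 2) ℝ} (hdet : γ.det.val = 1) :
    (toGL (⟨γ.val, hdet⟩ : SL(2, ℝ)) : GL (Fin 2) ℝ) = γ :=
  Units.ext rfl

/-- **Determinant-one elements act isometrically** (hyperbolic metric).
[cite: BruggemanLewisZagier2015, §1.1 p. 8] -/
theorem dist_smul_smul_of_det_one {γ : GL (Fin 2) ℝ} (hdet : γ.det.val = 1) (x y : ℍ) :
    dist (γ • x) (γ • y) = dist x y := by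
  set g : SL(2, ℝ) := ⟨γ.val, hdet⟩ with hg
  have h := dist_smul g x y
  rwa [sl_smul_eq_toGL_smul, sl_smul_eq_toGL_smul, hg, toGL_mk_eq hdet] at h

open Matrix.SpecialLinearGroup in
/-- **Far elements.** An infinite discrete subgroup of `GL₂(ℝ)` of determinant one moves any
`z₀ ∈ ℍ` arbitrarily far: the set of `γ` with `d(γ z₀, z₀) ≤ M` is finite by properness of the
action (Mathlib `UpperHalfPlane.isProperMap_smul_I`) and discreteness.
[cite: BruggemanLewisZagier2015, Proposition 5.1 pp. 30–31] -/
theorem exists_far_element {Γ : Subgroup (GL (Fin 2) ℝ)} [hΓ : Γ.HasDetOne]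
    (hdisc : DiscreteTopology Γ) (hinf : (Γ : Set (GL (Fin 2) ℝ)).Infinite) (z₀ : ℍ) (M : ℝ) :
    ∃ γ ∈ Γ, M < dist (γ • z₀) z₀ := by
  set G : Subgroup SL(2, ℝ) := Γ.comap toGL with hG
  -- the restriction of `toGL` to `G → Γ`
  have hmapsΓ : ∀ g : G, (toGL g.1 : GL (Fin 2) ℝ) ∈ Γ := fun g => g.2
  set f : G → Γ := fun g => ⟨toGL g.1, hmapsΓ g⟩ with hf
  have hfc : Continuous f := by
    apply Continuous.subtype_mk
    exact continuous_toGL.comp continuous_subtype_val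
  have hfinj : Function.Injective f := by
    intro a b h
    have h' : (toGL a.1 : GL (Fin 2) ℝ) = toGL b.1 := congrArg Subtype.val h
    exact Subtype.ext (toGL_injective h')
  have hfsurj : Function.Surjective f := by
    rintro ⟨γ, hγ⟩
    have hdet : γ.det.val = 1 := by
      have := hΓ.det_eq hγ
      rw [this]; rfl
    refine ⟨⟨⟨γ.val, hdet⟩, ?_⟩, ?_⟩
    · show (toGL (⟨γ.val, hdet⟩ : SL(2, ℝ)) : GL (Fin 2) ℝ) ∈ Γ
      rw [toGL_mk_eq hdet]; exact hγ
    · exact Subtype.ext (toGL_mk_eq hdet)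
  haveI : DiscreteTopology G := DiscreteTopology.of_continuous_injective hfc hfinj
  haveI : Infinite Γ := hinf.to_subtype
  haveI : Infinite G := Infinite.of_surjective f hfsurj
  -- suppose all displacements are bounded
  by_contra hcon
  push Not at hcon
  set d₀ : ℝ := dist z₀ UpperHalfPlane.I with hd₀
  have hK : IsCompact (Metric.closedBall UpperHalfPlane.I (M + 2 * d₀)) := isCompact_closedBall _ _
  have hpre := UpperHalfPlane.isProperMap_smul_I.isCompact_preimage hK
  have hGcl : IsClosed (G : Set SL(2, ℝ)) := Subgroup.isClosed_of_discrete
  have hsub : (G : Set SL(2, ℝ)) ⊆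
      (fun g : SL(2, ℝ) => g • UpperHalfPlane.I) ⁻¹' Metric.closedBall UpperHalfPlane.I (M + 2 * d₀) := by
    intro g hg
    have hgΓ : (toGL g : GL (Fin 2) ℝ) ∈ Γ := hg
    have hM := hcon _ hgΓ
    rw [← sl_smul_eq_toGL_smul] at hM
    show dist (g • UpperHalfPlane.I) UpperHalfPlane.I ≤ M + 2 * d₀
    calc dist (g • UpperHalfPlane.I) UpperHalfPlane.I
        ≤ dist (g • UpperHalfPlane.I) (g • z₀) + dist (g • z₀) z₀ + dist z₀ UpperHalfPlane.I :=
          dist_triangle4 _ _ _ _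
      _ = dist UpperHalfPlane.I z₀ + dist (g • z₀) z₀ + dist z₀ UpperHalfPlane.I := by rw [dist_smul]
      _ ≤ M + 2 * d₀ := by rw [dist_comm UpperHalfPlane.I z₀]; linarith
  have hGcpt : IsCompact (G : Set SL(2, ℝ)) := by
    have := hpre.inter_left hGcl
    rwa [inter_eq_left.mpr hsub] at this
  -- compact and discrete: finite
  have huniv : IsCompact (univ : Set G) := isCompact_iff_isCompact_univ.mp hGcpt
  have hfin : (univ : Set G).Finite := huniv.finite_of_discrete
  haveI : Finite G := Set.finite_univ_iff.mp hfin
  exact not_finite G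

/-- **Strip below**: a point of `ℍ` lower than `Im w · e^{-ρ}` is at hyperbolic distance `> ρ`
from `w`. [folklore] -/
theorem lt_dist_of_im_lt (η w : ℍ) {ρ : ℝ} (h : η.im < w.im * Real.exp (-ρ)) : ρ < dist η w := by
  have h1 := UpperHalfPlane.dist_log_im_le η w
  rw [Real.dist_eq] at h1
  have h2 : Real.log η.im < Real.log w.im - ρ := by
    have := Real.log_lt_log η.im_pos h
    rwa [Real.log_mul w.im_pos.ne' (Real.exp_pos _).ne', Real.log_exp] at this
  have h3 : ρ < |Real.log η.im - Real.log w.im| := by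
    rw [abs_sub_comm]
    exact lt_of_lt_of_le (by linarith) (le_abs_self _)
  linarith

/-- **Strip above**: a point of `ℍ` higher than `Im w · e^{ρ}` is at hyperbolic distance `> ρ`
from `w`. [folklore] -/
theorem lt_dist_of_lt_im (η w : ℍ) {ρ : ℝ} (h : w.im * Real.exp ρ < η.im) : ρ < dist η w := by
  have h1 := UpperHalfPlane.dist_log_im_le η w
  rw [Real.dist_eq] at h1
  have h2 : Real.log w.im + ρ < Real.log η.im := by
    have := Real.log_lt_log (by positivity) h
    rwa [Real.log_mul w.im_pos.ne' (Real.exp_pos _).ne', Real.log_exp] at this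
  have h3 : ρ < |Real.log η.im - Real.log w.im| :=
    lt_of_lt_of_le (by linarith) (le_abs_self _)
  linarith

/-- **Exterior of a large disc**: points of `ℍ` of large absolute value are hyperbolically far
from a fixed `w`. [folklore] -/
theorem lt_dist_of_norm_gt (η w : ℍ) {ρ : ℝ} (hρ : 0 ≤ ρ)
    (h : max (2 * ‖(w : ℂ)‖ + 1) (8 * w.im * (Real.cosh ρ + 1)) < ‖(η : ℂ)‖) : ρ < dist η w := by
  have hn1 : 2 * ‖(w : ℂ)‖ + 1 < ‖(η : ℂ)‖ := lt_of_le_of_lt (le_max_left _ _) h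
  have hn2 : 8 * w.im * (Real.cosh ρ + 1) < ‖(η : ℂ)‖ := lt_of_le_of_lt (le_max_right _ _) h
  have hwim := w.im_pos
  have hηim0 := η.im_pos
  have hD : ‖(η : ℂ)‖ / 2 ≤ dist (η : ℂ) w := by
    rw [dist_eq_norm]
    have h1 := norm_sub_norm_le (η : ℂ) (w : ℂ)
    linarith [norm_nonneg (w : ℂ)]
  have hηim : η.im ≤ ‖(η : ℂ)‖ := by
    rw [← UpperHalfPlane.coe_im]
    exact le_trans (le_abs_self _) (Complex.abs_im_le_norm _)
  have hcosh : Real.cosh ρ < Real.cosh (dist η w) := by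
    rw [UpperHalfPlane.cosh_dist]
    have hD2 : ‖(η : ℂ)‖ ^ 2 / 4 ≤ dist (η : ℂ) w ^ 2 := by nlinarith [hD, norm_nonneg (η : ℂ)]
    have hfrac : ‖(η : ℂ)‖ / (8 * w.im) ≤ dist (η : ℂ) w ^ 2 / (2 * η.im * w.im) := by
      rw [div_le_div_iff₀ (by positivity) (by positivity)]
      have h1 : ‖(η : ℂ)‖ * (2 * η.im * w.im) ≤ ‖(η : ℂ)‖ * (2 * ‖(η : ℂ)‖ * w.im) := by
        apply mul_le_mul_of_nonneg_left _ (norm_nonneg _)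
        nlinarith [hηim, hwim.le]
      have h2 : ‖(η : ℂ)‖ * (2 * ‖(η : ℂ)‖ * w.im) = (‖(η : ℂ)‖ ^ 2 / 4) * (8 * w.im) := by ring
      have h3 : (‖(η : ℂ)‖ ^ 2 / 4) * (8 * w.im) ≤ dist (η : ℂ) w ^ 2 * (8 * w.im) :=
        mul_le_mul_of_nonneg_right hD2 (by positivity)
      linarith
    have hkey : Real.cosh ρ + 1 < ‖(η : ℂ)‖ / (8 * w.im) := by
      rw [lt_div_iff₀ (by positivity)]; linarith
    linarith
  have := Real.cosh_lt_cosh.mp hcosh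
  rwa [abs_of_nonneg hρ, abs_of_nonneg dist_nonneg] at this

/-- **Finitely many zeros on a compact set** for a function whose zeros are isolated there.
[folklore] -/
theorem finite_zeros_of_eventually_ne {f : ℂ → ℂ} {K : Set ℂ} (hK : IsCompact K)
    (h : ∀ z ∈ K, ∀ᶠ w in 𝓝[≠] z, f w ≠ 0) : {z ∈ K | f z = 0}.Finite := by
  by_contra hinf
  rw [Set.not_finite] at hinf
  obtain ⟨x, hxK, hacc⟩ := hinf.exists_accPt_of_subset_isCompact hK (fun z hz => hz.1)
  rw [accPt_iff_frequently_nhdsNE] at hacc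
  obtain ⟨y, hy1, hy2⟩ := ((h x hxK).and_frequently hacc).exists
  exact hy1 hy2.2

/-- A thin annulus around a circle is preconnected (image of a rectangle under the polar map).
[folklore] -/
theorem isPreconnected_annulus (c : ℂ) {r₁ r₂ : ℝ} (hr₁ : 0 ≤ r₁) :
    IsPreconnected {w : ℂ | r₁ < ‖w - c‖ ∧ ‖w - c‖ < r₂} := by
  have heq : {w : ℂ | r₁ < ‖w - c‖ ∧ ‖w - c‖ < r₂} =
      (fun p : ℝ × ℝ => c + (p.1 : ℂ) * Complex.exp ((p.2 : ℂ) * Complex.I)) '' (Ioo r₁ r₂ ×ˢ univ) := by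
    ext w
    constructor
    · intro hw
      have hw0 : w - c ≠ 0 := by
        intro h0
        have h1 : r₁ < ‖w - c‖ := hw.1
        rw [h0, norm_zero] at h1; linarith
      refine ⟨(‖w - c‖, Complex.arg (w - c)), ⟨⟨hw.1, hw.2⟩, mem_univ _⟩, ?_⟩
      show c + ((‖w - c‖ : ℝ) : ℂ) * Complex.exp (((Complex.arg (w - c) : ℝ) : ℂ) * Complex.I) = w
      rw [Complex.norm_mul_exp_arg_mul_I]
      ring
    · rintro ⟨p, ⟨hp, -⟩, rfl⟩
      have hn : ‖c + (p.1 : ℂ) * Complex.exp ((p.2 : ℂ) * Complex.I) - c‖ = p.1 := by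
        rw [add_sub_cancel_left, norm_mul, Complex.norm_real, Complex.norm_exp_ofReal_mul_I,
          mul_one, Real.norm_eq_abs, abs_of_pos (lt_of_le_of_lt hr₁ hp.1)]
      refine ⟨?_, ?_⟩
      · show r₁ < ‖c + (p.1 : ℂ) * Complex.exp ((p.2 : ℂ) * Complex.I) - c‖
        rw [hn]; exact hp.1
      · show ‖c + (p.1 : ℂ) * Complex.exp ((p.2 : ℂ) * Complex.I) - c‖ < r₂
        rw [hn]; exact hp.2
  rw [heq]
  exact (isPreconnected_Ioo.prod isPreconnected_univ).image _ (by fun_prop)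

/-- A thin annulus around a circle contained in an open set lies in that open set.
[folklore] -/
theorem exists_annulus_subset {U : Set ℂ} (hU : IsOpen U) {c : ℂ} {R : ℝ} (hR : 0 < R)
    (hsub : Metric.sphere c R ⊆ U) :
    ∃ ε > 0, ε < R ∧ {w : ℂ | R - ε < ‖w - c‖ ∧ ‖w - c‖ < R + ε} ⊆ U := by
  obtain ⟨δ, hδ, hδU⟩ := (isCompact_sphere c R).exists_thickening_subset_open hU hsub
  refine ⟨min δ (R / 2), lt_min hδ (by positivity), lt_of_le_of_lt (min_le_right _ _) (by linarith), ?_⟩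
  intro w hw
  apply hδU
  rw [Metric.mem_thickening_iff]
  have hw0 : w - c ≠ 0 := by
    intro h0
    have h1 : R - min δ (R / 2) < ‖w - c‖ := hw.1
    rw [h0, norm_zero] at h1
    have : min δ (R / 2) ≤ R / 2 := min_le_right _ _
    linarith
  have hn0 : 0 < ‖w - c‖ := norm_pos_iff.mpr hw0
  refine ⟨c + ((R / ‖w - c‖ : ℝ) : ℂ) * (w - c), ?_, ?_⟩
  · rw [Metric.mem_sphere, dist_eq_norm, add_sub_cancel_left, norm_mul, Complex.norm_real,
      Real.norm_eq_abs, abs_of_pos (by positivity), div_mul_cancel₀ _ hn0.ne']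
  · rw [dist_eq_norm]
    have e : w - (c + ((R / ‖w - c‖ : ℝ) : ℂ) * (w - c)) = ((1 - R / ‖w - c‖ : ℝ) : ℂ) * (w - c) := by
      push_cast; ring
    rw [e, norm_mul, Complex.norm_real, Real.norm_eq_abs]
    have e2 : |1 - R / ‖w - c‖| * ‖w - c‖ = |‖w - c‖ - R| := by
      rw [← abs_of_pos hn0, ← abs_mul, abs_of_pos hn0]
      congr 1
      field_simp
    rw [e2]
    have h1 := hw.1
    have h2 := hw.2
    have hmin : min δ (R / 2) ≤ δ := min_le_left _ _
    rw [abs_lt]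
    constructor <;> linarith

/-- **The collar region is preconnected**: `{0 < Im} ∩ ({|Re| > T} ∪ {|Im| > T} ∪ {|Im| < δ})`
is a chain of four convex pieces. [folklore] -/
theorem isPreconnected_collar {T δ : ℝ} (hT : 0 < T) (hδ : 0 < δ) :
    IsPreconnected {η : ℂ | 0 < η.im ∧ (T < |η.re| ∨ T < |η.im| ∨ |η.im| < δ)} := by
  set P₁ : Set ℂ := {η : ℂ | T < η.re} ∩ {η : ℂ | 0 < η.im} with hP₁
  set P₂ : Set ℂ := {η : ℂ | T < η.im} with hP₂
  set P₃ : Set ℂ := {η : ℂ | η.re < -T} ∩ {η : ℂ | 0 < η.im} with hP₃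
  set P₄ : Set ℂ := {η : ℂ | 0 < η.im} ∩ {η : ℂ | η.im < δ} with hP₄
  have c₁ : Convex ℝ P₁ := (convex_halfSpace_re_gt T).inter (convex_halfSpace_im_gt 0)
  have c₂ : Convex ℝ P₂ := convex_halfSpace_im_gt T
  have c₃ : Convex ℝ P₃ := (convex_halfSpace_re_lt (-T)).inter (convex_halfSpace_im_gt 0)
  have c₄ : Convex ℝ P₄ := (convex_halfSpace_im_gt 0).inter (convex_halfSpace_im_lt δ)
  have heq : {η : ℂ | 0 < η.im ∧ (T < |η.re| ∨ T < |η.im| ∨ |η.im| < δ)} = ((P₄ ∪ P₁) ∪ P₂) ∪ P₃ := by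
    ext η
    simp only [hP₁, hP₂, hP₃, hP₄, mem_setOf_eq, mem_union, mem_inter_iff]
    constructor
    · rintro ⟨him, h | h | h⟩
      · rcases lt_abs.mp h with h' | h'
        · exact Or.inl (Or.inl (Or.inr ⟨h', him⟩))
        · exact Or.inr ⟨by linarith, him⟩
      · rw [abs_of_pos him] at h
        exact Or.inl (Or.inr h)
      · rw [abs_of_pos him] at h
        exact Or.inl (Or.inl (Or.inl ⟨him, h⟩))
    · rintro (((⟨him, h⟩ | ⟨h, him⟩) | h) | ⟨h, him⟩)
      · exact ⟨him, Or.inr (Or.inr (by rw [abs_of_pos him]; exact h))⟩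
      · exact ⟨him, Or.inl (lt_of_lt_of_le h (le_abs_self _))⟩
      · have him : 0 < η.im := lt_trans hT h
        exact ⟨him, Or.inr (Or.inl (by rw [abs_of_pos him]; exact h))⟩
      · exact ⟨him, Or.inl (by rw [lt_abs]; right; linarith)⟩
  rw [heq]
  have hreim : ∀ a b : ℝ, (((a : ℝ) : ℂ) + ((b : ℝ) : ℂ) * Complex.I).re = a ∧
      (((a : ℝ) : ℂ) + ((b : ℝ) : ℂ) * Complex.I).im = b := fun a b => by
    constructor <;> simp
  have p41 : ((T + 1 : ℝ) : ℂ) + ((δ / 2 : ℝ) : ℂ) * Complex.I ∈ P₄ ∩ P₁ := by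
    obtain ⟨hre, him⟩ := hreim (T + 1) (δ / 2)
    simp only [hP₄, hP₁, mem_inter_iff, mem_setOf_eq, hre, him]
    exact ⟨⟨by linarith, by linarith⟩, by linarith, by linarith⟩
  have p12 : ((T + 1 : ℝ) : ℂ) + ((T + 1 : ℝ) : ℂ) * Complex.I ∈ (P₄ ∪ P₁) ∩ P₂ := by
    obtain ⟨hre, him⟩ := hreim (T + 1) (T + 1)
    simp only [hP₄, hP₁, hP₂, mem_inter_iff, mem_union, mem_setOf_eq, hre, him]
    exact ⟨Or.inr ⟨by linarith, by linarith⟩, by linarith⟩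
  have p23 : ((-(T + 1) : ℝ) : ℂ) + ((T + 1 : ℝ) : ℂ) * Complex.I ∈ ((P₄ ∪ P₁) ∪ P₂) ∩ P₃ := by
    obtain ⟨hre, him⟩ := hreim (-(T + 1)) (T + 1)
    simp only [hP₄, hP₁, hP₂, hP₃, mem_inter_iff, mem_union, mem_setOf_eq, hre, him]
    exact ⟨Or.inr (by linarith), by linarith, by linarith⟩
  refine IsPreconnected.union _ p23.1 p23.2 ?_ c₃.isPreconnected
  refine IsPreconnected.union _ p12.1 p12.2 ?_ c₂.isPreconnected
  exact IsPreconnected.union _ p41.1 p41.2 c₄.isPreconnected c₁.isPreconnected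

/-- **The box** `{|Re| ≤ T, δ ≤ Im ≤ T}` is hyperbolically bounded: there is `ρ₁ ≥ 0` such that
every point of `ℍ` at distance `> ρ₁` from `z₀` lies in the collar region. [folklore] -/
theorem exists_radius_collar (z₀ : ℍ) {T δ : ℝ} (hδ : 0 < δ) :
    ∃ ρ₁ : ℝ, 0 ≤ ρ₁ ∧ ∀ η : ℍ, ρ₁ < dist η z₀ →
      (T < |(η : ℂ).re| ∨ T < |(η : ℂ).im| ∨ |(η : ℂ).im| < δ) := by
  set Kc : Set ℂ := {η : ℂ | |η.re| ≤ T ∧ δ ≤ η.im ∧ η.im ≤ T} with hKc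
  have hKcpt : IsCompact Kc := by
    apply Metric.isCompact_of_isClosed_isBounded
    · simp only [hKc, Set.setOf_and]
      refine (isClosed_le (continuous_abs.comp Complex.continuous_re) continuous_const).inter
        ((isClosed_le continuous_const Complex.continuous_im).inter
        (isClosed_le Complex.continuous_im continuous_const))
    · rw [Metric.isBounded_iff_subset_closedBall 0]
      refine ⟨T + T, fun η hη => ?_⟩
      rw [Metric.mem_closedBall, dist_zero_right]
      have h1 : |η.re| ≤ T := hη.1
      have h2 : |η.im| ≤ T := by rw [abs_of_nonneg (le_trans hδ.le hη.2.1)]; exact hη.2.2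
      calc ‖η‖ ≤ |η.re| + |η.im| := Complex.norm_le_abs_re_add_abs_im η
        _ ≤ T + T := add_le_add h1 h2
  set KH : Set ℍ := ((↑) : ℍ → ℂ) ⁻¹' Kc with hKH
  have himg : ((↑) : ℍ → ℂ) '' KH = Kc := by
    apply Set.image_preimage_eq_of_subset
    intro η hη
    have : 0 < η.im := lt_of_lt_of_le hδ hη.2.1
    exact ⟨⟨η, this⟩, rfl⟩
  have hKHcpt : IsCompact KH := by
    rw [UpperHalfPlane.isEmbedding_coe.isCompact_iff, himg]; exact hKcpt
  obtain ⟨ρ, hρ⟩ := hKHcpt.isBounded.subset_closedBall z₀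
  refine ⟨max ρ 0, le_max_right _ _, fun η hη => ?_⟩
  by_contra hnot
  push Not at hnot
  obtain ⟨h1, h2, h3⟩ := hnot
  have hηim : 0 < (η : ℂ).im := η.coe_im_pos
  rw [abs_of_pos hηim] at h2 h3
  have hmem : η ∈ KH := ⟨h1, h3, h2⟩
  have := hρ hmem
  rw [Metric.mem_closedBall] at this
  linarith [le_max_left ρ 0]

end CollarGeometry

/-! ## 27. Vanishing of `D = Φ - h` on the collar (the argument principle)

The heart of the printed proof of Proposition 5.1 ("`H_s^Γ = {0}` for infinite discrete `Γ`",
p. 31): the holomorphic function `D = Φ - h` on the collar `W₀ = ℍ ∩ N` satisfies the twisted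
functional equation `D(g⁻¹ η) = μ(η)^s D(η)` near the real axis for every `g ∈ Γ` (§24); if
`D ≢ 0`, choose `g` displacing `z₀` far (§26), a hyperbolic circle `C` around `z₀` of radius
`ρ' = ρ₁ + 1` (a Euclidean circle, Mathlib `UpperHalfPlane.image_coe_sphere`), propagate the
branch-free identity `F'D - FD' = s(μ'/μ)FD` (`F = D ∘ g⁻¹`) from a seed patch to a connected
region containing `C` (identity theorem), adjust the radius to avoid the finitely many zeros of
`D`, `F` near `C`, and integrate: `∮ F'/F - ∮ D'/D = s ∮ μ'/μ = -2πi s` with the left side in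
`2πiℤ` (§25), contradicting `0 < Re s < 1`. Hence `D ≡ 0`: `Φ = h` on the collar. -/

section CollarVanishing

variable {Γ : Subgroup (GL (Fin 2) ℝ)} {s : ℂ} {u : ℍ → ℂ}

/-- The far region `{η ∈ ℍ : d(η, z₀) > ρ₁, d(η, a₁) > ρ₁}` is open in `ℂ`. [folklore] -/
theorem isOpen_farRegion (z₀ a₁ : ℍ) (ρ₁ : ℝ) :
    IsOpen {η : ℂ | ∃ h : 0 < η.im, ρ₁ < dist (⟨η, h⟩ : ℍ) z₀ ∧ ρ₁ < dist (⟨η, h⟩ : ℍ) a₁} := by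
  have heq : {η : ℂ | ∃ h : 0 < η.im, ρ₁ < dist (⟨η, h⟩ : ℍ) z₀ ∧ ρ₁ < dist (⟨η, h⟩ : ℍ) a₁} =
      ((↑) : ℍ → ℂ) '' {w : ℍ | ρ₁ < dist w z₀ ∧ ρ₁ < dist w a₁} := by
    ext η
    constructor
    · rintro ⟨h, h1, h2⟩
      exact ⟨⟨η, h⟩, ⟨h1, h2⟩, rfl⟩
    · rintro ⟨w, ⟨h1, h2⟩, rfl⟩
      exact ⟨w.coe_im_pos, h1, h2⟩
  rw [heq]
  apply UpperHalfPlane.isOpenEmbedding_coe.isOpenMap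
  exact (isOpen_lt continuous_const (continuous_id.dist continuous_const)).inter
    (isOpen_lt continuous_const (continuous_id.dist continuous_const))

/-- Points of the Euclidean circle `|w - c₀| = y₀ sinh ρ` (`c₀ = x₀ + i y₀ cosh ρ`) are the points
of `ℍ` at hyperbolic distance `ρ` from `z₀` (Mathlib `UpperHalfPlane.image_coe_sphere`).
[folklore] -/
theorem mem_sphere_center_iff (z₀ : ℍ) (ρ : ℝ) (w : ℂ) :
    w ∈ Metric.sphere ((z₀.center ρ : ℍ) : ℂ) (z₀.im * Real.sinh ρ) ↔
      ∃ h : 0 < w.im, dist (⟨w, h⟩ : ℍ) z₀ = ρ := by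
  rw [← UpperHalfPlane.image_coe_sphere]
  constructor
  · rintro ⟨w', hw', rfl⟩
    exact ⟨w'.coe_im_pos, hw'⟩
  · rintro ⟨h, hd⟩
    exact ⟨⟨w, h⟩, hd, rfl⟩

/-- Points of the closed Euclidean disc of that circle lie in `ℍ` at hyperbolic distance `≤ ρ`
from `z₀`. [folklore] -/
theorem mem_closedBall_center_iff (z₀ : ℍ) (ρ : ℝ) (w : ℂ) :
    w ∈ Metric.closedBall ((z₀.center ρ : ℍ) : ℂ) (z₀.im * Real.sinh ρ) ↔
      ∃ h : 0 < w.im, dist (⟨w, h⟩ : ℍ) z₀ ≤ ρ := by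
  rw [← UpperHalfPlane.image_coe_closedBall]
  constructor
  · rintro ⟨w', hw', rfl⟩
    exact ⟨w'.coe_im_pos, hw'⟩
  · rintro ⟨h, hd⟩
    exact ⟨⟨w, h⟩, hd, rfl⟩

/-- The hyperbolic centre lies in the open Euclidean disc. [folklore] -/
theorem coe_mem_ball_center (z₀ : ℍ) {ρ : ℝ} (hρ : 0 < ρ) :
    (z₀ : ℂ) ∈ Metric.ball ((z₀.center ρ : ℍ) : ℂ) (z₀.im * Real.sinh ρ) := by
  rw [← UpperHalfPlane.image_coe_ball]
  exact ⟨z₀, by simpa using hρ, rfl⟩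

/-- The top and bottom points `x₀ + i y₀ e^{±ρ}` of the circle (`ρ ≥ 0`). [folklore] -/
theorem top_bot_mem_sphere (z₀ : ℍ) {ρ : ℝ} (hρ : 0 ≤ ρ) :
    ((z₀.re : ℝ) : ℂ) + ((z₀.im * Real.exp ρ : ℝ) : ℂ) * Complex.I ∈
        Metric.sphere ((z₀.center ρ : ℍ) : ℂ) (z₀.im * Real.sinh ρ) ∧
      ((z₀.re : ℝ) : ℂ) + ((z₀.im * Real.exp (-ρ) : ℝ) : ℂ) * Complex.I ∈
        Metric.sphere ((z₀.center ρ : ℍ) : ℂ) (z₀.im * Real.sinh ρ) := by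
  have hc : ((z₀.center ρ : ℍ) : ℂ) = ((z₀.re : ℝ) : ℂ) + ((z₀.im * Real.cosh ρ : ℝ) : ℂ) * Complex.I := by
    apply Complex.ext
    · simp [UpperHalfPlane.center_re]
    · simp [UpperHalfPlane.center_im]
  have hs0 : 0 ≤ z₀.im * Real.sinh ρ := mul_nonneg z₀.im_pos.le (Real.sinh_nonneg_iff.mpr hρ)
  have hexp : Real.exp ρ - Real.cosh ρ = Real.sinh ρ := Real.exp_sub_cosh ρ
  have hexp' : Real.exp (-ρ) - Real.cosh ρ = -Real.sinh ρ := by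
    have := Real.cosh_add_sinh (-ρ)
    rw [Real.cosh_neg, Real.sinh_neg] at this
    linarith
  constructor
  · rw [Metric.mem_sphere, dist_eq_norm, hc]
    have e : ((z₀.re : ℝ) : ℂ) + ((z₀.im * Real.exp ρ : ℝ) : ℂ) * Complex.I -
        (((z₀.re : ℝ) : ℂ) + ((z₀.im * Real.cosh ρ : ℝ) : ℂ) * Complex.I) =
        ((z₀.im * (Real.exp ρ - Real.cosh ρ) : ℝ) : ℂ) * Complex.I := by
      push_cast; ring
    rw [e, hexp, norm_mul, Complex.norm_I, mul_one, Complex.norm_real, Real.norm_eq_abs,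
      abs_of_nonneg hs0]
  · rw [Metric.mem_sphere, dist_eq_norm, hc]
    have e : ((z₀.re : ℝ) : ℂ) + ((z₀.im * Real.exp (-ρ) : ℝ) : ℂ) * Complex.I -
        (((z₀.re : ℝ) : ℂ) + ((z₀.im * Real.cosh ρ : ℝ) : ℂ) * Complex.I) =
        ((z₀.im * (Real.exp (-ρ) - Real.cosh ρ) : ℝ) : ℂ) * Complex.I := by
      push_cast; ring
    rw [e, hexp', norm_mul, Complex.norm_I, mul_one, Complex.norm_real, Real.norm_eq_abs,
      mul_neg, abs_neg, abs_of_nonneg hs0]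

/-- The Möbius map of a determinant-one `γ` is injective on `ℍ`. [folklore] -/
theorem injOn_moebius {γ : GL (Fin 2) ℝ} (hγ : γ.det.val = 1) :
    InjOn (fun η : ℂ => ((γ 0 0 : ℂ) * η + (γ 0 1 : ℝ)) / ((γ 1 0 : ℂ) * η + (γ 1 1 : ℝ)))
      {η : ℂ | 0 < η.im} := by
  have hγ' : 0 < γ.det.val := by rw [hγ]; exact one_pos
  intro η hη η' hη' h
  simp only [] at h
  rw [moebius_apply_of_im_pos hγ' hη, moebius_apply_of_im_pos hγ' hη'] at h
  have h2 : γ • (⟨η, hη⟩ : ℍ) = γ • (⟨η', hη'⟩ : ℍ) := UpperHalfPlane.ext h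
  have h3 := smul_left_cancel γ h2
  exact congrArg UpperHalfPlane.coe h3

/-- The Möbius map of a determinant-one `γ` is continuous on `ℍ`; images of compact subsets of `ℍ`
are compact. [folklore] -/
theorem isCompact_image_moebius (γ : GL (Fin 2) ℝ) {K : Set ℂ}
    (hK : IsCompact K) (hKH : K ⊆ {η : ℂ | 0 < η.im}) :
    IsCompact ((fun η : ℂ => ((γ 0 0 : ℂ) * η + (γ 0 1 : ℝ)) / ((γ 1 0 : ℂ) * η + (γ 1 1 : ℝ))) '' K) := by
  apply hK.image_of_continuousOn
  intro η hη
  have hden : (γ 1 0 : ℂ) * η + (γ 1 1 : ℝ) ≠ 0 := smul_denom_ne_zero γ ⟨η, hKH hη⟩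
  exact (differentiableAt_moebius γ hden).continuousAt.continuousWithinAt

attribute [local irreducible] ratioKernel poissonKernelC in
/-- **`D = Φ - h` vanishes on the collar** (the argument principle on a collar of `P¹(ℝ)`; BLZ
p. 31, "`H_s^Γ = {0}`"). Here `Φ` is the collar extension (holomorphic on
`N = {|Re| > T} ∪ {|Im| > T} ∪ {|Im| < δ}` with `Φ(t) = φ(t) R_t(z₀)^{-s}` on `ℝ`), `h` the
canonical integral, `Γ` an infinite discrete subgroup of determinant one for which the cocycle
`r` is the coboundary of `φ`, and `0 < Re s < 1`.
[cite: BruggemanLewisZagier2015, Proposition 5.1 pp. 30–31] -/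
theorem collar_vanishing (hu : IsInvariantEigenfunction Γ s u) (hs : s.re < 1) (hs' : 0 < s.re)
    (hs1 : s ≠ 1) [hΓ : Γ.HasDetOne] (hdisc : DiscreteTopology Γ)
    (hinf : (Γ : Set (GL (Fin 2) ℝ)).Infinite) (z₀ : ℍ) {φ : ℝ → ℂ} {T δ : ℝ} (hT : 0 < T)
    (hδ : 0 < δ) {Φ : ℂ → ℂ}
    (hΦN : DifferentiableOn ℂ Φ ({η : ℂ | T < |η.re|} ∪ {η : ℂ | T < |η.im|} ∪ {η : ℂ | |η.im| < δ}))
    (hΦ : ∀ t : ℝ, Φ t = φ t * (poissonKernelC t z₀) ^ (-s))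
    (hcb : ∀ γ ∈ Γ, ∀ᶠ t : ℝ in cofinite, lewisZagierCocycle s z₀ u γ t = lineSlash s γ φ t - φ t) :
    ∀ η : ℂ, 0 < η.im → (T < |η.re| ∨ T < |η.im| ∨ |η.im| < δ) →
      Φ η = greenSegmentIntegral (u ∘ ofComplex) (ratioKernel s z₀ η) z₀ η := by
  have hs0 : s ≠ 0 := fun h => by rw [h] at hs'; simp at hs'
  have hz₀im : 0 < (z₀ : ℂ).im := z₀.coe_im_pos
  -- the domain `N`, the collar `W₀`
  set N : Set ℂ := {η : ℂ | T < |η.re|} ∪ {η : ℂ | T < |η.im|} ∪ {η : ℂ | |η.im| < δ} with hNdef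
  have hNo : IsOpen N := by
    refine ((isOpen_lt continuous_const (continuous_abs.comp Complex.continuous_re)).union
      (isOpen_lt continuous_const (continuous_abs.comp Complex.continuous_im))).union
      (isOpen_lt (continuous_abs.comp Complex.continuous_im) continuous_const)
  have hrealN : ∀ t : ℝ, (t : ℂ) ∈ N := fun t => Or.inr (by simp [hδ])
  have hNmem : ∀ η : ℂ, (T < |η.re| ∨ T < |η.im| ∨ |η.im| < δ) ↔ η ∈ N := by
    intro η
    simp only [hNdef, mem_union, mem_setOf_eq, or_assoc]
  set W₀ : Set ℂ := {η : ℂ | 0 < η.im ∧ (T < |η.re| ∨ T < |η.im| ∨ |η.im| < δ)} with hW₀def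
  have hW₀o : IsOpen W₀ := by
    have : W₀ = {η : ℂ | 0 < η.im} ∩ N := by
      ext η; simp only [hW₀def, mem_inter_iff, mem_setOf_eq, hNmem]
    rw [this]
    exact isOpen_upperHalfPlaneSet.inter hNo
  have hW₀c : IsPreconnected W₀ := isPreconnected_collar hT hδ
  have hW₀N : W₀ ⊆ N := fun η hη => (hNmem η).mp hη.2
  have hW₀H : W₀ ⊆ {η : ℂ | 0 < η.im} := fun η hη => hη.1
  -- the canonical integral and `D`
  set HC : ℂ → ℂ := fun ξ => greenSegmentIntegral (u ∘ ofComplex) (ratioKernel s z₀ ξ) z₀ ξ with hHCdef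
  have hHC : DifferentiableOn ℂ HC {η : ℂ | 0 < η.im} :=
    differentiableOn_canonicalIntegral hu hs hs0 hs1 hz₀im
  set D : ℂ → ℂ := fun ξ => Φ ξ - HC ξ with hDdef
  have hD : DifferentiableOn ℂ D W₀ := (hΦN.mono hW₀N).sub (hHC.mono hW₀H)
  have hDa : AnalyticOnNhd ℂ D W₀ := hD.analyticOnNhd hW₀o
  -- it suffices to show `D = 0` on `W₀`
  suffices hmain : ∀ η ∈ W₀, D η = 0 by
    intro η hη hcond
    have := hmain η ⟨hη, hcond⟩
    simp only [hDdef, hHCdef, sub_eq_zero] at this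
    exact this
  by_contra hcon
  push Not at hcon
  obtain ⟨η₁, hη₁W, hη₁⟩ := hcon
  -- zeros of `D` are isolated in `W₀`
  have hiso : ∀ z ∈ W₀, ∀ᶠ w in 𝓝[≠] z, D w ≠ 0 := by
    intro z hz
    by_contra hnot
    have hfr : ∃ᶠ w in 𝓝[≠] z, D w = 0 := by
      rw [Filter.not_eventually] at hnot
      exact hnot.mono fun w hw => not_not.mp hw
    have := hDa.eqOn_zero_of_preconnected_of_frequently_eq_zero hW₀c hz hfr
    exact hη₁ (this hη₁W)
  -- the hyperbolic radius of the box and a far element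
  obtain ⟨ρ₁, hρ₁0, hρ₁⟩ := exists_radius_collar z₀ (T := T) hδ
  have hfar : ∀ η : ℍ, ρ₁ < dist η z₀ → (η : ℂ) ∈ W₀ := fun η hη => ⟨η.coe_im_pos, hρ₁ η hη⟩
  obtain ⟨g, hg, hgfar⟩ := exists_far_element hdisc hinf z₀ (2 * ρ₁ + 2)
  have hdet : g.det.val = 1 := by
    have := hΓ.det_eq hg
    rw [this]; rfl
  have hdet' : (g⁻¹).det.val = 1 := det_inv_eq_one hdet
  have hγpos : 0 < (g⁻¹).det.val := by rw [hdet']; exact one_pos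
  set a₁ : ℍ := g • z₀ with ha₁def
  have ha₁im : 0 < (a₁ : ℂ).im := a₁.coe_im_pos
  -- the far region `Ω'`
  set Ω' : Set ℂ := {η : ℂ | ∃ h : 0 < η.im, ρ₁ < dist (⟨η, h⟩ : ℍ) z₀ ∧ ρ₁ < dist (⟨η, h⟩ : ℍ) a₁}
    with hΩ'def
  have hΩ'o : IsOpen Ω' := isOpen_farRegion z₀ a₁ ρ₁
  have hΩ'W : Ω' ⊆ W₀ := fun η ⟨h, h1, _⟩ => hfar ⟨η, h⟩ h1
  have hΩ'H : Ω' ⊆ {η : ℂ | 0 < η.im} := fun η hη => hη.1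
  -- the Möbius map of `g⁻¹` on `Ω'`
  have hMob : ∀ η : ℂ, ∀ hη : 0 < η.im,
      (((g⁻¹ 0 0 : ℂ) * η + (g⁻¹ 0 1 : ℝ)) / ((g⁻¹ 1 0 : ℂ) * η + (g⁻¹ 1 1 : ℝ))) = ((g⁻¹ • (⟨η, hη⟩ : ℍ) : ℍ) : ℂ) := fun η hη => moebius_apply_of_im_pos hγpos hη
  have hMobdist : ∀ η : ℂ, ∀ hη : 0 < η.im,
      dist (g⁻¹ • (⟨η, hη⟩ : ℍ)) z₀ = dist (⟨η, hη⟩ : ℍ) a₁ := by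
    intro η hη
    have := dist_smul_smul_of_det_one hdet' (⟨η, hη⟩ : ℍ) a₁
    rw [ha₁def, inv_smul_smul] at this
    rw [← this]
  have hMobW : ∀ η ∈ Ω', (((g⁻¹ 0 0 : ℂ) * η + (g⁻¹ 0 1 : ℝ)) / ((g⁻¹ 1 0 : ℂ) * η + (g⁻¹ 1 1 : ℝ))) ∈ W₀ := by
    rintro η ⟨hη, -, h2⟩
    rw [hMob η hη]
    apply hfar
    rw [hMobdist η hη]
    exact h2
  have hMobd : ∀ η : ℂ, 0 < η.im →
      DifferentiableAt ℂ (fun η : ℂ => (((g⁻¹ 0 0 : ℂ) * η + (g⁻¹ 0 1 : ℝ)) / ((g⁻¹ 1 0 : ℂ) * η + (g⁻¹ 1 1 : ℝ)))) η := fun η hη =>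
    differentiableAt_moebius g⁻¹ (smul_denom_ne_zero g⁻¹ ⟨η, hη⟩)
  -- `F = D ∘ g⁻¹`, `μ`, the logarithmic derivative, and the combination `G`
  set F : ℂ → ℂ := fun η => D ((((g⁻¹ 0 0 : ℂ) * η + (g⁻¹ 0 1 : ℝ)) / ((g⁻¹ 1 0 : ℂ) * η + (g⁻¹ 1 1 : ℝ)))) with hFdef
  have hF : DifferentiableOn ℂ F Ω' := by
    intro η hη
    have h1 : DifferentiableAt ℂ D ((((g⁻¹ 0 0 : ℂ) * η + (g⁻¹ 0 1 : ℝ)) / ((g⁻¹ 1 0 : ℂ) * η + (g⁻¹ 1 1 : ℝ)))) := hD.differentiableAt (hW₀o.mem_nhds (hMobW η hη))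
    exact (h1.comp η (hMobd η hη.1)).differentiableWithinAt
  set μ : ℂ → ℂ := fun η => poissonKernelC η z₀ / poissonKernelC η a₁ with hμdef
  have hpts : ∀ η ∈ Ω', η ≠ (z₀ : ℂ) ∧ η ≠ conj (z₀ : ℂ) ∧ η ≠ (a₁ : ℂ) ∧ η ≠ conj (a₁ : ℂ) := by
    rintro η ⟨hη, h1, h2⟩
    refine ⟨?_, ?_, ?_, ?_⟩
    · intro h
      have : (⟨η, hη⟩ : ℍ) = z₀ := UpperHalfPlane.ext h
      rw [this, dist_self] at h1; linarith
    · intro h; have := congrArg Complex.im h; simp at this; linarith [z₀.im_pos]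
    · intro h
      have : (⟨η, hη⟩ : ℍ) = a₁ := UpperHalfPlane.ext h
      rw [this, dist_self] at h2; linarith
    · intro h; have := congrArg Complex.im h; simp at this; linarith [a₁.im_pos]
  have hμpt : ∀ η ∈ Ω', DifferentiableAt ℂ μ η ∧ μ η ≠ 0 := by
    intro η hη
    obtain ⟨h1, h2, h3, h4⟩ := hpts η hη
    have hpa : poissonKernelC η a₁ ≠ 0 := poissonKernelC_ne_zero a₁.coe_im_pos h3 h4
    have hpz : poissonKernelC η z₀ ≠ 0 := poissonKernelC_ne_zero z₀.coe_im_pos h1 h2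
    exact ⟨(differentiableAt_poissonKernelC_param h1 h2).div
      (differentiableAt_poissonKernelC_param h3 h4) hpa, div_ne_zero hpz hpa⟩
  have hμ : DifferentiableOn ℂ μ Ω' := fun η hη => (hμpt η hη).1.differentiableWithinAt
  have hFa : AnalyticOnNhd ℂ F Ω' := hF.analyticOnNhd hΩ'o
  have hDΩ : DifferentiableOn ℂ D Ω' := hD.mono hΩ'W
  have hDaΩ : AnalyticOnNhd ℂ D Ω' := hDΩ.analyticOnNhd hΩ'o
  have hμa : AnalyticOnNhd ℂ μ Ω' := hμ.analyticOnNhd hΩ'o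
  set G : ℂ → ℂ := fun η => deriv F η * D η - F η * deriv D η - s * (deriv μ η / μ η) * (F η * D η)
    with hGdef
  have hG : DifferentiableOn ℂ G Ω' := by
    have h1 : DifferentiableOn ℂ (deriv F) Ω' := hFa.deriv.differentiableOn
    have h2 : DifferentiableOn ℂ (deriv D) Ω' := hDaΩ.deriv.differentiableOn
    have h3 : DifferentiableOn ℂ (fun η => deriv μ η / μ η) Ω' :=
      hμa.deriv.differentiableOn.div hμ fun η hη => (hμpt η hη).2
    exact ((h1.mul hDΩ).sub (hF.mul h2)).sub ((h3.const_mul s).mul (hF.mul hDΩ))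
  have hGa : AnalyticOnNhd ℂ G Ω' := hG.analyticOnNhd hΩ'o
  -- the circle `C` of hyperbolic radius `ρ' = ρ₁ + 1` around `z₀`
  set ρ' : ℝ := ρ₁ + 1 with hρ'def
  have hρ'0 : 0 < ρ' := by simp only [hρ'def]; linarith
  set c₀ : ℂ := ((z₀.center ρ' : ℍ) : ℂ) with hc₀def
  set Rc : ℝ := z₀.im * Real.sinh ρ' with hRcdef
  have hRc : 0 < Rc := mul_pos z₀.im_pos (Real.sinh_pos_iff.mpr hρ'0)
  have hsphΩ : Metric.sphere c₀ Rc ⊆ Ω' := by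
    intro w hw
    obtain ⟨hwim, hwd⟩ := (mem_sphere_center_iff z₀ ρ' w).mp hw
    refine ⟨hwim, by rw [hwd]; simp only [hρ'def]; linarith, ?_⟩
    have htri := dist_triangle a₁ (⟨w, hwim⟩ : ℍ) z₀
    rw [dist_comm a₁ (⟨w, hwim⟩ : ℍ), hwd] at htri
    have : dist a₁ z₀ = dist (g • z₀) z₀ := rfl
    simp only [hρ'def] at htri ⊢
    linarith
  -- a thin annulus `A` around `C` inside `Ω'`
  obtain ⟨ε, hε, hεR, hAΩ⟩ := exists_annulus_subset hΩ'o hRc hsphΩ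
  set A : Set ℂ := {w : ℂ | Rc - ε < ‖w - c₀‖ ∧ ‖w - c₀‖ < Rc + ε} with hAdef
  have hAo : IsOpen A := by
    simp only [hAdef, Set.setOf_and]
    exact (isOpen_lt continuous_const (continuous_norm.comp (continuous_id.sub continuous_const))).inter
      (isOpen_lt (continuous_norm.comp (continuous_id.sub continuous_const)) continuous_const)
  have hAc : IsPreconnected A := isPreconnected_annulus c₀ (by linarith)
  have hsphA : ∀ R'' : ℝ, Rc - ε < R'' → R'' < Rc + ε → Metric.sphere c₀ R'' ⊆ A := by
    intro R'' h1 h2 w hw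
    rw [Metric.mem_sphere, dist_eq_norm] at hw
    exact ⟨by rw [hw]; exact h1, by rw [hw]; exact h2⟩
  -- the strip `S` through the top or bottom point of `C`, and the convex region `E'` at infinity
  set Rbig : ℝ := max (max (2 * ‖(z₀ : ℂ)‖ + 1) (8 * z₀.im * (Real.cosh ρ₁ + 1)))
    (max (2 * ‖(a₁ : ℂ)‖ + 1) (8 * a₁.im * (Real.cosh ρ₁ + 1))) with hRbigdef
  set E' : Set ℂ := {η : ℂ | Rbig < η.re} ∩ {η : ℂ | 0 < η.im} with hE'def
  have hE'c : IsPreconnected E' := ((convex_halfSpace_re_gt Rbig).inter (convex_halfSpace_im_gt 0)).isPreconnected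
  have hE'Ω : E' ⊆ Ω' := by
    rintro η ⟨hre, him⟩
    have hnorm : Rbig < ‖η‖ := lt_of_lt_of_le hre (le_trans (le_abs_self _) (Complex.abs_re_le_norm η))
    refine ⟨him, ?_, ?_⟩
    · exact lt_dist_of_norm_gt ⟨η, him⟩ z₀ hρ₁0 (lt_of_le_of_lt (le_max_left _ _) hnorm)
    · exact lt_dist_of_norm_gt ⟨η, him⟩ a₁ hρ₁0 (lt_of_le_of_lt (le_max_right _ _) hnorm)
  -- the strip
  obtain ⟨S, hSc, hSΩ, hSA, hSE⟩ : ∃ S : Set ℂ, IsPreconnected S ∧ S ⊆ Ω' ∧ (A ∩ S).Nonempty ∧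
      (S ∩ E').Nonempty := by
    by_cases hcase : a₁.im < z₀.im * Real.exp 1
    · -- top strip
      set Ht : ℝ := max z₀.im a₁.im * Real.exp ρ₁ with hHtdef
      refine ⟨{η : ℂ | Ht < η.im}, (convex_halfSpace_im_gt Ht).isPreconnected, ?_, ?_, ?_⟩
      · intro η hη
        have hη' : Ht < η.im := hη
        have him : 0 < η.im := lt_trans (by positivity) hη'
        refine ⟨him, ?_, ?_⟩
        · apply lt_dist_of_lt_im ⟨η, him⟩ z₀
          calc z₀.im * Real.exp ρ₁ ≤ Ht := by
                simp only [hHtdef]; gcongr; exact le_max_left _ _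
            _ < η.im := hη'
        · apply lt_dist_of_lt_im ⟨η, him⟩ a₁
          calc a₁.im * Real.exp ρ₁ ≤ Ht := by
                simp only [hHtdef]; gcongr; exact le_max_right _ _
            _ < η.im := hη'
      · -- the top point of `C`
        refine ⟨((z₀.re : ℝ) : ℂ) + ((z₀.im * Real.exp ρ' : ℝ) : ℂ) * Complex.I, ?_, ?_⟩
        · exact hsphA Rc (by linarith) (by linarith) (top_bot_mem_sphere z₀ hρ'0.le).1
        · show Ht < (((z₀.re : ℝ) : ℂ) + ((z₀.im * Real.exp ρ' : ℝ) : ℂ) * Complex.I).im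
          simp only [Complex.add_im, Complex.ofReal_im, Complex.mul_im, Complex.ofReal_re,
            Complex.I_re, Complex.I_im, mul_zero, mul_one, zero_add, Complex.ofReal_im, hHtdef, hρ'def]
          rw [Real.exp_add]
          have hmax : max z₀.im a₁.im < z₀.im * Real.exp 1 := max_lt (by
            have : (1 : ℝ) < Real.exp 1 := by
              have := Real.add_one_lt_exp (one_ne_zero); linarith
            nlinarith [z₀.im_pos]) hcase
          have hexp : 0 < Real.exp ρ₁ := Real.exp_pos _
          nlinarith
      · refine ⟨((Rbig + 1 : ℝ) : ℂ) + ((Ht + 1 : ℝ) : ℂ) * Complex.I, ?_, ?_⟩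
        · show Ht < (((Rbig + 1 : ℝ) : ℂ) + ((Ht + 1 : ℝ) : ℂ) * Complex.I).im
          simp
        · constructor
          · show Rbig < (((Rbig + 1 : ℝ) : ℂ) + ((Ht + 1 : ℝ) : ℂ) * Complex.I).re
            simp
          · show 0 < (((Rbig + 1 : ℝ) : ℂ) + ((Ht + 1 : ℝ) : ℂ) * Complex.I).im
            simp; positivity
    · -- bottom strip
      push Not at hcase
      set hb : ℝ := z₀.im * Real.exp (-ρ₁) with hhbdef
      have hhb : 0 < hb := by positivity
      refine ⟨{η : ℂ | 0 < η.im} ∩ {η : ℂ | η.im < hb},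
        ((convex_halfSpace_im_gt 0).inter (convex_halfSpace_im_lt hb)).isPreconnected, ?_, ?_, ?_⟩
      · rintro η ⟨him, hη⟩
        have him' : 0 < η.im := him
        have hη' : η.im < hb := hη
        refine ⟨him', ?_, ?_⟩
        · exact lt_dist_of_im_lt ⟨η, him'⟩ z₀ hη'
        · apply lt_dist_of_im_lt ⟨η, him'⟩ a₁
          calc (⟨η, him'⟩ : ℍ).im = η.im := rfl
            _ < hb := hη'
            _ ≤ a₁.im * Real.exp (-ρ₁) := by
                simp only [hhbdef]
                gcongr
                have : (1 : ℝ) ≤ Real.exp 1 := by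
                  have := Real.add_one_le_exp (1 : ℝ); linarith
                nlinarith [z₀.im_pos]
      · -- the bottom point of `C`
        refine ⟨((z₀.re : ℝ) : ℂ) + ((z₀.im * Real.exp (-ρ') : ℝ) : ℂ) * Complex.I, ?_, ?_⟩
        · exact hsphA Rc (by linarith) (by linarith) (top_bot_mem_sphere z₀ hρ'0.le).2
        · have him : (((z₀.re : ℝ) : ℂ) + ((z₀.im * Real.exp (-ρ') : ℝ) : ℂ) * Complex.I).im =
              z₀.im * Real.exp (-ρ') := by
            simp only [Complex.add_im, Complex.ofReal_im, Complex.mul_im, Complex.ofReal_re,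
              Complex.I_re, Complex.I_im, mul_zero, mul_one, zero_add, add_zero]
          constructor
          · show 0 < (((z₀.re : ℝ) : ℂ) + ((z₀.im * Real.exp (-ρ') : ℝ) : ℂ) * Complex.I).im
            rw [him]; exact mul_pos z₀.im_pos (Real.exp_pos _)
          · show (((z₀.re : ℝ) : ℂ) + ((z₀.im * Real.exp (-ρ') : ℝ) : ℂ) * Complex.I).im < hb
            rw [him, hhbdef]
            apply mul_lt_mul_of_pos_left _ z₀.im_pos
            apply Real.exp_lt_exp.mpr
            simp only [hρ'def]; linarith
      · refine ⟨((Rbig + 1 : ℝ) : ℂ) + ((hb / 2 : ℝ) : ℂ) * Complex.I, ?_, ?_⟩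
        · constructor
          · show 0 < (((Rbig + 1 : ℝ) : ℂ) + ((hb / 2 : ℝ) : ℂ) * Complex.I).im
            simp; positivity
          · show (((Rbig + 1 : ℝ) : ℂ) + ((hb / 2 : ℝ) : ℂ) * Complex.I).im < hb
            simp; linarith
        · constructor
          · show Rbig < (((Rbig + 1 : ℝ) : ℂ) + ((hb / 2 : ℝ) : ℂ) * Complex.I).re
            simp
          · show 0 < (((Rbig + 1 : ℝ) : ℂ) + ((hb / 2 : ℝ) : ℂ) * Complex.I).im
            simp; positivity
  -- the region `Ω = (A ∪ S) ∪ E'`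
  set Ω : Set ℂ := (A ∪ S) ∪ E' with hΩdef
  have hΩΩ' : Ω ⊆ Ω' := union_subset (union_subset hAΩ hSΩ) hE'Ω
  have hΩc : IsPreconnected Ω := by
    obtain ⟨p, hpA, hpS⟩ := hSA
    obtain ⟨q, hqS, hqE⟩ := hSE
    have h1 : IsPreconnected (A ∪ S) := IsPreconnected.union p hpA hpS hAc hSc
    exact IsPreconnected.union q (Or.inr hqS) hqE h1 hE'c
  -- the seed: a real point `t₀ > Rbig + 1` off the pole of `g⁻¹`
  obtain ⟨t₀, ht₀pole, ht₀big⟩ : ∃ t₀ : ℝ, g⁻¹ 1 0 * t₀ + g⁻¹ 1 1 ≠ 0 ∧ Rbig + 1 < t₀ :=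
    (((eventually_cofinite_denom_ne_zero hdet').filter_mono Filter.atTop_le_cofinite).and
      (Filter.eventually_gt_atTop (Rbig + 1))).exists
  obtain ⟨δ', hδ', hseed⟩ := seed_functionalEquation hu hs hs' hs1 hg hdet z₀ hNo hΦN hrealN hΦ
    (hcb g⁻¹ (Γ.inv_mem hg)) ht₀pole
  -- `G = 0` on the half-disc, hence near the point `p = t₀ + i δ'/2 ∈ E' ⊆ Ω`
  set p : ℂ := ((t₀ : ℝ) : ℂ) + ((δ' / 2 : ℝ) : ℂ) * Complex.I with hpdef
  have hpre : p.re = t₀ := by simp [hpdef]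
  have hpim : p.im = δ' / 2 := by simp [hpdef]
  have hpball : p ∈ Metric.ball ((t₀ : ℝ) : ℂ) δ' := by
    rw [Metric.mem_ball, dist_eq_norm]
    have e : p - ((t₀ : ℝ) : ℂ) = ((δ' / 2 : ℝ) : ℂ) * Complex.I := by simp [hpdef]
    rw [e, norm_mul, Complex.norm_I, mul_one, Complex.norm_real, Real.norm_eq_abs,
      abs_of_pos (by positivity)]
    linarith
  have hpE : p ∈ E' := ⟨by show Rbig < p.re; rw [hpre]; linarith, by show 0 < p.im; rw [hpim]; positivity⟩
  have hpΩ : p ∈ Ω := Or.inr hpE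
  have hGzero : G =ᶠ[𝓝 p] 0 := by
    have hnhds : Metric.ball ((t₀ : ℝ) : ℂ) δ' ∩ {η : ℂ | 0 < η.im} ∈ 𝓝 p :=
      (Metric.isOpen_ball.inter isOpen_upperHalfPlaneSet).mem_nhds ⟨hpball, by show 0 < p.im; rw [hpim]; positivity⟩
    filter_upwards [hnhds] with η hη
    obtain ⟨-, -, -, -, -, -, -, -, hid⟩ := hseed η hη.1 hη.2
    show G η = 0
    simp only [hGdef, hFdef, hDdef, hHCdef, hμdef]
    rw [sub_eq_zero]
    exact hid
  have hGΩ : EqOn G 0 Ω := (hGa.mono hΩΩ').eqOn_zero_of_preconnected_of_eventuallyEq_zero hΩc hpΩ hGzero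
  -- zeros of `D` and `F` near `C` are finite
  set Abar : Set ℂ := {w : ℂ | Rc - ε / 2 ≤ ‖w - c₀‖ ∧ ‖w - c₀‖ ≤ Rc + ε / 2} with hAbardef
  have hAbarA : Abar ⊆ A := fun w hw => ⟨by linarith [hw.1], by linarith [hw.2]⟩
  have hAbarcpt : IsCompact Abar := by
    apply Metric.isCompact_of_isClosed_isBounded
    · simp only [hAbardef, Set.setOf_and]
      exact (isClosed_le continuous_const (continuous_norm.comp (continuous_id.sub continuous_const))).inter
        (isClosed_le (continuous_norm.comp (continuous_id.sub continuous_const)) continuous_const)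
    · rw [Metric.isBounded_iff_subset_closedBall c₀]
      exact ⟨Rc + ε / 2, fun w hw => by rw [Metric.mem_closedBall, dist_eq_norm]; exact hw.2⟩
  have hZD : {z ∈ Abar | D z = 0}.Finite :=
    finite_zeros_of_eventually_ne hAbarcpt fun z hz => hiso z (hΩ'W (hAΩ (hAbarA hz)))
  have hZF : {z ∈ Abar | F z = 0}.Finite := by
    -- zeros of `F` map injectively to zeros of `D` in the compact set `g⁻¹(Abar) ⊆ W₀`
    have hAbarH : Abar ⊆ {η : ℂ | 0 < η.im} := fun w hw => (hAΩ (hAbarA hw)).1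
    have hKcpt := isCompact_image_moebius g⁻¹ hAbarcpt hAbarH
    have hKW : (fun η : ℂ => (((g⁻¹ 0 0 : ℂ) * η + (g⁻¹ 0 1 : ℝ)) / ((g⁻¹ 1 0 : ℂ) * η + (g⁻¹ 1 1 : ℝ)))) '' Abar ⊆ W₀ := by
      rintro _ ⟨η, hη, rfl⟩
      exact hMobW η (hAΩ (hAbarA hη))
    have hZD' : {ζ ∈ (fun η : ℂ => (((g⁻¹ 0 0 : ℂ) * η + (g⁻¹ 0 1 : ℝ)) / ((g⁻¹ 1 0 : ℂ) * η + (g⁻¹ 1 1 : ℝ)))) '' Abar | D ζ = 0}.Finite :=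
      finite_zeros_of_eventually_ne hKcpt fun ζ hζ => hiso ζ (hKW hζ)
    have hinj : InjOn (fun η : ℂ => (((g⁻¹ 0 0 : ℂ) * η + (g⁻¹ 0 1 : ℝ)) / ((g⁻¹ 1 0 : ℂ) * η + (g⁻¹ 1 1 : ℝ)))) {z ∈ Abar | F z = 0} :=
      (injOn_moebius hdet').mono fun z hz => hAbarH hz.1
    refine Set.Finite.of_finite_image (hZD'.subset ?_) hinj
    rintro _ ⟨z, ⟨hz, hFz⟩, rfl⟩
    exact ⟨⟨z, hz, rfl⟩, hFz⟩
  -- choose the radius `R''` avoiding the zeros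
  have hz₀ball : (z₀ : ℂ) ∈ Metric.ball c₀ Rc := coe_mem_ball_center z₀ hρ'0
  have hz₀c : ‖(z₀ : ℂ) - c₀‖ < Rc := by rwa [Metric.mem_ball, dist_eq_norm] at hz₀ball
  set lo : ℝ := max (Rc - ε / 2) ‖(z₀ : ℂ) - c₀‖ with hlodef
  have hlo : lo < Rc := max_lt (by linarith) hz₀c
  have hlo0 : 0 ≤ lo := le_trans (norm_nonneg _) (le_max_right _ _)
  set B : Set ℝ := (fun z : ℂ => ‖z - c₀‖) '' ({z ∈ Abar | D z = 0} ∪ {z ∈ Abar | F z = 0}) with hBdef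
  have hBfin : B.Finite := (hZD.union hZF).image _
  obtain ⟨R'', ⟨hR''lo, hR''hi⟩, hR''B⟩ := ((Ioo_infinite hlo).sdiff hBfin).nonempty
  have hR''pos : 0 < R'' := lt_of_le_of_lt hlo0 hR''lo
  have hR''1 : Rc - ε / 2 < R'' := lt_of_le_of_lt (le_max_left _ _) hR''lo
  have hR''2 : ‖(z₀ : ℂ) - c₀‖ < R'' := lt_of_le_of_lt (le_max_right _ _) hR''lo
  have hsphAbar : Metric.sphere c₀ R'' ⊆ Abar := fun z hz => by
    rw [Metric.mem_sphere, dist_eq_norm] at hz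
    exact ⟨by rw [hz]; linarith, by rw [hz]; linarith⟩
  have hsphA' : Metric.sphere c₀ R'' ⊆ A := hsphA R'' (by linarith) (by linarith)
  have hDne : ∀ z ∈ Metric.sphere c₀ R'', D z ≠ 0 := by
    intro z hz hDz
    apply hR''B
    refine ⟨z, Or.inl ⟨hsphAbar hz, hDz⟩, ?_⟩
    rw [Metric.mem_sphere, dist_eq_norm] at hz; exact hz
  have hFne : ∀ z ∈ Metric.sphere c₀ R'', F z ≠ 0 := by
    intro z hz hFz
    apply hR''B
    refine ⟨z, Or.inr ⟨hsphAbar hz, hFz⟩, ?_⟩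
    rw [Metric.mem_sphere, dist_eq_norm] at hz; exact hz
  -- the identity on the circle
  have hid : ∀ z ∈ Metric.sphere c₀ R'',
      deriv F z * D z - F z * deriv D z = s * (deriv μ z / μ z) * (F z * D z) := by
    intro z hz
    have h0 := hGΩ (Or.inl (Or.inl (hsphA' hz)))
    simp only [hGdef, Pi.zero_apply] at h0
    linear_combination h0
  -- the configuration of the four poles/zeros of `μ'/μ` relative to the circle
  have hz₀ball'' : (z₀ : ℂ) ∈ Metric.ball c₀ R'' := by
    rw [Metric.mem_ball, dist_eq_norm]; exact hR''2
  have hclosed : ∀ w ∈ Metric.closedBall c₀ R'', ∃ h : 0 < w.im, dist (⟨w, h⟩ : ℍ) z₀ ≤ ρ' := by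
    intro w hw
    exact (mem_closedBall_center_iff z₀ ρ' w).mp (Metric.closedBall_subset_closedBall hR''hi.le hw)
  have hconj_z₀ : conj (z₀ : ℂ) ∉ Metric.closedBall c₀ R'' := by
    intro h; obtain ⟨him, -⟩ := hclosed _ h; simp at him; linarith [z₀.im_pos]
  have hconj_a₁ : conj (a₁ : ℂ) ∉ Metric.closedBall c₀ R'' := by
    intro h; obtain ⟨him, -⟩ := hclosed _ h; simp at him; linarith [a₁.im_pos]
  have ha₁out : (a₁ : ℂ) ∉ Metric.closedBall c₀ R'' := by
    intro h
    obtain ⟨him, hd⟩ := hclosed _ h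
    have e : (⟨(a₁ : ℂ), him⟩ : ℍ) = a₁ := rfl
    rw [e] at hd
    simp only [hρ'def] at hd
    linarith
  have hint := circleIntegral_logDeriv_ratioBase (c := c₀) (z₀ := (z₀ : ℂ)) (a := (a₁ : ℂ))
    hR''pos (by rw [UpperHalfPlane.coe_im]; exact z₀.im_pos.ne')
    (by rw [UpperHalfPlane.coe_im]; exact a₁.im_pos.ne') hz₀ball'' hconj_z₀ ha₁out hconj_a₁
  exact false_of_logDeriv_identity (m := fun z => deriv μ z / μ z) hs' hs hR''pos hAo hsphA'
    (hF.mono hAΩ) (hDΩ.mono hAΩ) hFne hDne hid hint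

end CollarVanishing

/-! ## 28. The conjugate system

Conjugating the coboundary hypothesis: since the Green's form satisfies
`conj [U, V] = [V̄, Ū]` and `[P, Q] + [Q, P] = d(PQ)`, the period cocycle of the conjugate
eigenfunction `ū ∈ E_{s̄}^Γ` is `r_γ[ū, s̄] = -conj ∘ r_γ[u, s] + ū(z₀)(κ - κ|γ)` with
`κ(t) = R_t(z₀)^{s̄} ∈ V_{s̄}^ω`; so if `r[u, s]` is the coboundary of `φ ∈ V_s^ω` then
`r[ū, s̄]` is the coboundary of `φ̃ = -conj ∘ φ - ū(z₀) κ ∈ V_{s̄}^ω`. -/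

section ConjugateCoboundary

variable {Γ : Subgroup (GL (Fin 2) ℝ)} {s : ℂ} {u : ℍ → ℂ}

/-- Wirtinger derivatives of a conjugate: `∂(conj ∘ U) = conj ∘ ∂̄U`. [folklore] -/
theorem wirtingerDz_conj_comp (U : ℂ → ℂ) (w : ℂ) :
    wirtingerDz (fun z => conj (U z)) w = conj (wirtingerDzbar U w) := by
  have h : fderiv ℝ (fun z => conj (U z)) w = (Complex.conjCLE : ℂ →L[ℝ] ℂ).comp (fderiv ℝ U w) :=
    (Complex.conjCLE).comp_fderiv (f := U) (x := w)
  rw [wirtingerDz, wirtingerDzbar, h]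
  simp only [ContinuousLinearMap.coe_comp, Function.comp_apply, ContinuousLinearEquiv.coe_coe,
    Complex.conjCLE_apply]
  rw [map_div₀, map_add, map_mul, Complex.conj_I, map_ofNat]
  ring

/-- Wirtinger derivatives of a conjugate: `∂̄(conj ∘ U) = conj ∘ ∂U`. [folklore] -/
theorem wirtingerDzbar_conj_comp (U : ℂ → ℂ) (w : ℂ) :
    wirtingerDzbar (fun z => conj (U z)) w = conj (wirtingerDz U w) := by
  have h : fderiv ℝ (fun z => conj (U z)) w = (Complex.conjCLE : ℂ →L[ℝ] ℂ).comp (fderiv ℝ U w) :=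
    (Complex.conjCLE).comp_fderiv (f := U) (x := w)
  rw [wirtingerDz, wirtingerDzbar, h]
  simp only [ContinuousLinearMap.coe_comp, Function.comp_apply, ContinuousLinearEquiv.coe_coe,
    Complex.conjCLE_apply]
  rw [map_div₀, map_sub, map_mul, Complex.conj_I, map_ofNat]
  ring

/-- `w ↦ ∂̄U(w)` is continuous where `U` is `C²`. [folklore] -/
theorem continuousOn_wirtingerDzbar {U : ℂ → ℂ} {O : Set ℂ} (hO : IsOpen O) (hU : ContDiffOn ℝ 2 U O) :
    ContinuousOn (fun w => wirtingerDzbar U w) O := by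
  have hDU : ContinuousOn (fderiv ℝ U) O := hU.continuousOn_fderiv_of_isOpen hO (by norm_num)
  unfold wirtingerDzbar
  exact ((hDU.clm_apply continuousOn_const).add
    (continuousOn_const.mul (hDU.clm_apply continuousOn_const))).div_const _

/-- **Conjugation of the Green's form**: `conj [U, V](w)(h) = [V̄, Ū](w)(h)`.
[cite: BruggemanLewisZagier2015, (1.9) p. 11] -/
theorem conj_greenForm (U V : ℂ → ℂ) (w h : ℂ) :
    conj (greenForm U V w h) = greenForm (fun z => conj (V z)) (fun z => conj (U z)) w h := by
  simp only [greenForm, wirtingerDz_conj_comp, wirtingerDzbar_conj_comp, map_add, map_mul,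
    Complex.conj_conj]
  ring

/-- **Conjugation of segment integrals**: `conj ∫_a^b [U, V] = ∫_a^b [V̄, Ū]`.
[cite: BruggemanLewisZagier2015, (1.9) p. 11] -/
theorem conj_greenSegmentIntegral (U V : ℂ → ℂ) (a b : ℂ) :
    conj (greenSegmentIntegral U V a b) =
      greenSegmentIntegral (fun z => conj (V z)) (fun z => conj (U z)) a b := by
  unfold greenSegmentIntegral
  rw [intervalIntegral.integral_of_le zero_le_one, intervalIntegral.integral_of_le zero_le_one,
    ← integral_conj]
  simp_rw [conj_greenForm]

/-- `conj (R(t; z)^s) = R(t; z)^{s̄}` (real base). [cite: BruggemanLewisZagier2015, (1.6) p. 10] -/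
theorem conj_hypPoissonKernelCpow (s : ℂ) (t : ℝ) {z : ℂ} (hz : 0 < z.im) :
    conj (hypPoissonKernelCpow s t z) = hypPoissonKernelCpow (conj s) t z := by
  unfold hypPoissonKernelCpow
  have h : 0 ≤ hypPoissonKernel t z := (hypPoissonKernel_pos t hz).le
  have harg : ((hypPoissonKernel t z : ℝ) : ℂ).arg ≠ Real.pi := by
    rw [Complex.arg_ofReal_of_nonneg h]; exact Real.pi_ne_zero.symm
  rw [Complex.cpow_conj _ _ harg, Complex.conj_ofReal]

/-- **Conjugation of the slash action**: `conj ((φ|_s g)(t)) = ((conj ∘ φ)|_{s̄} g)(t)`.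
[cite: BruggemanLewisZagier2015, (2.1) p. 11] -/
theorem conj_lineSlash (s : ℂ) (g : GL (Fin 2) ℝ) (φ : ℝ → ℂ) (t : ℝ) :
    conj (lineSlash s g φ t) = lineSlash (conj s) g (fun x => conj (φ x)) t := by
  rw [lineSlash_apply, lineSlash_apply, map_mul]
  congr 1
  have harg : ((|g 1 0 * t + g 1 1| : ℝ) : ℂ).arg ≠ Real.pi := by
    rw [Complex.arg_ofReal_of_nonneg (abs_nonneg _)]; exact Real.pi_ne_zero.symm
  have key : ∀ m : ℂ, conj (((|g 1 0 * t + g 1 1| : ℝ) : ℂ) ^ m) =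
      ((|g 1 0 * t + g 1 1| : ℝ) : ℂ) ^ conj m := fun m => by
    have h := Complex.conj_cpow ((|g 1 0 * t + g 1 1| : ℝ) : ℂ) (conj m) harg
    rw [Complex.conj_conj, Complex.conj_ofReal] at h
    exact h.symm
  rw [key, map_neg, map_mul, map_ofNat]

/-- The slash action is additive in `φ`. [cite: BruggemanLewisZagier2015, (2.1) p. 11] -/
theorem lineSlash_fun_add (s : ℂ) (g : GL (Fin 2) ℝ) (φ ψ : ℝ → ℂ) (t : ℝ) :
    lineSlash s g (fun x => φ x + ψ x) t = lineSlash s g φ t + lineSlash s g ψ t := by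
  simp only [lineSlash_apply]; ring

/-- The slash action commutes with scalars. [cite: BruggemanLewisZagier2015, (2.1) p. 11] -/
theorem lineSlash_const_mul (s : ℂ) (g : GL (Fin 2) ℝ) (c : ℂ) (φ : ℝ → ℂ) (t : ℝ) :
    lineSlash s g (fun x => c * φ x) t = c * lineSlash s g φ t := by
  simp only [lineSlash_apply]; ring

/-- The slash action commutes with negation. [cite: BruggemanLewisZagier2015, (2.1) p. 11] -/
theorem lineSlash_fun_neg (s : ℂ) (g : GL (Fin 2) ℝ) (φ : ℝ → ℂ) (t : ℝ) :
    lineSlash s g (fun x => -φ x) t = -lineSlash s g φ t := by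
  simp only [lineSlash_apply]; ring

/-- The real differential of `f : ℂ → ℂ` in Wirtinger form: `Df(w)h = ∂f h + ∂̄f h̄`. [folklore] -/
theorem fderiv_apply_eq_wirtinger (f : ℂ → ℂ) (w h : ℂ) :
    fderiv ℝ f w h = wirtingerDz f w * h + wirtingerDzbar f w * conj h := by
  rw [clm_apply_eq_wirtinger (fderiv ℝ f w) h, wirtingerDz, wirtingerDzbar]

/-- **`[P, Q] + [Q, P] = d(PQ)`**, integrated: for `P`, `Q` of class `C²` on an open set
containing the segment, `∫_a^b [P, Q] + ∫_a^b [Q, P] = P(b)Q(b) - P(a)Q(a)`.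
[cite: BruggemanLewisZagier2015, (1.9) p. 11] -/
theorem greenSegmentIntegral_add_swap {P Q : ℂ → ℂ} {O : Set ℂ} (hO : IsOpen O)
    (hP : ContDiffOn ℝ 2 P O) (hQ : ContDiffOn ℝ 2 Q O) {a b : ℂ}
    (hseg : ∀ τ ∈ Icc (0 : ℝ) 1, (1 - (τ : ℂ)) * a + (τ : ℂ) * b ∈ O) :
    greenSegmentIntegral P Q a b + greenSegmentIntegral Q P a b = P b * Q b - P a * Q a := by
  set ℓ : ℝ → ℂ := fun τ => (1 - (τ : ℂ)) * a + (τ : ℂ) * b with hℓ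
  have hℓd : ∀ τ : ℝ, HasDerivAt ℓ (b - a) τ := by
    intro τ
    simp only [hℓ]
    have h1 : HasDerivAt (fun τ : ℝ => (τ : ℂ)) 1 τ := Complex.ofRealCLM.hasDerivAt
    have := ((h1.const_sub 1).mul_const a).add (h1.mul_const b)
    exact this.congr_deriv (by ring)
  -- continuity of the two integrands on `[0, 1]`
  have hcont : ∀ {U V : ℂ → ℂ}, ContDiffOn ℝ 2 U O → ContDiffOn ℝ 2 V O →
      ContinuousOn (fun τ : ℝ => greenForm U V (ℓ τ) (b - a)) (Icc 0 1) := by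
    intro U V hU hV
    have hℓc : Continuous ℓ := continuous_segmentMap a b
    have hmaps : MapsTo ℓ (Icc 0 1) O := hseg
    have h1 := (continuousOn_wirtingerDz hO hU).comp hℓc.continuousOn hmaps
    have h2 := hV.continuousOn.comp hℓc.continuousOn hmaps
    have h3 := hU.continuousOn.comp hℓc.continuousOn hmaps
    have h4 := (continuousOn_wirtingerDzbar hO hV).comp hℓc.continuousOn hmaps
    simp only [greenForm]
    exact ((h1.mul h2).mul continuousOn_const).add ((h3.mul h4).mul continuousOn_const)
  -- the derivative of `τ ↦ P(ℓ τ) Q(ℓ τ)`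
  have hderiv : ∀ τ ∈ uIcc (0 : ℝ) 1, HasDerivAt (fun τ => P (ℓ τ) * Q (ℓ τ))
      (greenForm P Q (ℓ τ) (b - a) + greenForm Q P (ℓ τ) (b - a)) τ := by
    intro τ hτ
    rw [uIcc_of_le zero_le_one] at hτ
    have hmem : ℓ τ ∈ O := hseg τ hτ
    have hPd : DifferentiableAt ℝ P (ℓ τ) := (hP.differentiableOn two_ne_zero).differentiableAt (hO.mem_nhds hmem)
    have hQd : DifferentiableAt ℝ Q (ℓ τ) := (hQ.differentiableOn two_ne_zero).differentiableAt (hO.mem_nhds hmem)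
    have h1 : HasDerivAt (fun τ => P (ℓ τ)) (fderiv ℝ P (ℓ τ) (b - a)) τ :=
      hPd.hasFDerivAt.comp_hasDerivAt τ (hℓd τ)
    have h2 : HasDerivAt (fun τ => Q (ℓ τ)) (fderiv ℝ Q (ℓ τ) (b - a)) τ :=
      hQd.hasFDerivAt.comp_hasDerivAt τ (hℓd τ)
    have := h1.mul h2
    refine this.congr_deriv ?_
    rw [fderiv_apply_eq_wirtinger, fderiv_apply_eq_wirtinger]
    simp only [greenForm]
    ring
  have hint : IntervalIntegrable (fun τ => greenForm P Q (ℓ τ) (b - a) + greenForm Q P (ℓ τ) (b - a))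
      volume 0 1 := by
    apply ContinuousOn.intervalIntegrable
    rw [uIcc_of_le zero_le_one]
    exact (hcont hP hQ).add (hcont hQ hP)
  have hFTC := intervalIntegral.integral_eq_sub_of_hasDerivAt hderiv hint
  unfold greenSegmentIntegral
  rw [← intervalIntegral.integral_add]
  · simp only [hℓ] at hFTC ⊢
    rw [hFTC]
    simp
  · exact (hcont hP hQ).intervalIntegrable_of_Icc zero_le_one
  · exact (hcont hQ hP).intervalIntegrable_of_Icc zero_le_one

/-- **The conjugated period cocycle.** For `u ∈ E_s^Γ` (`s ≠ 0, 1`):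
`r_γ[ū, s̄](t) = -conj (r_γ[u, s](t)) + ū(z₀) R_t(z₀)^{s̄} - ū(γ⁻¹ z₀) R_t(γ⁻¹ z₀)^{s̄}`.
[cite: BruggemanLewisZagier2015, (5.5a) p. 29] -/
theorem lewisZagierCocycle_conj (hu : IsInvariantEigenfunction Γ s u) (z₀ : ℍ) (γ : GL (Fin 2) ℝ)
    (t : ℝ) :
    lewisZagierCocycle (conj s) z₀ (fun z => conj (u z)) γ t =
      -conj (lewisZagierCocycle s z₀ u γ t) +
        (conj (u z₀) * hypPoissonKernelCpow (conj s) t z₀ -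
          conj (u (γ⁻¹ • z₀)) * hypPoissonKernelCpow (conj s) t ((γ⁻¹ • z₀ : ℍ) : ℂ)) := by
  simp only [lewisZagierCocycle, greenPeriod]
  rw [conj_greenSegmentIntegral]
  rw [greenSegmentIntegral_congr_upperHalfPlane (U' := hypPoissonKernelCpow (conj s) t)
    (V' := fun z => conj ((u ∘ ofComplex) z))
    (fun z hz => conj_hypPoissonKernelCpow s t hz) (fun z _ => rfl) (γ⁻¹ • z₀) z₀]
  -- `∫ [P, Q] + ∫ [Q, P] = PQ |_{a}^{b}` with `P = ū`, `Q = R_t^{s̄}` on `ℍ`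
  have hO : IsOpen {z : ℂ | 0 < z.im} := isOpen_upperHalfPlaneSet
  have hP : ContDiffOn ℝ 2 ((fun z => conj (u z)) ∘ ofComplex) {z : ℂ | 0 < z.im} := hu.conj.isC2
  have hQ : ContDiffOn ℝ 2 (hypPoissonKernelCpow (conj s) t) {z : ℂ | 0 < z.im} :=
    contDiffOn_hypPoissonKernelCpow (conj s) t
  have hseg : ∀ τ ∈ Icc (0 : ℝ) 1, (1 - (τ : ℂ)) * ((γ⁻¹ • z₀ : ℍ) : ℂ) + (τ : ℂ) * (z₀ : ℂ) ∈
      {z : ℂ | 0 < z.im} := fun τ hτ =>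
    im_pos_of_segment (γ⁻¹ • z₀).coe_im_pos z₀.coe_im_pos hτ
  have hswap := greenSegmentIntegral_add_swap hO hP hQ hseg
  have e1 : ((fun z => conj (u z)) ∘ ofComplex) (z₀ : ℂ) = conj (u z₀) := by
    simp [UpperHalfPlane.ofComplex_apply]
  have e2 : ((fun z => conj (u z)) ∘ ofComplex) ((γ⁻¹ • z₀ : ℍ) : ℂ) = conj (u (γ⁻¹ • z₀)) := by
    simp [UpperHalfPlane.ofComplex_apply]
  rw [e1, e2] at hswap
  have hU : (fun z => conj ((u ∘ ofComplex) z)) = (fun z => conj (u z)) ∘ ofComplex := by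
    funext z; rfl
  rw [hU]
  linear_combination hswap

/-- **`κ(t) = R_t(z₀)^{s̄}` transforms by `κ|_{s̄} γ = R_t(γ⁻¹ z₀)^{s̄}`** for `det γ = 1` off the
pole ((2.25)). [cite: BruggemanLewisZagier2015, (2.25) p. 16] -/
theorem lineSlash_hypPoissonKernelCpow {γ : GL (Fin 2) ℝ} (hdet : γ.det.val = 1) (s : ℂ) (z₀ : ℍ)
    {t : ℝ} (ht : γ 1 0 * t + γ 1 1 ≠ 0) :
    lineSlash s γ (fun x => hypPoissonKernelCpow s x z₀) t =
      hypPoissonKernelCpow s t ((γ⁻¹ • z₀ : ℍ) : ℂ) := by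
  have hpos : 0 < γ.det.val := by rw [hdet]; exact one_pos
  rw [lineSlash_apply]
  have h := hypPoissonKernelCpow_glSmul s hpos (γ⁻¹ • z₀) ht
  rw [smul_inv_smul, hdet] at h
  rw [h]
  simp

/-- **The conjugate coboundary hypothesis.** If `r_γ[u, s] = φ|γ - φ` off finite sets for all
`γ ∈ Γ`, then with `φ̃ = -conj ∘ φ - ū(z₀) κ` one has `r_γ[ū, s̄] = φ̃|γ - φ̃` off finite sets.
[cite: BruggemanLewisZagier2015, Proposition 5.1 pp. 30–31] -/
theorem conj_coboundary_hypothesis [hΓ : Γ.HasDetOne] (hu : IsInvariantEigenfunction Γ s u)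
    (z₀ : ℍ) {φ : ℝ → ℂ}
    (hcb : ∀ γ ∈ Γ, ∀ᶠ t : ℝ in cofinite, lewisZagierCocycle s z₀ u γ t = lineSlash s γ φ t - φ t) :
    ∀ γ ∈ Γ, ∀ᶠ t : ℝ in cofinite,
      lewisZagierCocycle (conj s) z₀ (fun z => conj (u z)) γ t =
        lineSlash (conj s) γ (fun x => -conj (φ x) - conj (u z₀) * hypPoissonKernelCpow (conj s) x z₀) t -
          (-conj (φ t) - conj (u z₀) * hypPoissonKernelCpow (conj s) t z₀) := by
  intro γ hγ
  have hdet : γ.det.val = 1 := by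
    have := hΓ.det_eq hγ
    rw [this]; rfl
  filter_upwards [hcb γ hγ, eventually_cofinite_denom_ne_zero hdet] with t ht hp
  rw [lewisZagierCocycle_conj hu z₀ γ t, ht, hu.invariant γ⁻¹ (Γ.inv_mem hγ) z₀]
  have hκ := lineSlash_hypPoissonKernelCpow hdet (conj s) z₀ hp
  -- expand the slash of `φ̃`
  have e : lineSlash (conj s) γ (fun x => -conj (φ x) - conj (u z₀) * hypPoissonKernelCpow (conj s) x z₀) t =
      -lineSlash (conj s) γ (fun x => conj (φ x)) t -
        conj (u z₀) * lineSlash (conj s) γ (fun x => hypPoissonKernelCpow (conj s) x z₀) t := by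
    simp only [lineSlash_apply]; ring
  rw [e, hκ, ← conj_lineSlash, map_sub]
  ring

end ConjugateCoboundary

end Literature.NumberTheory.Automorphic
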